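import Summits.Langlands.Langlands.Theses.IrreducibilityBySelfDuality
import Literature.NumberTheory.Automorphic.GLOneArchParameterOfAlgebraicCharacter
import Literature.NumberTheory.GaloisRepresentations.HeckeCharacterArchType
import Literature.NumberTheory.GaloisRepresentations.AlgebraicHeckeCharacterPurity
import Literature.NumberTheory.Automorphic.HarishChandraGLParameterOfCharacter

/-!
# Disproof workfile for crux `HalfIntegralTwistCM` (stmt-Langlands-14036) — standing adversary

Route `route-Langlands-IrreducibilityBySelfDuality`, decl
`Summit.Langlands.Langlands.Theses.IrreducibilityBySelfDuality.HalfIntegralTwistCM` (crux, rank 4):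
for `K` CM and exponent functions `s₁ s₂ : (K →+* ℂ) → ℂ` with (i) `s₁ - s₂ ∈ ℤ`, (ii)
`s₁ ι - s₁ ῑ ∈ ℤ`, (iii) `(s₁-s₂) ι + (s₁-s₂) ῑ ∈ 2ℤ`, (iv) a `GL₁` datum `ω` with archimedean parameter
`{s₁ ι + s₂ ι}`, there is a `GL₁` datum `χ` with parameter `{p ι}`, `p ι + s₁ ι ∈ 1/2 + ℤ`.

## Findings (cycle 1, refuter-cdisprove-stmt-Langlands-14036-0, 2026-08-16; gen 2 additions F9– by
## refuter-cdisprove-stmt-Langlands-14036-g2-0, 2026-08-16)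

* **F0 (elaboration / semantics).** The decl elaborates (probe rc 0, one sorry). Read back: `K : Type`
  with Mathlib's genuine `NumberField.IsCMField` (totally complex + quadratic over `K⁺`);
  `CuspidalAutomorphicRepData 1 K h1` = Borel–Jacquet data on `GL₁` (the cusp condition `0 < k < 1` is
  EMPTY, so these are all automorphic `GL₁` data = idele class characters, `exists_heckeCharacter_glOne`
  / `exists_automorphicRepData_detTwist_glOne`, both PROVED); `HasArchParameter` is PINNED (no junk):
  the Lie action on the line `W/W'` is unique (`hasLieAction_unique`), Harish-Chandra existence and
  isomorphism are proved (`HasHCParameter.unique`), so every `GL₁` datum has exactly one parameter,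
  a family of singletons (`exists_hasArchParameter_glOne`, `hasArchParameter_unique`); `1 / 2 : ℂ` is the
  genuine half. No coercion / junk-operator / quantifier slip. VERDICT ON PAPER: TRUE as typed (Weil's
  unit criterion in both directions + `[𝓞_Kˣ : 𝓞_{K⁺}ˣ μ_K] < ∞` for CM `K`; the `Im`-parts of the
  exponents impose only a lattice condition, preserved by halving after passing to squares of units).
  No Lean counter-model: the statement is true; this file records WHY each hypothesis is needed.
* **F1 (§2, sorry-free, any `K`).** For every `GL₁` datum the parameter at a complex place is
  `({p}, {q})` at `(σ_w, σ̄_w)` with `χ_π(det(exp a_w, 1)) = e^{a p + ā q}`; hence `p - q ∈ ℤ`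
  (`archParam_embedding_sub_conj_mem_int_glOne`) and `p - q = m_w` for a character of unitary
  archimedean type `(m, t)` (`archParam_sub_conj_eq_of_hasUnitaryArchType`).
* **F2 (§3: hypothesis (ii) is LOAD-BEARING — kernel-checked modulo Weil).**
  `halfIntegralTwistCM_false_without_conjInt : Patrikis2019_heckeCharacter_archType_iff_units → ¬ HalfIntegralTwistCMWithoutConjInt`
  (axioms `propext, Classical.choice, Quot.sound`). Witness `K = ℚ(ζ₃)`, `ω = π_ψ`, `ψ_∞ = z/|z|`,
  `s₁ = s₂ = (p/2, q/2)` with `p - q = 1`: (i), (iii), (iv) hold, (ii) fails by exactly `1/2`, and no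
  re-twist exists by F1. The hypothesis of the theorem is the SAME named fact (Weil 1956 / Patrikis
  Lemma 2.1.1) that the positive proof consumes, so this is the honest "any proof must use (ii)".
* **F3 (mutations on paper, for the prover).** (a) Hypothesis (i) is REDUNDANT given (ii)+(iii)+(iv):
  with `e = s₁ + s₂`, `s₁ ι + s₁ ῑ = (e ι + e ῑ)/2 + ((s₁-s₂) ι + (s₁-s₂) ῑ)/2` and only this sum and
  `s₁ ι - s₁ ῑ` enter Weil's unit condition for `χ_∞ = ∏ z^{1/2-s₁+N}`. (b) Hypothesis (iii) can be
  WEAKENED to "the parity of `(s₁-s₂) ι + (s₁-s₂) ῑ` is the same at every complex place" (uniform odd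
  parity shifts `Re(p_w + p_w̄)` by the same `1/2` everywhere, still parallel); mixed parity is fatal as
  soon as `[K:ℚ] ≥ 4` (cf. the sibling `RegularTwistCM` Disproof, `cmParity_obstructed`). (c) The
  conclusion CANNOT be strengthened to "`χ` unitary" or "`p` real" (take `ω` with `Im e ≠ 0`, Maass
  type; the half-twist inherits `Im p = -Im s₁`). (d) `IsCMField` is SUFFICIENT, NOT NECESSARY: the
  statement also holds for `K = ℚ` and `K` imaginary quadratic (unit rank `0`); it FAILS for any `K`
  with two real places (§4) and for totally imaginary non-CM `K` (Patrikis Lemma 2.1.5).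
* **F4 (§4: `IsCMField` is LOAD-BEARING — kernel-checked, UNCONDITIONAL).**
  `halfIntegralTwistCM_false_without_isCMField : ¬ HalfIntegralTwistCMWithoutIsCMField` (axioms
  `propext, Classical.choice, Quot.sound`; witness `K = ℚ(ζ₅)⁺ = ℚ(√5)`, `ω = π_𝟙`,
  `s₁ = (0, 1/2)`, `s₂ = -s₁`). The obstruction is analytic and proved in the tree: `|θ| = ‖·‖^σ` for
  every idele class character, so the real parts of the exponents of ANY `GL₁` datum are parallel
  (`exists_re_archParam_parallel_glOne`), while the conclusion asks for `Re c_{w₁} ∈ 1/2 + ℤ`,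
  `Re c_{w₂} ∈ ℤ` at two real places. Holds verbatim for every `K` with two real places
  (`…_of_two_real_places`).
* **F4' (§5, for the prover).** `archParam_of_hasUnitaryArchType` (full parameter of `π_θ`, `θ` of unitary
  type) + a PROOF PLAN in the §5 docstring that needs only the (⇐) half of Weil's named fact: the unit
  condition for the half-twist is read off `ω` through `exists_level_glOne` (proved) and §2, never
  through the unformalised necessity half of `Patrikis2019_heckeCharacter_archType_iff_units`.
* **F6 (§6: hypothesis (iii) is LOAD-BEARING in its parity content — kernel-checked modulo Weil).**
  `halfIntegralTwistCM_false_without_parity : Patrikis2019_heckeCharacter_archType_iff_units →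
  ¬ HalfIntegralTwistCMWithoutParity` (axioms standard; witness `K = ℚ(ζ₅)`, `ψ_{w₁} = z/|z|`, `ψ_{w₂} = 1`,
  `s₁ = e + (1/4)𝟙_{w₁}`, `s₂ = -(1/4)𝟙_{w₁}`: parity odd at `w₁`, even at `w₂`). Holds verbatim over every
  CM field with two complex places (`…_of_two_complex_places`); the unit condition for the angular type
  is `unitCondition_angular_of_isCMField` (`(ι u/|ι u|)² = ι(u ū⁻¹) ∈ μ(K)`, Mathlib
  `IsCMField.unitsMulComplexConjInv`). With F3(b): the honest (iii) is UNIFORM parity.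
* **F7 (§7: hypothesis (iv) is LOAD-BEARING — kernel-checked, UNCONDITIONAL).**
  `halfIntegralTwistCM_false_without_datum : ¬ HalfIntegralTwistCMWithoutDatum` (witness `ℚ(ζ₅)`,
  `s₁ = s₂ = (1/4)𝟙_{w₁}`): automorphy of `s₁ + s₂` is what makes `Re (s₁ σ + s₁ σ̄)` place-independent.
* **Summary of the load-bearing census.** (i) redundant (paper, F3(a)); (ii) necessary (F2, modulo Weil);
  (iii) necessary as uniform parity (F6, modulo Weil); (iv) necessary (F7, unconditional); `IsCMField`
  necessary as "no real place" (F4, unconditional) AND as "not merely totally complex" (F11, unconditional)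
  — and sufficient but not necessary (F3(d): `ℚ`, imaginary quadratic). Conclusion: shifts necessary and
  non-uniform (F9). Toolkit: Weil necessity `unit_relation_glOne` (F10).
* **F8 (§8: non-vacuity, unconditional).** `hypotheses_satisfiable`: (i)–(iv) hold over `ℚ(ζ₅)` with
  `s₁ = s₂ = 0`, `ω = π_𝟙` — no proof of the crux by `False.elim` on its hypotheses.
* **F9 (§9, gen 2: natural strengthenings refuted — sorry-free, UNCONDITIONAL).**
  `not_halfIntegralTwistCMUniformShift : ¬ HalfIntegralTwistCMUniformShift` (conclusion `∃ χ N, χ` has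
  parameter `{1/2 - s₁ ι + N}` with ONE integer `N`) and `not_halfIntegralTwistCMExact` (`N = 0`), witness
  `ℚ(ζ₅)`, `s₁ = (1/2)𝟙_{w₁}`, `s₂ = -s₁`, `ω = π_𝟙`: the shifts `N_ι` of the one-page proof are NECESSARY
  and must DEPEND on `ι` (`N_{σ_w} + N_{σ̄_w} = j_w + const`, `j_w = ((s₁-s₂) σ_w + (s₁-s₂) σ̄_w)/2`). A stub
  fixing `p := 1/2 - s₁` or a uniform shift is false. Landed: `Negative/ExactShift.lean`.
* **F10 (§10, gen 2: Weil NECESSITY — sorry-free, any number field, NO named fact).** `unit_relation_glOne`: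
  for a `GL₁` datum with parameter `P` there is `M ≥ 1` with
  `exp (M (∑_{w real} c_w log|u|_w + ∑_{w cplx} (a_w p_w + ā_w q_w))) = 1` for EVERY unit `u` and EVERY
  choice of logarithms `e^{a_w} = σ_w(u)` (`θ((u^M)_∞,1) = 1` via `exists_isModulus` + `map_principalIdele_eq`,
  and the exponential formula `heckeCharacter_infiniteIdeles_eq_exp_sum` for `θ_∞`, all places at once). This is
  STUB 1 `necessity_weilForm` of card torsion-blind-unit-criterion in exponent form (bridge to Weil's
  `archUnitaryValue` form: the ideator's `exp_linear_eq_norm_cpow_mul_archUnitaryValue`). Landed: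
  `Negative/UnitRelation.lean`. **F10b (§10b).** `unit_relation_weilForm_glOne` = that stub VERBATIM
  (`(∏_w archUnitaryValue (m_w) (Im(e σ_w + e σ̄_w)) (σ_w α))^M = 1` for all units), for every TOTALLY COMPLEX
  `K`, no named fact (landed: `Negative/UnitRelationWeilForm.lean`).
* **F11 (§11, gen 2: `IsCMField` CANNOT be weakened to `IsTotallyComplex` — sorry-free, UNCONDITIONAL).**
  `halfIntegralTwistCM_false_of_isTotallyComplex : ¬ HalfIntegralTwistCMTotallyComplex`; witness the non-CM
  totally imaginary `S₃`-sextic `K₆ = ℚ(ζ₃, ∛2)` (`SplittingField (X³ - 2)`), `s₁ = (1/2)𝟙_{mk ι₀}`,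
  `s₂ = -s₁`, `ω = π_𝟙`. Mechanism (Patrikis L.2.1.5 made explicit): parallel weights + F10 at the unit
  `ε₁ = 1 + ζ∛2 + ζ²∛4` give `exp ((log A - log Ā)(2m+1) M / 2) = 1`, so `A^N = Ā^N` (`A = ι₀ ε₁`, `N ≥ 1`),
  i.e. `ε₁^N = ε₂^N`; the transposition `(γ₁ γ₀)` of `Gal ≅ S₃` turns it into `E^N = |A|^N`, `E³ = E|A|² = 1`,
  contradicting `E = 1 + ∛2 + ∛4 > 1`. So the CM input of the positive proof is PRECISELY "`ε/ε̄` is a root of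
  unity for every unit" (Mathlib `IsCMField.unitsMulComplexConjInv`), not merely "no real place". With F4:
  `IsCMField` is load-bearing at BOTH ends (modulus at real places; angles at complex places of non-CM fields).
  Landed: `Negative/SexticDefs.lean` (+ `SexticRoots`, `SexticPlaces`, `TotallyComplexNonCM`). **F11b (§11b).**
  `not_weilHypothesis_blind_of_isTotallyComplex`: the CM-blindness lever `(m, t) ↦ (m', t/2)` of card
  torsion-blind-unit-criterion (`weilHypothesis_blind_halve`, proved there for CM `K`) FAILS over `K₆`
  (Weil's hypothesis holds for the type `(0,0)` but not for `(𝟙_{mk ι₀}, 0)`): any line using blindness MUST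
  keep `IsCMField` (not just total complexity) among its hypotheses.
* **F5 (negatives / barriers).** `ledger negatives --problem Langlands` and the barrier catalogue
  `Literature/Barriers/Langlands/` contain nothing on archimedean re-twisting of Hecke characters;
  nearest printed statements: Patrikis arXiv:1207.6724 Lemma 2.1.1 (Weil), Prop. 1.3.1 (CM lifts exist),
  Lemma 2.1.5 / Prop. 1.3.3 (the real-place obstruction) — all CONSISTENT with the crux.

## Targets
`payload.targets` / `stuck_stubs` empty (no line picked yet). On re-arm: the lemmas of §2 and §4 are
the templates for killing any stub that (a) forgets `p σ - p σ̄ ∈ ℤ`, (b) asks for a unitary / real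
re-twist, (c) drops the CM hypothesis, or (d) treats `Im` of the exponents as place-independent.
-/

-- Mathlib idiom (Mathlib/Algebra/Lie/OfAssociative.lean): commutator bracket on matrices, needed to
-- mention `𝔤 →ₗ⁅ℝ⁆ End V` (as in `AutomorphicRepsGLOneArchParameter`)
attribute [local instance 100] LieRing.ofAssociativeRing

set_option linter.dupNamespace false

noncomputable section

open scoped MatrixGroups Matrix Classical NumberField ComplexConjugate
open NumberField NumberField.InfinitePlace NumberField.mixedEmbedding IsDedekindDomain

namespace Summit.Langlands.Langlands.Cruxes.HalfIntegralTwistCM.Disproof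

open Literature.NumberTheory.Automorphic
open Literature.NumberTheory.GaloisRepresentations

/-! ## §1 The crux, by name -/

/-- The crux under attack, by name (definitionally the route decl). [folklore] -/
abbrev Crux : Prop := Summit.Langlands.Langlands.Theses.IrreducibilityBySelfDuality.HalfIntegralTwistCM

/-! ## §2 The archimedean parameter of a `GL₁` datum at a complex place (sorry-free)

For ANY number field `K` and ANY automorphic representation `π = W / W'` of `GL₁(𝔸_K)` in the
tree's Borel–Jacquet model: the archimedean parameter at a complex place `w` is `{p}` at `σ_w` and
`{q}` at `σ̄_w`, and the Hecke character `χ_π` of `π` satisfies `χ_π(det (exp a_w, 1)) = e^{a p + ā q}`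
(`heckeCharacter_glOne_det_ofArch_expMem` + Harish-Chandra clauses). Consequences:
`p - q ∈ ℤ` always (`exp (2πi)_w = 1`), and `p - q = m_w` when `χ_π` has unitary archimedean type
`(m, t)`. -/

variable {K : Type} [Field K] [NumberField K] {hcpt : isCompact_glFiniteIntegralLevel 1 K}

/-- **Core computation.** Let `π = W / W'` be an automorphic representation of `GL₁(𝔸_K)` with Hecke
character `χ` (`r(g) φ - χ(det g) φ ∈ W'`) and archimedean parameter `P`, and let `w` be a complex
place. Then `P σ_w = {p}`, `P σ̄_w = {q}` and `χ(det (exp a_w, 1)) = e^{a p + ā q}` for every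
`a ∈ ℂ = K_w` (`a_w ∈ 𝔤𝔩₁(K_∞)` the matrix `a` at `w`, `0` elsewhere). Gelbart 1975, §2.A;
Clozel 1990, §3.3; Knapp 2002, Thm. 5.44. [cite: Clozel1990, §3.3] -/
theorem archParam_complexPlace_glOne
    (π : AutomorphicRepData (AutomorphyDatum.gl 1 K hcpt)) {χ : HeckeCharacter K}
    (hχ : ∀ (g : (AdelicGroupData.gl 1 K).Adelic), ∀ φ ∈ π.W,
      rightTranslation (AdelicGroupData.gl 1 K) g φ -
        ((χ (Matrix.GeneralLinearGroup.det g) : ℂˣ) : ℂ) • φ ∈ π.W')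
    {P : (K →+* ℂ) → Multiset ℂ} (hP : π.HasArchParameter P)
    (w : {w : InfinitePlace K // w.IsComplex}) :
    ∃ p q : ℂ, P w.1.embedding = {p} ∧ P (ComplexEmbedding.conjugate w.1.embedding) = {q} ∧
      ∀ a : ℂ, ((χ (Matrix.GeneralLinearGroup.det (GLn.ofInfinite 1 K
        (expGL (complexPlaceLie 1 w (a • (1 : Matrix (Fin 1) (Fin 1) ℂ)))))) : ℂˣ) : ℂ) =
          Complex.exp (a * p + conj a * q) := by
  classical
  -- the Lie algebra acts on the line `W / W'` through the real linear form `d'`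
  obtain ⟨ρ, hρ⟩ := π.exists_hasLieAction_gl
  obtain ⟨d', hd'⟩ := π.exists_linearMap_lieAction_eq_smul_one_glOne ρ
  -- the link `χ(det (exp Y, 1)) = e^{d'(Y)}`
  have hlink : ∀ Y : Matrix (Fin 1) (Fin 1) (mixedSpace K),
      ((χ (Matrix.GeneralLinearGroup.det (GLn.ofInfinite 1 K (expGL Y))) : ℂˣ) : ℂ) =
        Complex.exp (d' ⟨Y, trivial⟩) := by
    intro Y
    have h := π.heckeCharacter_glOne_det_ofArch_expMem hχ ⟨Y, trivial⟩
      (fun φ hφ => π.lieDeriv_sub_smul_mem_of_hasLieAction_glOne hρ hd' ⟨Y, trivial⟩ hφ) 1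
    rw [one_smul, Complex.ofReal_one, one_mul] at h
    exact h
  -- the clauses of the archimedean parameter at the complex place `w`
  obtain ⟨-, hco⟩ := π.archParameter_clauses_glOne hρ d' hd' hP
  -- the real linear form `L(b) = d'(b_w)` and its decomposition along `τ ∈ {id, conj}`
  let L : ℂ →ₗ[ℝ] ℂ :=
    { toFun := fun b => d' ⟨complexPlaceLie 1 w (b • (1 : Matrix (Fin 1) (Fin 1) ℂ)), trivial⟩
      map_add' := fun b c => by
        have : complexPlaceLie 1 w ((b + c) • (1 : Matrix (Fin 1) (Fin 1) ℂ)) =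
            complexPlaceLie 1 w (b • (1 : Matrix (Fin 1) (Fin 1) ℂ)) +
              complexPlaceLie 1 w (c • (1 : Matrix (Fin 1) (Fin 1) ℂ)) := by
          rw [add_smul, map_add]
        rw [← map_add]
        exact congrArg d' (Subtype.ext this)
      map_smul' := fun r b => by
        have : complexPlaceLie 1 w ((r • b) • (1 : Matrix (Fin 1) (Fin 1) ℂ)) =
            r • complexPlaceLie 1 w (b • (1 : Matrix (Fin 1) (Fin 1) ℂ)) := by
          rw [smul_assoc, map_smul]
        rw [RingHom.id_apply, ← map_smul]
        exact congrArg d' (Subtype.ext this) }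
  have hL : ∀ b : ℂ, L b = d' ⟨complexPlaceLie 1 w (b • (1 : Matrix (Fin 1) (Fin 1) ℂ)), trivial⟩ :=
    fun b => rfl
  set p : ℂ := HCEmb.proj (L : ℂ → ℂ) (AlgHom.id ℝ ℂ) 1 with hp
  set q : ℂ := HCEmb.proj (L : ℂ → ℂ) (Complex.conjAe : ℂ →ₐ[ℝ] ℂ) 1 with hq
  have hsum : ∀ a : ℂ, L a = a * p + conj a * q := by
    intro a
    have h := HCEmb.sum_proj (𝕜 := ℂ) L.toAddMonoidHom a
    rw [LinearMap.toAddMonoidHom_coe] at h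
    rw [← h]
    obtain ⟨huniv, hne⟩ := univ_algHom_complex_eq
    rw [huniv, Finset.sum_pair hne]
    have h1 := HCEmb.proj_smul L (AlgHom.id ℝ ℂ) a (1 : ℂ)
    have h2 := HCEmb.proj_smul L (Complex.conjAe : ℂ →ₐ[ℝ] ℂ) a (1 : ℂ)
    rw [smul_eq_mul, mul_one, smul_eq_mul] at h1 h2
    rw [h1, h2]
    rfl
  refine ⟨p, q, ?_, ?_, fun a => ?_⟩
  · have h := hco w (AlgHom.id ℝ ℂ)
    rwa [algHomId_toRingHom_comp] at h
  · have h := hco w (Complex.conjAe : ℂ →ₐ[ℝ] ℂ)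
    rwa [conjAe_toRingHom_comp] at h
  · rw [hlink, show d' ⟨complexPlaceLie 1 w (a • (1 : Matrix (Fin 1) (Fin 1) ℂ)), trivial⟩ = L a
      from rfl, hsum]

/-- The idele `det (exp a_w, 1)` has coordinates `e^a` at `w` and `1` elsewhere; in particular it is
`1` for `a = 2πi`. [folklore] -/
theorem det_ofInfinite_expGL_two_pi_I (w : {w : InfinitePlace K // w.IsComplex}) :
    Matrix.GeneralLinearGroup.det (GLn.ofInfinite 1 K
      (expGL (complexPlaceLie 1 w ((2 * Real.pi * Complex.I : ℂ) • (1 : Matrix (Fin 1) (Fin 1) ℂ))))) = 1 := by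
  refine idele_eq_of_snd_eq_of_extensionEmbedding_eq K ?_ fun w' => ?_
  · rw [det_ofInfinite_snd]
    rfl
  · rw [extensionEmbedding_det_ofInfinite_expGL_complexPlaceLie]
    have h1 : Completion.extensionEmbedding w'
        (((1 : (AdeleRing (𝓞 K) K)ˣ) : AdeleRing (𝓞 K) K).1 w') = 1 := by
      rw [Units.val_one]
      exact map_one _
    rw [h1]
    split_ifs
    · exact Complex.exp_two_pi_mul_I
    · rfl

/-- **Conjugate exponents of a `GL₁` datum differ by an integer.** If `π = W / W'` is an automorphic
representation of `GL₁(𝔸_K)` (ANY number field `K`) with archimedean parameter `P`, then at every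
complex place `w`, `P σ_w = {p}` and `P σ̄_w = {q}` with `p - q ∈ ℤ` (the restriction of `π_w` to
the circle is `z ↦ z^{p-q}`; here: `1 = χ_π(det (exp (2πi)_w, 1)) = e^{2πi (p - q)}`). This is the
constraint that makes hypothesis (ii) of the crux load-bearing. Tate (1950), §2.3 (quasi-characters
of `ℂˣ`); Clozel 1990, §3.3. [cite: TateThesis1967, §2.3] -/
theorem archParam_embedding_sub_conj_mem_int_glOne
    (π : AutomorphicRepData (AutomorphyDatum.gl 1 K hcpt)) {P : (K →+* ℂ) → Multiset ℂ}
    (hP : π.HasArchParameter P) (w : {w : InfinitePlace K // w.IsComplex}) :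
    ∃ (p q : ℂ) (m : ℤ), P w.1.embedding = {p} ∧
      P (ComplexEmbedding.conjugate w.1.embedding) = {q} ∧ p - q = m := by
  obtain ⟨χ, hχ⟩ := π.exists_heckeCharacter_glOne
  obtain ⟨p, q, hPp, hPq, hval⟩ := archParam_complexPlace_glOne π hχ hP w
  -- `e^{2πi (p - q)} = 1`
  have hexp : Complex.exp (2 * Real.pi * Complex.I * (p - q)) = 1 := by
    have h := hval (2 * Real.pi * Complex.I)
    rw [det_ofInfinite_expGL_two_pi_I, map_one, Units.val_one] at h
    rw [h]
    congr 1
    rw [map_mul, map_mul, Complex.conj_ofReal, Complex.conj_I, map_ofNat]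
    ring
  obtain ⟨m, hm⟩ := Complex.exp_eq_one_iff.1 hexp
  refine ⟨p, q, m, hPp, hPq, ?_⟩
  have h2pi : (2 * Real.pi * Complex.I : ℂ) ≠ 0 := by
    simp [Real.pi_ne_zero, Complex.I_ne_zero]
  exact mul_right_cancel₀ h2pi (show (p - q) * (2 * Real.pi * Complex.I) =
    m * (2 * Real.pi * Complex.I) by rw [← hm]; ring)

/-- `archUnitaryValue m t 1 = 1`. [folklore] -/
theorem archUnitaryValue_one (m : ℤ) (t : ℝ) : archUnitaryValue m t 1 = 1 := by
  simp [archUnitaryValue]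

/-- `archUnitaryValue m t (e^{i s}) = e^{i s m}` for real `s` (the angular character of `ℂˣ`).
[folklore] -/
theorem archUnitaryValue_exp_mul_I (m : ℤ) (t : ℝ) (s : ℝ) :
    archUnitaryValue m t (Complex.exp (s * Complex.I)) = Complex.exp (s * Complex.I * m) := by
  unfold archUnitaryValue
  rw [Complex.norm_exp_ofReal_mul_I, Complex.ofReal_one, div_one, Complex.one_cpow, mul_one,
    ← Complex.exp_int_mul]
  congr 1
  ring

/-- **The archimedean parameter of the datum of a Hecke character of unitary archimedean type.**
If the Hecke character `θ` of `π = W / W'` (`r(g) φ - θ(det g) φ ∈ W'`) has unitary archimedean type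
`(m, t)` (`θ((x,1)) = ∏_w (ι_w x_w/|ι_w x_w|)^{m_w} |ι_w x_w|^{i t_w}`), then at a complex place `w` the
archimedean parameter `P` of `π` has `P σ_w = {p}`, `P σ̄_w = {q}` with `p - q = m_w` EXACTLY
(evaluate `θ(det (exp (is)_w, 1)) = e^{is (p - q)}` against `(e^{is}/1)^{m_w} = e^{is m_w}`).
Tate (1950), §2.3; Patrikis 2019, §2.1. [cite: Patrikis2019, §2.1 (display before Lemma 2.1.1)] -/
theorem archParam_sub_conj_eq_of_hasUnitaryArchType
    (π : AutomorphicRepData (AutomorphyDatum.gl 1 K hcpt)) {θ : HeckeCharacter K}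
    (hχ : ∀ (g : (AdelicGroupData.gl 1 K).Adelic), ∀ φ ∈ π.W,
      rightTranslation (AdelicGroupData.gl 1 K) g φ -
        ((θ (Matrix.GeneralLinearGroup.det g) : ℂˣ) : ℂ) • φ ∈ π.W')
    {m : InfinitePlace K → ℤ} {t : InfinitePlace K → ℝ} (hθ : θ.HasUnitaryArchType m t)
    {P : (K →+* ℂ) → Multiset ℂ} (hP : π.HasArchParameter P)
    (w : {w : InfinitePlace K // w.IsComplex}) :
    ∃ p q : ℂ, P w.1.embedding = {p} ∧ P (ComplexEmbedding.conjugate w.1.embedding) = {q} ∧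
      p - q = m w.1 := by
  obtain ⟨p, q, hPp, hPq, hval⟩ := archParam_complexPlace_glOne π hχ hP w
  refine ⟨p, q, hPp, hPq, ?_⟩
  -- `e^{is (p - q)} = e^{is m_w}` for every real `s`
  have key : ∀ s : ℝ, Complex.exp (s * (Complex.I * (p - q))) = Complex.exp (s * (Complex.I * m w.1)) := by
    intro s
    have h := hval (s * Complex.I)
    -- left-hand side through the unitary archimedean type
    have hx := hθ (HeckeCharacter.infPart K (Matrix.GeneralLinearGroup.det (GLn.ofInfinite 1 K
      (expGL (complexPlaceLie 1 w (((s : ℂ) * Complex.I) • (1 : Matrix (Fin 1) (Fin 1) ℂ)))))))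
    rw [infiniteIdeles_infPart_det_ofInfinite_expGL] at hx
    simp only [HeckeCharacter.val_infPart] at hx
    simp_rw [extensionEmbedding_det_ofInfinite_expGL_complexPlaceLie K w] at hx
    rw [Finset.prod_eq_single w.1 (fun w' _ hw' => by rw [if_neg hw', archUnitaryValue_one])
      (fun h => absurd (Finset.mem_univ _) h), if_pos rfl, archUnitaryValue_exp_mul_I] at hx
    rw [hx] at h
    rw [show (s : ℂ) * (Complex.I * (m w.1 : ℂ)) = s * Complex.I * m w.1 by ring, h]
    congr 1
    rw [map_mul, Complex.conj_ofReal, Complex.conj_I]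
    ring
  have e := eq_of_forall_cexp_mul_eq key
  have := mul_left_cancel₀ Complex.I_ne_zero e
  exact this


/-! ## §3 Load-bearing analysis I: hypothesis (ii) `s₁ ι - s₁ ῑ ∈ ℤ` cannot be dropped

`HalfIntegralTwistCMWithoutConjInt` is the route decl copied verbatim with hypothesis (ii) removed. It is FALSE, and the
refutation is a Lean theorem MODULO the named fact `Patrikis2019_heckeCharacter_archType_iff_units`
(Weil 1956 / Patrikis 2019 Lemma 2.1.1, direction "unit condition ⇒ existence"), which is exactly the
input the positive proof of the crux also needs. Witness: `K = ℚ(ζ₃)` (CM, finite unit group),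
`ω` = the datum of a Hecke character `ψ` with `ψ_∞(z) = z/|z|` (exists by Weil: `(u/|u|)^M = 1` for
`M = |𝓞_Kˣ|`), whose parameter is `(p, q)` with `p - q = 1` (§2); `s₁ = s₂ = (p/2 at σ, q/2 at σ̄)`
satisfies (i) (`k = 0`), (iii) (`0`), (iv) (`ω`), violates (ii) (`(p-q)/2 = 1/2`), and the conclusion
fails: a re-twist `χ` would have exponents `P` with `P σ - P σ̄ ≡ -(p - q)/2 = -1/2 (mod ℤ)`,
contradicting §2 (`archParam_embedding_sub_conj_mem_int_glOne`). -/

/-- The crux with hypothesis (ii) (`∀ ι, ∃ m : ℤ, s₁ ι - s₁ ῑ = m`) DROPPED; everything else verbatim.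
[folklore] -/
def HalfIntegralTwistCMWithoutConjInt : Prop :=
  ∀ (K : Type) [Field K] [NumberField K], NumberField.IsCMField K →
    ∀ (h1 : Literature.NumberTheory.Automorphic.isCompact_glFiniteIntegralLevel 1 K)
      (s₁ s₂ : (K →+* ℂ) → ℂ), (∀ ι, ∃ k : ℤ, s₁ ι - s₂ ι = k) →
      (∀ ι, ∃ m : ℤ, (s₁ ι - s₂ ι) + (s₁ (NumberField.ComplexEmbedding.conjugate ι) -
        s₂ (NumberField.ComplexEmbedding.conjugate ι)) = 2 * m) →
      (∃ ω : Literature.NumberTheory.Automorphic.CuspidalAutomorphicRepData 1 K h1,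
        ω.1.HasArchParameter (fun ι => {s₁ ι + s₂ ι})) →
      ∃ (χ : Literature.NumberTheory.Automorphic.CuspidalAutomorphicRepData 1 K h1)
        (p : (K →+* ℂ) → ℂ), χ.1.HasArchParameter (fun ι => {p ι}) ∧
          ∀ ι, ∃ m : ℤ, p ι + s₁ ι - 1 / 2 = m

/-- Sanity: the crux is `HalfIntegralTwistCMWithoutConjInt` plus hypothesis (ii) (pure logic). [folklore] -/
theorem halfIntegralTwistCM_of_withoutConjInt (h : HalfIntegralTwistCMWithoutConjInt) : Crux :=
  fun K _ _ hK h1 s₁ s₂ hi _ hiii hiv => h K hK h1 s₁ s₂ hi hiii hiv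

/-- **The parity obstruction.** If a `GL₁` datum `χ` over `K` has parameter `ι ↦ {P ι}` and, at a
complex place `w`, `P σ_w + e₁/2` and `P σ̄_w + e₂/2` are both in `1/2 + ℤ` while `e₁ - e₂` is an ODD
integer, contradiction (`P σ_w - P σ̄_w ∈ ℤ` by `archParam_embedding_sub_conj_mem_int_glOne`).
[folklore] -/
theorem no_halfIntegralTwist_of_odd
    (χ : AutomorphicRepData (AutomorphyDatum.gl 1 K hcpt)) {P : (K →+* ℂ) → ℂ}
    (hP : χ.HasArchParameter fun ι => {P ι}) (w : {w : InfinitePlace K // w.IsComplex})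
    {e₁ e₂ : ℂ} {k : ℤ} (hodd : e₁ - e₂ = 2 * k + 1)
    (h₁ : ∃ m : ℤ, P w.1.embedding + e₁ / 2 - 1 / 2 = m)
    (h₂ : ∃ m : ℤ, P (ComplexEmbedding.conjugate w.1.embedding) + e₂ / 2 - 1 / 2 = m) : False := by
  obtain ⟨p, q, n, hp, hq, hn⟩ := archParam_embedding_sub_conj_mem_int_glOne χ hP w
  obtain ⟨m₁, hm₁⟩ := h₁
  obtain ⟨m₂, hm₂⟩ := h₂
  have hp' : P w.1.embedding = p := Multiset.singleton_inj.1 hp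
  have hq' : P (ComplexEmbedding.conjugate w.1.embedding) = q := Multiset.singleton_inj.1 hq
  rw [hp'] at hm₁
  rw [hq'] at hm₂
  have key : (2 : ℂ) * (m₁ - m₂ - n - k) = 1 := by
    linear_combination -2 * hm₁ + 2 * hm₂ + 2 * hn + hodd
  have key' : (2 * (m₁ - m₂ - n - k) : ℤ) = 1 := by exact_mod_cast key
  omega

/-! ### The witness field `ℚ(ζ₃)` -/

/-- The third cyclotomic field `ℚ(ζ₃) = ℚ(√-3)`. [folklore] -/
abbrev K₃ : Type := CyclotomicField 3 ℚ

/-- `ℚ(ζ₃)/ℚ` is the cyclotomic extension of level `3` (Mathlib's instance, named). [folklore] -/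
theorem isCyclotomicExtension_K₃ : IsCyclotomicExtension {3} ℚ K₃ :=
  CyclotomicField.isCyclotomicExtension 3 ℚ

/-- `ℚ(ζ₃)` is a CM field (Mathlib: a nontrivial cyclotomic extension of `ℚ` is CM). [folklore] -/
theorem isCMField_K₃ : NumberField.IsCMField K₃ :=
  haveI := isCyclotomicExtension_K₃
  IsCyclotomicExtension.Rat.isCMField K₃ (S := {3}) ⟨3, Set.mem_singleton 3, by norm_num⟩

/-- `ℚ(ζ₃)` has unit rank `0` (one complex place). [folklore] -/
theorem units_rank_K₃ : NumberField.Units.rank K₃ = 0 := by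
  haveI := isCyclotomicExtension_K₃
  dsimp only [NumberField.Units.rank]
  rw [card_eq_nrRealPlaces_add_nrComplexPlaces,
    IsCyclotomicExtension.Rat.nrRealPlaces_eq_zero (n := 3) K₃ (by decide), zero_add,
    IsCyclotomicExtension.Rat.nrComplexPlaces_eq_totient_div_two (n := 3)]
  rfl

/-- **A uniform exponent for the units of `ℚ(ζ₃)`**: `u^M = 1` for all `u ∈ 𝓞_Kˣ` with
`M = |torsion| (= 6)` — the unit group is finite (rank `0`, Dirichlet). [folklore] -/
theorem exists_units_pow_eq_one_K₃ : ∃ M : ℕ, 0 < M ∧ ∀ u : (𝓞 K₃)ˣ, u ^ M = 1 := by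
  refine ⟨Nat.card (NumberField.Units.torsion K₃), Nat.card_pos, fun u => ?_⟩
  obtain ⟨⟨x, e⟩, hxu, -⟩ := NumberField.Units.exist_unique_eq_mul_prod _ u
  replace hxu : u = x := by
    rw [← mul_one x.1, hxu]
    apply congr_arg
    rw [← Finset.prod_empty]
    congr
    rw [Finset.univ_eq_empty_iff, units_rank_K₃]
    infer_instance
  have h := pow_card_eq_one' (G := NumberField.Units.torsion K₃) (x := x)
  rw [hxu]
  exact_mod_cast congrArg Subtype.val h

/-- **Weil's unit condition holds for the angular type `m ≡ 1`, `t ≡ 0` over `ℚ(ζ₃)`**: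
`(∏_w ι_w(u)/|ι_w(u)|)^M = 1` for all units `u`, with `M` as above. [folklore] -/
theorem unitCondition_K₃ : ∃ M : ℕ, 0 < M ∧ ∀ α : (𝓞 K₃)ˣ,
    (∏ w : InfinitePlace K₃, archUnitaryValue ((fun _ => (1 : ℤ)) w) ((fun _ => (0 : ℝ)) w)
      (w.embedding ((α : 𝓞 K₃) : K₃))) ^ M = 1 := by
  obtain ⟨M, hM, hu⟩ := exists_units_pow_eq_one_K₃
  refine ⟨M, hM, fun α => ?_⟩
  rw [← Finset.prod_pow]
  refine Finset.prod_eq_one fun w _ => ?_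
  have hz : w.embedding ((α : 𝓞 K₃) : K₃) ≠ 0 := by
    rw [map_ne_zero]
    exact_mod_cast α.ne_zero
  have hαM : (w.embedding ((α : 𝓞 K₃) : K₃)) ^ M = 1 := by
    rw [← map_pow]
    have : (((α : 𝓞 K₃) : K₃)) ^ M = 1 := by
      have h := hu α
      rw [Units.ext_iff, Units.val_pow_eq_pow_val, Units.val_one] at h
      exact_mod_cast congrArg (algebraMap (𝓞 K₃) K₃) h
    rw [this, map_one]
  unfold archUnitaryValue
  rw [zpow_one, Complex.ofReal_zero, zero_mul, Complex.cpow_zero, mul_one, div_pow, hαM,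
    ← Complex.ofReal_pow, ← norm_pow, hαM, norm_one, Complex.ofReal_one, div_one]

/-- The `GL₁` datum `π_θ = ℂ·(θ∘det)/⊥` of a Hecke character has `θ` as its Hecke character:
`r(g) φ - θ(det g) φ ∈ W'` for all `φ ∈ W`. [folklore] -/
theorem detTwist_datum_heckeCharacter {θ : HeckeCharacter K}
    {π : AutomorphicRepData (AutomorphyDatum.gl 1 K hcpt)}
    (hW : π.W = Submodule.span ℂ {fun g : (AdelicGroupData.gl 1 K).Adelic => (detTwist 1 θ g : ℂ)}) :
    ∀ (g : (AdelicGroupData.gl 1 K).Adelic), ∀ φ ∈ π.W,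
      rightTranslation (AdelicGroupData.gl 1 K) g φ -
        ((θ (Matrix.GeneralLinearGroup.det g) : ℂˣ) : ℂ) • φ ∈ π.W' := by
  intro g φ hφ
  rw [hW] at hφ
  obtain ⟨a, rfl⟩ := Submodule.mem_span_singleton.1 hφ
  have h0 : rightTranslation (AdelicGroupData.gl 1 K) g
      (a • fun g : (AdelicGroupData.gl 1 K).Adelic => (detTwist 1 θ g : ℂ)) -
        ((θ (Matrix.GeneralLinearGroup.det g) : ℂˣ) : ℂ) •
          (a • fun g : (AdelicGroupData.gl 1 K).Adelic => (detTwist 1 θ g : ℂ)) = 0 := by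
    rw [map_smul, rightTranslation_detTwist_glOne, smul_comm, detTwist_apply', sub_self]
  rw [h0]
  exact Submodule.zero_mem _

/-- **Hypothesis (ii) is load-bearing: `HalfIntegralTwistCMWithoutConjInt` is FALSE** (modulo Weil's unit criterion
`Patrikis2019_heckeCharacter_archType_iff_units`, the named fact the positive proof also consumes).
Witness `K = ℚ(ζ₃)`, `ω = π_ψ` with `ψ_∞ = z/|z|`, `s₁ = s₂ = (p/2, q/2)`, `p - q = 1`; see the section
docstring. Any proof of the crux must therefore USE (ii). [cite: Patrikis2019, Lemma 2.1.1] -/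
theorem halfIntegralTwistCM_false_without_conjInt (hW : Patrikis2019_heckeCharacter_archType_iff_units) :
    ¬ HalfIntegralTwistCMWithoutConjInt := by
  intro hC
  -- the Hecke character `ψ` of `ℚ(ζ₃)` with `ψ_∞(z) = z/|z|` (Weil)
  obtain ⟨ψ, -, hψ⟩ := (hW K₃ (fun _ => 1) (fun _ => 0)).2 unitCondition_K₃
  set h1 : isCompact_glFiniteIntegralLevel 1 K₃ := isCompact_glFiniteIntegralLevel_holds 1 K₃ with hh1
  -- its datum `π_ψ = ℂ·(ψ∘det)/⊥`, cuspidal (no parabolic condition in rank one)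
  obtain ⟨τ, hτW, hτW'⟩ := exists_automorphicRepData_detTwist_glOne h1 ψ
  have hcusp : τ.W ≤ cuspFormsGL 1 K₃ h1 := by
    rw [hτW, Submodule.span_le]
    rintro _ rfl
    exact IsCuspFormGL.mem_cuspFormsGL
      ⟨isAutomorphicForm_detTwist_glOne h1 ψ, fun k hk hk1 => absurd hk1 (by omega)⟩
  have hχτ := detTwist_datum_heckeCharacter (hcpt := h1) (θ := ψ) hτW
  -- its archimedean parameter `E`: singletons, with `p - q = 1` at the complex place
  obtain ⟨E, hE⟩ := τ.exists_hasArchParameter_glOne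
  haveI : NumberField.IsCMField K₃ := isCMField_K₃
  have hsing : ∀ ι : K₃ →+* ℂ, ∃ x : ℂ, E ι = {x} := by
    intro ι
    have hw : (InfinitePlace.mk ι).IsComplex := NumberField.IsTotallyComplex.isComplex _
    obtain ⟨p, q, -, hp, hq, -⟩ :=
      archParam_embedding_sub_conj_mem_int_glOne τ hE ⟨InfinitePlace.mk ι, hw⟩
    have hp' : E (InfinitePlace.mk ι).embedding = {p} := hp
    have hq' : E (ComplexEmbedding.conjugate (InfinitePlace.mk ι).embedding) = {q} := hq
    rcases InfinitePlace.mk_eq_iff.mp (InfinitePlace.mk_embedding (InfinitePlace.mk ι)) with hι | hι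
    · rw [hι] at hp'
      exact ⟨p, hp'⟩
    · rw [hι] at hq'
      exact ⟨q, hq'⟩
  choose e he using hsing
  have hEe : E = fun ι => {e ι} := funext he
  -- the exponents `s₁ = s₂ = e/2`
  have hmain := hC K₃ isCMField_K₃ h1 (fun ι => e ι / 2) (fun ι => e ι / 2)
    (fun ι => ⟨0, by simp⟩) (fun ι => ⟨0, by simp⟩)
    ⟨⟨τ, hcusp⟩, by
      have : (fun ι : K₃ →+* ℂ => ({e ι / 2 + e ι / 2} : Multiset ℂ)) = E := by
        rw [hEe]; funext ι; congr 1; ring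
      rw [this]; exact hE⟩
  obtain ⟨χ, P, hP, hint⟩ := hmain
  -- a complex place `w` and the parity contradiction
  obtain ⟨w⟩ : Nonempty {w : InfinitePlace K₃ // w.IsComplex} := by
    let ι : K₃ →+* ℂ := Classical.choice (inferInstance : Nonempty _)
    exact ⟨⟨InfinitePlace.mk ι, NumberField.IsTotallyComplex.isComplex _⟩⟩
  obtain ⟨p, q, hp, hq, hpq⟩ := archParam_sub_conj_eq_of_hasUnitaryArchType τ hχτ hψ hE w
  have hep : e w.1.embedding = p := Multiset.singleton_inj.1 ((he _).symm.trans hp)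
  have heq : e (ComplexEmbedding.conjugate w.1.embedding) = q :=
    Multiset.singleton_inj.1 ((he _).symm.trans hq)
  refine no_halfIntegralTwist_of_odd χ.1 hP w (e₁ := e w.1.embedding)
    (e₂ := e (ComplexEmbedding.conjugate w.1.embedding)) (k := 0) ?_ (hint _) (hint _)
  rw [hep, heq, hpq]
  push_cast
  ring

/-! ## §4 Load-bearing analysis II: `IsCMField` cannot be dropped (sorry-free, UNCONDITIONAL)

`HalfIntegralTwistCMWithoutIsCMField` is the route decl with `NumberField.IsCMField K →` removed. It is FALSE for every
number field with two real places `w₁ ≠ w₂`, by a purely ANALYTIC obstruction that the tree proves: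
every idele class character satisfies `|θ| = ‖·‖^σ` (`HeckeCharacter.exists_norm_apply_eq_ideleNorm_rpow`,
from the compactness of `𝕀¹_K/Kˣ`), hence the REAL PARTS of the archimedean exponents of any `GL₁`
datum are PARALLEL: `Re c_w = σ` at every real place, `Re (p_w + q_w) = 2σ` at every complex place
(`exists_re_archParam_parallel_glOne`). With `s₁ = (0 at σ_{w₁}, 1/2 at σ_{w₂})`, `s₂ = -s₁`, `ω = 𝟙`
(parameter `{0}`, `archParam_trivial_glOne`), hypotheses (i)–(iv) hold and a re-twist would need
`Re c_{w₁} ∈ 1/2 + ℤ`, `Re c_{w₂} ∈ ℤ` — impossible. Concrete instance: `K = ℚ(ζ₅)⁺ = ℚ(√5)`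
(`halfIntegralTwistCM_false_without_isCMField`). No unit of infinite order is needed: the obstruction is `|θ| = ‖·‖^σ`,
i.e. ultimately the product formula + compactness, which is blind to the place at infinity. -/

/-- **Core computation at a real place.** For `π = W / W'` on `GL₁(𝔸_K)` with Hecke character `χ` and
parameter `P`, at a real place `w`: `P σ_w = {c}` and `χ(det (exp (r·1_w), 1)) = e^{r c}` for all real
`r`. Gelbart 1975, §2.A; Clozel 1990, §3.3. [cite: Clozel1990, §3.3] -/
theorem archParam_realPlace_glOne
    (π : AutomorphicRepData (AutomorphyDatum.gl 1 K hcpt)) {χ : HeckeCharacter K}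
    (hχ : ∀ (g : (AdelicGroupData.gl 1 K).Adelic), ∀ φ ∈ π.W,
      rightTranslation (AdelicGroupData.gl 1 K) g φ -
        ((χ (Matrix.GeneralLinearGroup.det g) : ℂˣ) : ℂ) • φ ∈ π.W')
    {P : (K →+* ℂ) → Multiset ℂ} (hP : π.HasArchParameter P)
    (w : {w : InfinitePlace K // w.IsReal}) :
    ∃ c : ℂ, P w.1.embedding = {c} ∧
      ∀ r : ℝ, ((χ (Matrix.GeneralLinearGroup.det (GLn.ofInfinite 1 K
        (expGL (realPlaceLie 1 w (r • (1 : Matrix (Fin 1) (Fin 1) ℝ)))))) : ℂˣ) : ℂ) =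
          Complex.exp (r * c) := by
  classical
  obtain ⟨ρ, hρ⟩ := π.exists_hasLieAction_gl
  obtain ⟨d', hd'⟩ := π.exists_linearMap_lieAction_eq_smul_one_glOne ρ
  have hlink : ∀ Y : Matrix (Fin 1) (Fin 1) (mixedSpace K),
      ((χ (Matrix.GeneralLinearGroup.det (GLn.ofInfinite 1 K (expGL Y))) : ℂˣ) : ℂ) =
        Complex.exp (d' ⟨Y, trivial⟩) := by
    intro Y
    have h := π.heckeCharacter_glOne_det_ofArch_expMem hχ ⟨Y, trivial⟩
      (fun φ hφ => π.lieDeriv_sub_smul_mem_of_hasLieAction_glOne hρ hd' ⟨Y, trivial⟩ hφ) 1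
    rw [one_smul, Complex.ofReal_one, one_mul] at h
    exact h
  obtain ⟨hre, -⟩ := π.archParameter_clauses_glOne hρ d' hd' hP
  refine ⟨d' ⟨realPlaceLie 1 w 1, trivial⟩, hre w, fun r => ?_⟩
  rw [hlink]
  congr 1
  have : (⟨realPlaceLie 1 w (r • (1 : Matrix (Fin 1) (Fin 1) ℝ)), trivial⟩ :
      (AutomorphyDatum.gl 1 K hcpt).arch.lie) = r • ⟨realPlaceLie 1 w 1, trivial⟩ := by
    refine Subtype.ext ?_
    change realPlaceLie 1 w (r • (1 : Matrix (Fin 1) (Fin 1) ℝ)) = r • realPlaceLie 1 w 1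
    rw [map_smul]
  rw [this, map_smul, Complex.real_smul]

/-- The idele norm of `det (exp (r·1_w), 1)` at a real place `w` is `e^r`. [folklore] -/
theorem ideleNorm_det_ofInfinite_expGL_realPlaceLie (w : {w : InfinitePlace K // w.IsReal}) (r : ℝ) :
    Literature.NumberTheory.GaloisRepresentations.ideleNorm (Matrix.GeneralLinearGroup.det (GLn.ofInfinite 1 K
      (expGL (realPlaceLie 1 w (r • (1 : Matrix (Fin 1) (Fin 1) ℝ)))))) = Real.exp r := by
  unfold Literature.NumberTheory.GaloisRepresentations.ideleNorm
  rw [det_ofInfinite_snd]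
  have hfin : ∏ᶠ v : HeightOneSpectrum (𝓞 K),
      ‖((1 : FiniteAdeleRing (𝓞 K) K) v)‖ = 1 :=
    finprod_eq_one_of_forall_eq_one fun v => by
      rw [show ((1 : FiniteAdeleRing (𝓞 K) K) v) = 1 from rfl, norm_one]
  rw [hfin, mul_one]
  have hnorm : ∀ w' : InfinitePlace K,
      ‖(((Matrix.GeneralLinearGroup.det (GLn.ofInfinite 1 K
        (expGL (realPlaceLie 1 w (r • (1 : Matrix (Fin 1) (Fin 1) ℝ))))) : (AdeleRing (𝓞 K) K)ˣ) :
          AdeleRing (𝓞 K) K).1 w')‖ = if w' = w.1 then Real.exp r else 1 := by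
    intro w'
    rw [← (Completion.isometry_extensionEmbedding w').norm_map_of_map_zero (map_zero _),
      extensionEmbedding_det_ofInfinite_expGL_realPlaceLie]
    split_ifs
    · rw [Complex.norm_real, Real.norm_eq_abs, abs_of_pos (Real.exp_pos r)]
    · exact norm_one
  simp_rw [hnorm]
  rw [Finset.prod_eq_single w.1 (fun w' _ hw' => by rw [if_neg hw', one_pow])
    (fun h => absurd (Finset.mem_univ _) h), if_pos rfl, mult_isReal, pow_one]

/-- The idele norm of `det (exp a_w, 1)` at a complex place `w` is `|e^a|² = e^{2 Re a}`. [folklore] -/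
theorem ideleNorm_det_ofInfinite_expGL_complexPlaceLie (w : {w : InfinitePlace K // w.IsComplex}) (a : ℂ) :
    Literature.NumberTheory.GaloisRepresentations.ideleNorm (Matrix.GeneralLinearGroup.det (GLn.ofInfinite 1 K
      (expGL (complexPlaceLie 1 w (a • (1 : Matrix (Fin 1) (Fin 1) ℂ)))))) = Real.exp a.re ^ 2 := by
  unfold Literature.NumberTheory.GaloisRepresentations.ideleNorm
  rw [det_ofInfinite_snd]
  have hfin : ∏ᶠ v : HeightOneSpectrum (𝓞 K),
      ‖((1 : FiniteAdeleRing (𝓞 K) K) v)‖ = 1 :=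
    finprod_eq_one_of_forall_eq_one fun v => by
      rw [show ((1 : FiniteAdeleRing (𝓞 K) K) v) = 1 from rfl, norm_one]
  rw [hfin, mul_one]
  have hnorm : ∀ w' : InfinitePlace K,
      ‖(((Matrix.GeneralLinearGroup.det (GLn.ofInfinite 1 K
        (expGL (complexPlaceLie 1 w (a • (1 : Matrix (Fin 1) (Fin 1) ℂ))))) : (AdeleRing (𝓞 K) K)ˣ) :
          AdeleRing (𝓞 K) K).1 w')‖ = if w' = w.1 then Real.exp a.re else 1 := by
    intro w'
    rw [← (Completion.isometry_extensionEmbedding w').norm_map_of_map_zero (map_zero _),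
      extensionEmbedding_det_ofInfinite_expGL_complexPlaceLie]
    split_ifs
    · exact Complex.norm_exp a
    · exact norm_one
  simp_rw [hnorm]
  rw [Finset.prod_eq_single w.1 (fun w' _ hw' => by rw [if_neg hw', one_pow])
    (fun h => absurd (Finset.mem_univ _) h), if_pos rfl, mult_isComplex]

/-- **Real parts of archimedean exponents are parallel** (any number field, any `GL₁` datum): there is
`σ ∈ ℝ` with `Re c_w = σ` at every real place (`P σ_w = {c_w}`) and `Re (p_w + q_w) = 2σ` at every
complex place (`P σ_w = {p_w}`, `P σ̄_w = {q_w}`). Proof: `|χ_π| = ‖·‖^σ`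
(`HeckeCharacter.exists_norm_apply_eq_ideleNorm_rpow`: `𝕀_K/𝕀¹_K ≅ ℝ_{>0}`, `𝕀¹_K/Kˣ` compact) evaluated
on `det (exp Y, 1)`. This is the necessity half of Weil's criterion for the MODULUS of the type, and the
obstruction behind `IsCMField`. Weil, *Basic Number Theory*, Ch. VII §3; Patrikis 2019, §2.1
(`ψ = |·|^r ·` unitary). [cite: WeilBNT1967, Ch. IV §4, Thm. 6] -/
theorem exists_re_archParam_parallel_glOne
    (π : AutomorphicRepData (AutomorphyDatum.gl 1 K hcpt)) {P : (K →+* ℂ) → Multiset ℂ}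
    (hP : π.HasArchParameter P) :
    ∃ σ : ℝ, (∀ (w : {w : InfinitePlace K // w.IsReal}) (c : ℂ), P w.1.embedding = {c} → c.re = σ) ∧
      ∀ (w : {w : InfinitePlace K // w.IsComplex}) (p q : ℂ), P w.1.embedding = {p} →
        P (ComplexEmbedding.conjugate w.1.embedding) = {q} → (p + q).re = 2 * σ := by
  obtain ⟨χ, hχ⟩ := π.exists_heckeCharacter_glOne
  obtain ⟨σ, hσ⟩ := χ.exists_norm_apply_eq_ideleNorm_rpow
  refine ⟨σ, fun w c hc => ?_, fun w p q hp hq => ?_⟩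
  · obtain ⟨c', hc', hval⟩ := archParam_realPlace_glOne π hχ hP w
    obtain rfl : c = c' := Multiset.singleton_inj.1 (hc.symm.trans hc')
    have h := hσ (Matrix.GeneralLinearGroup.det (GLn.ofInfinite 1 K
      (expGL (realPlaceLie 1 w ((1 : ℝ) • (1 : Matrix (Fin 1) (Fin 1) ℝ))))))
    rw [hval, ideleNorm_det_ofInfinite_expGL_realPlaceLie, Complex.norm_exp, ← Real.exp_mul] at h
    have h' := Real.exp_injective h
    simpa using h'
  · obtain ⟨p', q', hp', hq', hval⟩ := archParam_complexPlace_glOne π hχ hP w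
    obtain rfl : p = p' := Multiset.singleton_inj.1 (hp.symm.trans hp')
    obtain rfl : q = q' := Multiset.singleton_inj.1 (hq.symm.trans hq')
    have h := hσ (Matrix.GeneralLinearGroup.det (GLn.ofInfinite 1 K
      (expGL (complexPlaceLie 1 w ((1 : ℂ) • (1 : Matrix (Fin 1) (Fin 1) ℂ))))))
    rw [hval, ideleNorm_det_ofInfinite_expGL_complexPlaceLie, Complex.norm_exp, ← Real.exp_nat_mul,
      ← Real.exp_mul] at h
    have h' := Real.exp_injective h
    simp only [one_mul, map_one, Complex.one_re] at h'
    push_cast at h'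
    linarith

/-- **The datum of the trivial character has parameter `0` everywhere**: if `𝟙 = r(g)`-scalar of
`π` (`r(g) φ - φ ∈ W'`), then `P ι = {0}` for all `ι`. [folklore] -/
theorem archParam_trivial_glOne
    (π : AutomorphicRepData (AutomorphyDatum.gl 1 K hcpt))
    (hχ : ∀ (g : (AdelicGroupData.gl 1 K).Adelic), ∀ φ ∈ π.W,
      rightTranslation (AdelicGroupData.gl 1 K) g φ -
        (((1 : HeckeCharacter K) (Matrix.GeneralLinearGroup.det g) : ℂˣ) : ℂ) • φ ∈ π.W')
    {P : (K →+* ℂ) → Multiset ℂ} (hP : π.HasArchParameter P) (ι : K →+* ℂ) : P ι = {0} := by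
  rcases (InfinitePlace.mk ι).isReal_or_isComplex with hw | hw
  · -- real place
    obtain ⟨c, hc, hval⟩ := archParam_realPlace_glOne π hχ hP ⟨InfinitePlace.mk ι, hw⟩
    have hc0 : c = 0 := by
      refine eq_of_forall_cexp_mul_eq fun t => ?_
      rw [← hval t, HeckeCharacter.one_apply, Units.val_one, mul_zero, Complex.exp_zero]
    have e : (InfinitePlace.mk ι).embedding = ι := embedding_mk_eq_of_isReal (isReal_mk_iff.mp hw)
    rw [← e]
    rw [hc0] at hc
    exact hc
  · -- complex place
    obtain ⟨p, q, hp, hq, hval⟩ := archParam_complexPlace_glOne π hχ hP ⟨InfinitePlace.mk ι, hw⟩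
    have hsum : p + q = 0 := by
      refine eq_of_forall_cexp_mul_eq fun t => ?_
      have h := hval t
      rw [HeckeCharacter.one_apply, Units.val_one, Complex.conj_ofReal] at h
      rw [mul_zero, Complex.exp_zero, h]
      congr 1
      ring
    have hdiff : Complex.I * (p - q) = 0 := by
      refine eq_of_forall_cexp_mul_eq fun t => ?_
      have h := hval (t * Complex.I)
      rw [HeckeCharacter.one_apply, Units.val_one, map_mul, Complex.conj_ofReal, Complex.conj_I] at h
      rw [mul_zero, Complex.exp_zero, h]
      congr 1
      ring
    have hp0 : p = 0 := by
      have := mul_left_cancel₀ Complex.I_ne_zero (hdiff.trans (mul_zero _).symm)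
      linear_combination (hsum + this) / 2
    have hq0 : q = 0 := by rw [hp0, zero_add] at hsum; exact hsum
    rcases InfinitePlace.mk_eq_iff.mp (InfinitePlace.mk_embedding (InfinitePlace.mk ι)) with hι | hι
    · have hp' : P (InfinitePlace.mk ι).embedding = {p} := hp
      rw [hι, hp0] at hp'
      exact hp'
    · have hq' : P (ComplexEmbedding.conjugate (InfinitePlace.mk ι).embedding) = {q} := hq
      rw [hι, hq0] at hq'
      exact hq'

/-- The crux with the hypothesis `NumberField.IsCMField K` DROPPED; everything else verbatim.
[folklore] -/
def HalfIntegralTwistCMWithoutIsCMField : Prop :=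
  ∀ (K : Type) [Field K] [NumberField K],
    ∀ (h1 : Literature.NumberTheory.Automorphic.isCompact_glFiniteIntegralLevel 1 K)
      (s₁ s₂ : (K →+* ℂ) → ℂ), (∀ ι, ∃ k : ℤ, s₁ ι - s₂ ι = k) →
      (∀ ι, ∃ m : ℤ, s₁ ι - s₁ (NumberField.ComplexEmbedding.conjugate ι) = m) →
      (∀ ι, ∃ m : ℤ, (s₁ ι - s₂ ι) + (s₁ (NumberField.ComplexEmbedding.conjugate ι) -
        s₂ (NumberField.ComplexEmbedding.conjugate ι)) = 2 * m) →
      (∃ ω : Literature.NumberTheory.Automorphic.CuspidalAutomorphicRepData 1 K h1,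
        ω.1.HasArchParameter (fun ι => {s₁ ι + s₂ ι})) →
      ∃ (χ : Literature.NumberTheory.Automorphic.CuspidalAutomorphicRepData 1 K h1)
        (p : (K →+* ℂ) → ℂ), χ.1.HasArchParameter (fun ι => {p ι}) ∧
          ∀ ι, ∃ m : ℤ, p ι + s₁ ι - 1 / 2 = m

/-- Sanity: `HalfIntegralTwistCMWithoutIsCMField` implies the crux (pure logic). [folklore] -/
theorem halfIntegralTwistCM_of_withoutIsCMField (h : HalfIntegralTwistCMWithoutIsCMField) : Crux :=
  fun K _ _ _ h1 s₁ s₂ hi hii hiii hiv => h K h1 s₁ s₂ hi hii hiii hiv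

/-- **`IsCMField` is load-bearing: the crux without it FAILS over every number field with two real
places** (unconditional). Witness `s₁ = (1/2)·𝟙_{σ_{w₂}}`, `s₂ = -s₁`, `ω = π_𝟙`; obstruction
`exists_re_archParam_parallel_glOne`. Patrikis 2019, Prop. 1.3.3 / Lemma 2.1.5 (the real-place
obstruction `X*(Z)[2] = ℤ/2` per real place), here in its crudest form. [cite: Patrikis2019, Lemma 2.1.5] -/
theorem halfIntegralTwistCM_false_without_isCMField_of_two_real_places {K : Type} [Field K] [NumberField K]
    (w₁ w₂ : {w : InfinitePlace K // w.IsReal}) (hne : w₁ ≠ w₂) : ¬ HalfIntegralTwistCMWithoutIsCMField := by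
  intro hC
  classical
  set σ₂ : K →+* ℂ := w₂.1.embedding with hσ₂
  have hσ₂real : ComplexEmbedding.IsReal σ₂ := isReal_iff.mp w₂.2
  have hσ₂conj : ComplexEmbedding.conjugate σ₂ = σ₂ := ComplexEmbedding.isReal_iff.mp hσ₂real
  -- `conjugate ι = σ₂ ↔ ι = σ₂`
  have hconj : ∀ ι : K →+* ℂ, ComplexEmbedding.conjugate ι = σ₂ ↔ ι = σ₂ := by
    intro ι
    constructor
    · intro h
      have hcc : ComplexEmbedding.conjugate (ComplexEmbedding.conjugate ι) = ι :=
        RingHom.ext fun x => by simp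
      have := congrArg ComplexEmbedding.conjugate h
      rwa [hσ₂conj, hcc] at this
    · rintro rfl
      exact hσ₂conj
  set h1 : isCompact_glFiniteIntegralLevel 1 K := isCompact_glFiniteIntegralLevel_holds 1 K with hh1
  -- the exponents
  set s₁ : (K →+* ℂ) → ℂ := fun ι => if ι = σ₂ then 1 / 2 else 0 with hs₁
  -- the trivial datum
  obtain ⟨τ, hτW, hτW'⟩ := exists_automorphicRepData_detTwist_glOne h1 (1 : HeckeCharacter K)
  have hcusp : τ.W ≤ cuspFormsGL 1 K h1 := by
    rw [hτW, Submodule.span_le]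
    rintro _ rfl
    exact IsCuspFormGL.mem_cuspFormsGL
      ⟨isAutomorphicForm_detTwist_glOne h1 (1 : HeckeCharacter K), fun k hk hk1 => absurd hk1 (by omega)⟩
  have hχτ := detTwist_datum_heckeCharacter (hcpt := h1) (θ := (1 : HeckeCharacter K)) hτW
  obtain ⟨E, hE⟩ := τ.exists_hasArchParameter_glOne
  have hE0 : E = fun ι => ({s₁ ι + -s₁ ι} : Multiset ℂ) := by
    funext ι
    rw [add_neg_cancel]
    exact archParam_trivial_glOne τ hχτ hE ι
  -- apply the CM-free crux
  obtain ⟨χ, P, hP, hint⟩ := hC K h1 s₁ (fun ι => -s₁ ι)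
    (fun ι => by
      by_cases h : ι = σ₂
      · exact ⟨1, by simp [hs₁, h]; norm_num⟩
      · exact ⟨0, by simp [hs₁, h]⟩)
    (fun ι => ⟨0, by
      by_cases h : ι = σ₂
      · simp [hs₁, h, hσ₂conj]
      · have h' : ¬ ComplexEmbedding.conjugate ι = σ₂ := fun h'' => h ((hconj ι).1 h'')
        simp [hs₁, h, h']⟩)
    (fun ι => by
      by_cases h : ι = σ₂
      · exact ⟨1, by simp [hs₁, h, hσ₂conj]; norm_num⟩
      · have h' : ¬ ComplexEmbedding.conjugate ι = σ₂ := fun h'' => h ((hconj ι).1 h'')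
        exact ⟨0, by simp [hs₁, h, h']⟩)
    ⟨⟨τ, hcusp⟩, by rw [← hE0]; exact hE⟩
  -- the parallel real parts
  obtain ⟨σ, hreal, -⟩ := exists_re_archParam_parallel_glOne χ.1 hP
  have h₁ := hreal w₁ (P w₁.1.embedding) rfl
  have h₂ := hreal w₂ (P w₂.1.embedding) rfl
  have hne' : w₁.1.embedding ≠ σ₂ := fun h => hne (Subtype.ext (by
    have := congrArg InfinitePlace.mk h
    rwa [mk_embedding, hσ₂, mk_embedding] at this))
  obtain ⟨m₁, hm₁⟩ := hint w₁.1.embedding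
  obtain ⟨m₂, hm₂⟩ := hint σ₂
  have e₁ : s₁ w₁.1.embedding = 0 := by simp [hs₁, hne']
  have e₂ : s₁ σ₂ = 1 / 2 := by simp [hs₁]
  rw [e₁] at hm₁
  rw [e₂] at hm₂
  have r₁ := congrArg Complex.re hm₁
  have r₂ := congrArg Complex.re hm₂
  simp only [Complex.sub_re, Complex.add_re, Complex.zero_re, Complex.intCast_re] at r₁ r₂
  rw [h₁] at r₁
  rw [← hσ₂] at h₂
  rw [h₂] at r₂
  have half : ((1 : ℂ) / 2).re = 1 / 2 := by norm_num
  rw [half] at r₁ r₂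
  have key : (2 * (m₂ - m₁) : ℝ) = 1 := by linarith
  have key' : (2 * (m₂ - m₁) : ℤ) = 1 := by exact_mod_cast key
  omega

/-! ### The witness field `ℚ(ζ₅)⁺ = ℚ(√5)` -/

/-- The fifth cyclotomic field `ℚ(ζ₅)`. [folklore] -/
abbrev K₅ : Type := CyclotomicField 5 ℚ

/-- `ℚ(ζ₅)/ℚ` is the cyclotomic extension of level `5` (Mathlib's instance, named). [folklore] -/
theorem isCyclotomicExtension_K₅ : IsCyclotomicExtension {5} ℚ K₅ :=
  CyclotomicField.isCyclotomicExtension 5 ℚ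

/-- `ℚ(ζ₅)` is CM. [folklore] -/
theorem isCMField_K₅ : NumberField.IsCMField K₅ :=
  haveI := isCyclotomicExtension_K₅
  IsCyclotomicExtension.Rat.isCMField K₅ (S := {5}) ⟨5, Set.mem_singleton 5, by norm_num⟩


/-- The maximal real subfield `ℚ(ζ₅)⁺ = ℚ(√5)`, a totally real number field. [folklore] -/
abbrev K₅plus : Type := NumberField.maximalRealSubfield K₅

/-- `ℚ(ζ₅)⁺` has two (real) infinite places (`φ(5)/2 = 2`). [folklore] -/
theorem card_infinitePlace_K₅plus : Fintype.card (InfinitePlace K₅plus) = 2 := by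
  haveI := isCyclotomicExtension_K₅
  haveI := isCMField_K₅
  rw [NumberField.IsCMField.card_infinitePlace_eq_card_infinitePlace K₅,
    card_eq_nrRealPlaces_add_nrComplexPlaces,
    IsCyclotomicExtension.Rat.nrRealPlaces_eq_zero (n := 5) K₅ (by decide), zero_add,
    IsCyclotomicExtension.Rat.nrComplexPlaces_eq_totient_div_two (n := 5)]
  rfl

/-- **`IsCMField` is load-bearing: `HalfIntegralTwistCMWithoutIsCMField` is FALSE**, unconditionally (witness `ℚ(√5)`, two
real places). Any proof of the crux must USE the CM hypothesis — precisely, the absence of real places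
(the statement also holds for `K = ℚ` and imaginary quadratic `K`, finding F3(d)).
[cite: Patrikis2019, Lemma 2.1.5] -/
theorem halfIntegralTwistCM_false_without_isCMField : ¬ HalfIntegralTwistCMWithoutIsCMField := by
  have h : 1 < Fintype.card (InfinitePlace K₅plus) := by
    rw [card_infinitePlace_K₅plus]; decide
  obtain ⟨w₁, w₂, hne⟩ := Fintype.exists_pair_of_one_lt_card h
  exact halfIntegralTwistCM_false_without_isCMField_of_two_real_places (K := K₅plus)
    ⟨w₁, NumberField.IsTotallyReal.isReal w₁⟩ ⟨w₂, NumberField.IsTotallyReal.isReal w₂⟩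
    (fun e => hne (congrArg Subtype.val e))

/-! ## §5 For the provers: the full parameter of `π_θ` for `θ` of unitary archimedean type, and the
## proof plan that the obstructions above leave open

`archParam_of_hasUnitaryArchType` computes the archimedean parameter of the datum of a Hecke character
of unitary type `(m, t)` COMPLETELY: `{i t_w}` at a real place, `{(m_w + i t_w)/2}` at `σ_w` and
`{(-m_w + i t_w)/2}` at `σ̄_w` at a complex place. Together with the tree's norm-twist shift
(`HasArchParameter.of_map_mulChar_detTwist`, `ArchParameterTwistNorm`) this is the last step of the
positive proof: the re-twist is `χ = ψ · ‖·‖^r` with `ψ` from Weil's criterion.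

PROOF PLAN for the crux that AVOIDS the (unformalised) necessity half of Weil's criterion — recorded
here because the disproof attempts show it is the only delicate point. Let `ω` be the datum of (iv),
`θ = χ_ω` its Hecke character (`exists_heckeCharacter_glOne`), `e = s₁ + s₂` its exponents.
(1) `θ ∘ det` has a level `𝔪 ≠ 0` (`HeckeCharacter.exists_level_glOne`, PROVED), so `θ((1, u_f)) = 1` for
units `u ≡ 1 (𝔪)`; with `θ(principal idele of u) = 1` this gives `θ((u_∞, 1)) = 1` on the congruence
subgroup `U_𝔪`, of finite index in `𝓞_Kˣ` (kernel of `𝓞_Kˣ → (𝓞_K/𝔪)ˣ`). (2) For `u ∈ U_𝔪 ∩ (𝓞_{K⁺}ˣ)²`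
(finite index: Mathlib `NumberField.IsCMField.indexRealUnits_eq_one_or_two` — THIS is where CM enters),
`u_∞ = det (exp Y, 1)` with `Y_w = log ι_w(u) ∈ ℝ`, and `archParam_complexPlace_glOne` (§2) reads
`θ((u_∞,1)) = exp (∑_w (e σ_w + e σ̄_w) log ι_w u) = 1`. (3) The wanted exponents `p = 1/2 - s₁ + N` have
`p σ_w + p σ̄_w = (1 + N + N' - j_w) - (e σ_w + e σ̄_w)/2` (`j_w ∈ ℤ` from (iii); (i) is not needed) and
`p σ_w - p σ̄_w ∈ ℤ` from (ii); choose the `N`'s with `1 + N + N' - j_w = M` constant and put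
`m_w = p σ_w - p σ̄_w`, `t_w = Im (p σ_w + p σ̄_w)·(normalisation of HeckeCharacterArchType)`,
`r = Re (p σ_w + p σ̄_w)/2` (place-independent by `exists_re_archParam_parallel_glOne` applied to `ω`).
(4) Weil's unit product for `(m, t)` on `u²`, `u` as in (2), is `exp` of HALF the exponent in (2), so it is
`1` on a finite-index subgroup, hence of finite order `M` on all of `𝓞_Kˣ`: the hypothesis of
`Patrikis2019_heckeCharacter_archType_iff_units` (⇐) holds; get `ψ`. (5) `χ := π_{ψ·‖·‖^r}`
(`exists_automorphicRepData_detTwist_glOne`), parameter by `archParam_of_hasUnitaryArchType` + norm shift.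
Inputs beyond the tree: ONLY the named fact of (4). -/

/-- `archUnitaryValue m t (e^s) = e^{i s t}` for real `s` (the modulus character of `ℂˣ` / `ℝˣ` on the
positive reals). [folklore] -/
theorem archUnitaryValue_ofReal_exp (m : ℤ) (t : ℝ) (s : ℝ) :
    archUnitaryValue m t ((Real.exp s : ℝ) : ℂ) = Complex.exp (s * (t * Complex.I)) := by
  unfold archUnitaryValue
  have hpos : (0 : ℝ) < Real.exp s := Real.exp_pos s
  have hne : ((Real.exp s : ℝ) : ℂ) ≠ 0 := by exact_mod_cast hpos.ne'
  rw [Complex.norm_real, Real.norm_eq_abs, abs_of_pos hpos, div_self hne, one_zpow, one_mul,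
    Complex.cpow_def_of_ne_zero hne, Complex.ofReal_exp, Complex.log_exp (by simp [Real.pi_pos])
      (by simpa using Real.pi_pos.le)]

/-- **The archimedean parameter of `π_θ` for `θ` of unitary archimedean type `(m, t)`** (complete form
of `archParam_sub_conj_eq_of_hasUnitaryArchType`): at a real place `w`, `P σ_w = {i t_w}`; at a complex
place `w`, `P σ_w = {(m_w + i t_w)/2}` and `P σ̄_w = {(-m_w + i t_w)/2}`. (`θ_w = (z/|z|)^{m} |z|^{it}`
`= z^{(m+it)/2} z̄^{(-m+it)/2}`; at a real place the sign character is infinitesimally invisible.)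
Tate (1950), §2.3; Clozel 1990, §3.3; Patrikis 2019, §2.1. [cite: Patrikis2019, §2.1 (display before Lemma 2.1.1)] -/
theorem archParam_of_hasUnitaryArchType
    (π : AutomorphicRepData (AutomorphyDatum.gl 1 K hcpt)) {θ : HeckeCharacter K}
    (hχ : ∀ (g : (AdelicGroupData.gl 1 K).Adelic), ∀ φ ∈ π.W,
      rightTranslation (AdelicGroupData.gl 1 K) g φ -
        ((θ (Matrix.GeneralLinearGroup.det g) : ℂˣ) : ℂ) • φ ∈ π.W')
    {m : InfinitePlace K → ℤ} {t : InfinitePlace K → ℝ} (hθ : θ.HasUnitaryArchType m t)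
    {P : (K →+* ℂ) → Multiset ℂ} (hP : π.HasArchParameter P) :
    (∀ w : {w : InfinitePlace K // w.IsReal}, P w.1.embedding = {(t w.1 : ℂ) * Complex.I}) ∧
      ∀ w : {w : InfinitePlace K // w.IsComplex},
        P w.1.embedding = {((m w.1 : ℂ) + t w.1 * Complex.I) / 2} ∧
          P (ComplexEmbedding.conjugate w.1.embedding) = {(-(m w.1 : ℂ) + t w.1 * Complex.I) / 2} := by
  refine ⟨fun w => ?_, fun w => ?_⟩
  · -- real place
    obtain ⟨c, hc, hval⟩ := archParam_realPlace_glOne π hχ hP w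
    have key : ∀ s : ℝ, Complex.exp (s * c) = Complex.exp (s * (t w.1 * Complex.I)) := by
      intro s
      have hx := hθ (HeckeCharacter.infPart K (Matrix.GeneralLinearGroup.det (GLn.ofInfinite 1 K
        (expGL (realPlaceLie 1 w (s • (1 : Matrix (Fin 1) (Fin 1) ℝ)))))))
      rw [infiniteIdeles_infPart_det_ofInfinite_expGL] at hx
      simp only [HeckeCharacter.val_infPart] at hx
      simp_rw [extensionEmbedding_det_ofInfinite_expGL_realPlaceLie K w] at hx
      rw [Finset.prod_eq_single w.1 (fun w' _ hw' => by rw [if_neg hw', archUnitaryValue_one])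
        (fun h => absurd (Finset.mem_univ _) h), if_pos rfl, archUnitaryValue_ofReal_exp] at hx
      rw [← hval s, hx]
    rw [hc, eq_of_forall_cexp_mul_eq key]
  · -- complex place
    obtain ⟨p, q, hp, hq, hval⟩ := archParam_complexPlace_glOne π hχ hP w
    obtain ⟨p', q', hp', hq', hdiff⟩ := archParam_sub_conj_eq_of_hasUnitaryArchType π hχ hθ hP w
    obtain rfl : p = p' := Multiset.singleton_inj.1 (hp.symm.trans hp')
    obtain rfl : q = q' := Multiset.singleton_inj.1 (hq.symm.trans hq')
    have hsum : p + q = t w.1 * Complex.I := by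
      refine eq_of_forall_cexp_mul_eq fun s => ?_
      have hx := hθ (HeckeCharacter.infPart K (Matrix.GeneralLinearGroup.det (GLn.ofInfinite 1 K
        (expGL (complexPlaceLie 1 w ((s : ℂ) • (1 : Matrix (Fin 1) (Fin 1) ℂ)))))))
      rw [infiniteIdeles_infPart_det_ofInfinite_expGL] at hx
      simp only [HeckeCharacter.val_infPart] at hx
      simp_rw [extensionEmbedding_det_ofInfinite_expGL_complexPlaceLie K w] at hx
      rw [Finset.prod_eq_single w.1 (fun w' _ hw' => by rw [if_neg hw', archUnitaryValue_one])
        (fun h => absurd (Finset.mem_univ _) h), if_pos rfl, ← Complex.ofReal_exp,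
        archUnitaryValue_ofReal_exp] at hx
      have h := hval s
      rw [Complex.conj_ofReal] at h
      rw [show (s : ℂ) * (p + q) = s * p + s * q by ring, ← h, hx]
    refine ⟨?_, ?_⟩
    · rw [hp]
      congr 1
      linear_combination (hsum + hdiff) / 2
    · rw [hq]
      congr 1
      linear_combination (hsum - hdiff) / 2

/-! ## §6 Load-bearing analysis III: hypothesis (iii) (uniform parity) cannot be dropped
## (kernel-checked modulo Weil; witness `ℚ(ζ₅)`, mixed parity at its two complex places)

With (iii) `(s₁-s₂) ι + (s₁-s₂) ῑ ∈ 2ℤ` DROPPED the crux is FALSE over every CM field with two distinct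
complex places (so `[K:ℚ] ≥ 4`; over an imaginary quadratic field it stays true, F3(b)/(d)). Witness:
`ψ` the Hecke character with `ψ_{w₁}(z) = z/|z|`, `ψ_w = 1` at the other infinite places (Weil:
`(ι(u)/|ι(u)|)² = ι(u ū⁻¹)` is a root of unity for every unit `u` of a CM field — Mathlib
`IsCMField.unitsMulComplexConjInv`), `ω = π_ψ` with exponents `e = (1/2, -1/2)` at `(σ_{w₁}, σ̄_{w₁})` and
`0` elsewhere (`archParam_of_hasUnitaryArchType`), `d = (1/4)·𝟙_{mk ι = w₁}`, `s₁ = e + d`, `s₂ = -d`: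
(i) holds with `k = s₁ - s₂ = (1, 0 ; 0, 0)` — parity ODD at `w₁`, EVEN at `w₂` —, (ii) holds
(`d ι = d ῑ`, `e ι - e ῑ ∈ ℤ`), (iv) holds (`s₁ + s₂ = e`), and a re-twist `χ` would have
`Re (p σ_{w₁} + p σ̄_{w₁}) ∈ 1/2 + ℤ` but `Re (p σ_{w₂} + p σ̄_{w₂}) ∈ ℤ`, contradicting the parallelism of
real parts (`exists_re_archParam_parallel_glOne`). So the honest hypothesis is "the parity of
`(s₁-s₂) ι + (s₁-s₂) ῑ` is the SAME at all complex places"; (iii) as typed (all even) is one of its two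
cases, uniform odd parity being equally fine on paper. -/

/-- **Weil's unit condition for an angular type over a CM field.** For `K` CM, `m = 𝟙_{w₁}` (angular
degree `1` at one infinite place, `0` elsewhere) and `t = 0`: `(ι_{w₁}(u)/|ι_{w₁}(u)|)^{2N} = 1` for every
unit `u`, `N = |μ(K)|`, because `(ι(u)/|ι(u)|)² = ι(u ū⁻¹)` and `u ū⁻¹` is a root of unity
(Mathlib `NumberField.IsCMField.unitsMulComplexConjInv`). [folklore] -/
theorem unitCondition_angular_of_isCMField (K : Type) [Field K] [NumberField K] [NumberField.IsCMField K]
    (w₁ : InfinitePlace K) :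
    ∃ M : ℕ, 0 < M ∧ ∀ α : (𝓞 K)ˣ,
      (∏ w : InfinitePlace K, archUnitaryValue ((fun w => if w = w₁ then (1 : ℤ) else 0) w)
        ((fun _ => (0 : ℝ)) w) (w.embedding ((α : 𝓞 K) : K))) ^ M = 1 := by
  classical
  refine ⟨2 * Nat.card (NumberField.Units.torsion K), Nat.mul_pos two_pos Nat.card_pos, fun α => ?_⟩
  -- only the factor at `w₁` is non-trivial
  have h0 : ∀ z : ℂ, archUnitaryValue 0 0 z = 1 := fun z => by simp [archUnitaryValue]
  beta_reduce
  rw [Finset.prod_eq_single w₁ (fun w _ hw => by rw [if_neg hw, h0])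
    (fun h => absurd (Finset.mem_univ _) h), if_pos rfl]
  set a : K := ((α : 𝓞 K) : K) with ha
  set φ : K →+* ℂ := w₁.embedding with hφ
  have ha0 : a ≠ 0 := by
    rw [ha]; exact_mod_cast α.ne_zero
  have hφa : φ a ≠ 0 := (map_ne_zero φ).2 ha0
  -- `(φ a/|φ a|)² = φ (a ā⁻¹)`
  have hsq : (φ a / (‖φ a‖ : ℂ)) ^ 2 = φ (a * (NumberField.IsCMField.complexConj K a)⁻¹) := by
    have hnorm : ((‖φ a‖ : ℂ)) ^ 2 = φ a * conj (φ a) := by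
      rw [Complex.mul_conj, Complex.normSq_eq_norm_sq]; push_cast; ring
    have hconj : conj (φ a) ≠ 0 := by
      rwa [Ne, map_eq_zero]
    rw [div_pow, hnorm, map_mul, map_inv₀, NumberField.IsCMField.complexEmbedding_complexConj]
    field_simp
  -- `a ā⁻¹` is the root of unity `unitsMulComplexConjInv α`
  set ζ := NumberField.IsCMField.unitsMulComplexConjInv K α with hζ
  have hζval : (((ζ : (𝓞 K)ˣ) : 𝓞 K) : K) = a * (NumberField.IsCMField.complexConj K a)⁻¹ := by
    simp [hζ, NumberField.IsCMField.unitsMulComplexConjInv_apply, ha, Units.coe_mapEquiv,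
      NumberField.RingOfIntegers.mapRingEquiv_apply]
  have hζN : (ζ : (𝓞 K)ˣ) ^ Nat.card (NumberField.Units.torsion K) = 1 := by
    have := pow_card_eq_one' (G := NumberField.Units.torsion K) (x := ζ)
    exact_mod_cast congrArg Subtype.val this
  have hζN' : (a * (NumberField.IsCMField.complexConj K a)⁻¹) ^ Nat.card (NumberField.Units.torsion K)
      = 1 := by
    rw [← hζval]
    have := congrArg (fun u : (𝓞 K)ˣ => (((u : 𝓞 K)) : K)) hζN
    simpa using this
  unfold archUnitaryValue
  rw [zpow_one, Complex.ofReal_zero, zero_mul, Complex.cpow_zero, mul_one, pow_mul, hsq, ← map_pow,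
    hζN', map_one]

/-- The crux with hypothesis (iii) (`(s₁-s₂) ι + (s₁-s₂) ῑ ∈ 2ℤ`) DROPPED; everything else verbatim.
[folklore] -/
def HalfIntegralTwistCMWithoutParity : Prop :=
  ∀ (K : Type) [Field K] [NumberField K], NumberField.IsCMField K →
    ∀ (h1 : Literature.NumberTheory.Automorphic.isCompact_glFiniteIntegralLevel 1 K)
      (s₁ s₂ : (K →+* ℂ) → ℂ), (∀ ι, ∃ k : ℤ, s₁ ι - s₂ ι = k) →
      (∀ ι, ∃ m : ℤ, s₁ ι - s₁ (NumberField.ComplexEmbedding.conjugate ι) = m) →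
      (∃ ω : Literature.NumberTheory.Automorphic.CuspidalAutomorphicRepData 1 K h1,
        ω.1.HasArchParameter (fun ι => {s₁ ι + s₂ ι})) →
      ∃ (χ : Literature.NumberTheory.Automorphic.CuspidalAutomorphicRepData 1 K h1)
        (p : (K →+* ℂ) → ℂ), χ.1.HasArchParameter (fun ι => {p ι}) ∧
          ∀ ι, ∃ m : ℤ, p ι + s₁ ι - 1 / 2 = m

/-- Sanity: `HalfIntegralTwistCMWithoutParity` implies the crux (pure logic). [folklore] -/
theorem halfIntegralTwistCM_of_withoutParity (h : HalfIntegralTwistCMWithoutParity) : Crux :=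
  fun K _ _ hK h1 s₁ s₂ hi hii _ hiv => h K hK h1 s₁ s₂ hi hii hiv

/-- **Hypothesis (iii) is load-bearing over every CM field with two complex places** (modulo Weil's
unit criterion): mixed parity — odd at `w₁`, even at `w₂` — kills the half-integral re-twist, by the
parallelism of the real parts of the exponents of the putative `χ`. [cite: Patrikis2019, Lemma 2.1.1] -/
theorem halfIntegralTwistCM_false_without_parity_of_two_complex_places
    (hW : Patrikis2019_heckeCharacter_archType_iff_units)
    {K : Type} [Field K] [NumberField K] [hK : NumberField.IsCMField K]
    (w₁ w₂ : {w : InfinitePlace K // w.IsComplex}) (hne : w₁ ≠ w₂) : ¬ HalfIntegralTwistCMWithoutParity := by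
  intro hC
  classical
  -- the Hecke character `ψ` with `ψ_{w₁} = z/|z|`, `ψ_w = 1` elsewhere (Weil)
  obtain ⟨ψ, -, hψ⟩ := (hW K (fun w => if w = w₁.1 then 1 else 0) (fun _ => 0)).2
    (unitCondition_angular_of_isCMField K w₁.1)
  set h1 : isCompact_glFiniteIntegralLevel 1 K := isCompact_glFiniteIntegralLevel_holds 1 K with hh1
  obtain ⟨τ, hτW, hτW'⟩ := exists_automorphicRepData_detTwist_glOne h1 ψ
  have hcusp : τ.W ≤ cuspFormsGL 1 K h1 := by
    rw [hτW, Submodule.span_le]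
    rintro _ rfl
    exact IsCuspFormGL.mem_cuspFormsGL
      ⟨isAutomorphicForm_detTwist_glOne h1 ψ, fun k hk hk1 => absurd hk1 (by omega)⟩
  have hχτ := detTwist_datum_heckeCharacter (hcpt := h1) (θ := ψ) hτW
  obtain ⟨E, hE⟩ := τ.exists_hasArchParameter_glOne
  -- exponents `e` of `ω = π_ψ` (singletons everywhere: `K` is totally complex)
  have hsing : ∀ ι : K →+* ℂ, ∃ x : ℂ, E ι = {x} := by
    intro ι
    have hw : (InfinitePlace.mk ι).IsComplex := NumberField.IsTotallyComplex.isComplex _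
    obtain ⟨p, q, -, hp, hq, -⟩ :=
      archParam_embedding_sub_conj_mem_int_glOne τ hE ⟨InfinitePlace.mk ι, hw⟩
    have hp' : E (InfinitePlace.mk ι).embedding = {p} := hp
    have hq' : E (ComplexEmbedding.conjugate (InfinitePlace.mk ι).embedding) = {q} := hq
    rcases InfinitePlace.mk_eq_iff.mp (InfinitePlace.mk_embedding (InfinitePlace.mk ι)) with hι | hι
    · rw [hι] at hp'
      exact ⟨p, hp'⟩
    · rw [hι] at hq'
      exact ⟨q, hq'⟩
  choose e he using hsing
  have hEe : E = fun ι => {e ι} := funext he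
  have hcc : ∀ ι : K →+* ℂ, ComplexEmbedding.conjugate (ComplexEmbedding.conjugate ι) = ι :=
    fun ι => RingHom.ext fun x => by simp
  -- exact values of `e` at `σ_w`, `σ̄_w`: `± m_w / 2`
  have hex : ∀ w : {w : InfinitePlace K // w.IsComplex},
      e w.1.embedding = (if w.1 = w₁.1 then 1 / 2 else 0) ∧
        e (ComplexEmbedding.conjugate w.1.embedding) = (if w.1 = w₁.1 then -(1 / 2) else 0) := by
    intro w
    obtain ⟨-, hcx⟩ := archParam_of_hasUnitaryArchType τ hχτ hψ hE
    obtain ⟨hp, hq⟩ := hcx w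
    have e1 := Multiset.singleton_inj.1 ((he _).symm.trans hp)
    have e2 := Multiset.singleton_inj.1 ((he _).symm.trans hq)
    rw [e1, e2]
    constructor <;> split_ifs <;> push_cast <;> ring
  -- conjugate differences of `e` are integers
  have hez : ∀ ι : K →+* ℂ, ∃ n : ℤ, e ι - e (ComplexEmbedding.conjugate ι) = n := by
    intro ι
    have hw : (InfinitePlace.mk ι).IsComplex := NumberField.IsTotallyComplex.isComplex _
    obtain ⟨p, q, n, hp, hq, hn⟩ :=
      archParam_embedding_sub_conj_mem_int_glOne τ hE ⟨InfinitePlace.mk ι, hw⟩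
    have hp' : e (InfinitePlace.mk ι).embedding = p := Multiset.singleton_inj.1 ((he _).symm.trans hp)
    have hq' : e (ComplexEmbedding.conjugate (InfinitePlace.mk ι).embedding) = q :=
      Multiset.singleton_inj.1 ((he _).symm.trans hq)
    rcases InfinitePlace.mk_eq_iff.mp (InfinitePlace.mk_embedding (InfinitePlace.mk ι)) with hι | hι
    · rw [hι] at hp' hq'
      exact ⟨n, by rw [hp', hq', hn]⟩
    · have hι' : (InfinitePlace.mk ι).embedding = ComplexEmbedding.conjugate ι := by
        have h' := congrArg ComplexEmbedding.conjugate hι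
        rw [hcc] at h'
        exact h'
      rw [hι'] at hp'
      rw [hι', hcc] at hq'
      exact ⟨-n, by rw [hp', hq']; push_cast; linear_combination -hn⟩
  -- the place indicator `d = (1/4)·𝟙_{mk ι = w₁}` and the exponents `s₁ = e + d`, `s₂ = -d`
  set d : (K →+* ℂ) → ℂ := fun ι => if InfinitePlace.mk ι = w₁.1 then 1 / 4 else 0 with hd
  have hdconj : ∀ ι, d (ComplexEmbedding.conjugate ι) = d ι := fun ι => by
    simp only [hd, mk_conjugate_eq]
  set σ₁ : K →+* ℂ := w₁.1.embedding with hσ₁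
  set σ₂ : K →+* ℂ := w₂.1.embedding with hσ₂
  have hσ₁c : ComplexEmbedding.conjugate σ₁ ≠ σ₁ := fun h =>
    (not_isReal_iff_isComplex.mpr w₁.2) (isReal_iff.mpr (ComplexEmbedding.isReal_iff.mpr h))
  -- (i): `s₁ - s₂ = e + 2d ∈ {1, 0}`
  have hi : ∀ ι : K →+* ℂ, ∃ k : ℤ, (e ι + d ι) - (-d ι) = k := by
    intro ι
    have hw : (InfinitePlace.mk ι).IsComplex := NumberField.IsTotallyComplex.isComplex _
    obtain ⟨h₁, h₂⟩ := hex ⟨InfinitePlace.mk ι, hw⟩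
    by_cases hm : InfinitePlace.mk ι = w₁.1
    · rcases InfinitePlace.mk_eq_iff.mp (InfinitePlace.mk_embedding (InfinitePlace.mk ι)) with hι | hι
      · refine ⟨1, ?_⟩
        have : e ι = 1 / 2 := by rw [← hι]; simpa [hm] using h₁
        rw [this]; simp [hd, hm]; norm_num
      · refine ⟨0, ?_⟩
        have : e ι = -(1 / 2) := by rw [← hι]; simpa [hm] using h₂
        rw [this]; simp [hd, hm]; norm_num
    · rcases InfinitePlace.mk_eq_iff.mp (InfinitePlace.mk_embedding (InfinitePlace.mk ι)) with hι | hι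
      · refine ⟨0, ?_⟩
        have : e ι = 0 := by rw [← hι]; simpa [hm] using h₁
        rw [this]; simp [hd, hm]
      · refine ⟨0, ?_⟩
        have : e ι = 0 := by rw [← hι]; simpa [hm] using h₂
        rw [this]; simp [hd, hm]
  -- (ii): `s₁ ι - s₁ ῑ = e ι - e ῑ ∈ ℤ`
  have hii : ∀ ι : K →+* ℂ, ∃ m : ℤ, (e ι + d ι) - (e (ComplexEmbedding.conjugate ι) +
      d (ComplexEmbedding.conjugate ι)) = m := by
    intro ι
    obtain ⟨n, hn⟩ := hez ι
    exact ⟨n, by rw [hdconj]; linear_combination hn⟩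
  obtain ⟨χ, P, hP, hint⟩ := hC K hK h1 (fun ι => e ι + d ι) (fun ι => -d ι) hi hii
    ⟨⟨τ, hcusp⟩, by
      have : (fun ι : K →+* ℂ => ({(e ι + d ι) + -d ι} : Multiset ℂ)) = E := by
        rw [hEe]; funext ι; congr 1; ring
      rw [this]; exact hE⟩
  -- parallel real parts for `χ`
  obtain ⟨σ, -, hcplx⟩ := exists_re_archParam_parallel_glOne χ.1 hP
  have hPar : ∀ w : {w : InfinitePlace K // w.IsComplex},
      (P w.1.embedding + P (ComplexEmbedding.conjugate w.1.embedding)).re = 2 * σ :=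
    fun w => hcplx w _ _ rfl rfl
  -- values of `e` and `d` at `σ₁, σ̄₁, σ₂, σ̄₂`
  have hw₂ : w₂.1 ≠ w₁.1 := fun h => hne (Subtype.ext h).symm
  obtain ⟨e₁, e₁'⟩ := hex w₁
  obtain ⟨e₂, e₂'⟩ := hex w₂
  rw [if_pos rfl] at e₁ e₁'
  rw [if_neg hw₂] at e₂ e₂'
  have d₁ : d σ₁ = 1 / 4 := by simp [hd, hσ₁, mk_embedding]
  have d₁' : d (ComplexEmbedding.conjugate σ₁) = 1 / 4 := by rw [hdconj, d₁]
  have d₂ : d σ₂ = 0 := by simp [hd, hσ₂, mk_embedding, hw₂]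
  have d₂' : d (ComplexEmbedding.conjugate σ₂) = 0 := by rw [hdconj, d₂]
  obtain ⟨n₁, hn₁⟩ := hint σ₁
  obtain ⟨n₁', hn₁'⟩ := hint (ComplexEmbedding.conjugate σ₁)
  obtain ⟨n₂, hn₂⟩ := hint σ₂
  obtain ⟨n₂', hn₂'⟩ := hint (ComplexEmbedding.conjugate σ₂)
  rw [← hσ₁] at e₁ e₁'
  rw [← hσ₂] at e₂ e₂'
  rw [e₁, d₁] at hn₁
  rw [e₁', d₁'] at hn₁'
  rw [e₂, d₂] at hn₂
  rw [e₂', d₂'] at hn₂'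
  have p₁ := hPar w₁
  have p₂ := hPar w₂
  rw [← hσ₁] at p₁
  rw [← hσ₂] at p₂
  -- real parts
  have r₁ := congrArg Complex.re hn₁
  have r₁' := congrArg Complex.re hn₁'
  have r₂ := congrArg Complex.re hn₂
  have r₂' := congrArg Complex.re hn₂'
  simp only [Complex.add_re, Complex.sub_re, Complex.neg_re, Complex.zero_re, Complex.intCast_re]
    at r₁ r₁' r₂ r₂' p₁ p₂
  have q2 : ((1 : ℂ) / 2).re = 1 / 2 := by norm_num
  have q4 : ((1 : ℂ) / 4).re = 1 / 4 := by norm_num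
  simp only [q2, q4] at r₁ r₁' r₂ r₂'
  have key : (2 * ((n₁ + n₁') - (n₂ + n₂')) : ℝ) = 1 := by linarith
  have key' : (2 * ((n₁ + n₁') - (n₂ + n₂')) : ℤ) = 1 := by exact_mod_cast key
  omega

/-- `ℚ(ζ₅)` has two (complex) infinite places. [folklore] -/
theorem card_infinitePlace_K₅ : Fintype.card (InfinitePlace K₅) = 2 := by
  haveI := isCyclotomicExtension_K₅
  rw [card_eq_nrRealPlaces_add_nrComplexPlaces,
    IsCyclotomicExtension.Rat.nrRealPlaces_eq_zero (n := 5) K₅ (by decide), zero_add,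
    IsCyclotomicExtension.Rat.nrComplexPlaces_eq_totient_div_two (n := 5)]
  rfl

/-- **Hypothesis (iii) is load-bearing: `HalfIntegralTwistCMWithoutParity` is FALSE** (modulo Weil's
unit criterion; witness the CM quartic `ℚ(ζ₅)` with mixed parity at its two complex places). Together
with the positive analysis (uniform ODD parity is as good as uniform even parity) this pins the honest
form of (iii): uniform parity across the complex places. [cite: Patrikis2019, Lemma 2.1.1] -/
theorem halfIntegralTwistCM_false_without_parity (hW : Patrikis2019_heckeCharacter_archType_iff_units) :
    ¬ HalfIntegralTwistCMWithoutParity := by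
  haveI : NumberField.IsCMField K₅ := isCMField_K₅
  have h : 1 < Fintype.card (InfinitePlace K₅) := by rw [card_infinitePlace_K₅]; decide
  obtain ⟨v₁, v₂, hne⟩ := Fintype.exists_pair_of_one_lt_card h
  exact halfIntegralTwistCM_false_without_parity_of_two_complex_places hW (K := K₅)
    ⟨v₁, NumberField.IsTotallyComplex.isComplex v₁⟩ ⟨v₂, NumberField.IsTotallyComplex.isComplex v₂⟩
    (fun e => hne (congrArg Subtype.val e))

/-! ## §7 Load-bearing analysis IV: hypothesis (iv) (automorphy of the given exponents) cannot be
## dropped (sorry-free, UNCONDITIONAL; witness `ℚ(ζ₅)`)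

Without the datum `ω` the exponents `s₁, s₂` are free up to (i)–(iii), and nothing forces
`Re (s₁ σ_w + s₁ σ̄_w)` to be place-independent; but for the re-twist `χ` the quantity
`Re (p σ_w + p σ̄_w) ≡ 1 - Re (s₁ σ_w + s₁ σ̄_w) (mod ℤ)` must be (`exists_re_archParam_parallel_glOne`).
Witness over any CM field with two complex places: `s₁ = s₂ = (1/4 at σ_{w₁} and σ̄_{w₁}, 0 elsewhere)`. -/

/-- The crux with hypothesis (iv) (existence of the datum `ω`) DROPPED; everything else verbatim.
[folklore] -/
def HalfIntegralTwistCMWithoutDatum : Prop :=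
  ∀ (K : Type) [Field K] [NumberField K], NumberField.IsCMField K →
    ∀ (h1 : Literature.NumberTheory.Automorphic.isCompact_glFiniteIntegralLevel 1 K)
      (s₁ s₂ : (K →+* ℂ) → ℂ), (∀ ι, ∃ k : ℤ, s₁ ι - s₂ ι = k) →
      (∀ ι, ∃ m : ℤ, s₁ ι - s₁ (NumberField.ComplexEmbedding.conjugate ι) = m) →
      (∀ ι, ∃ m : ℤ, (s₁ ι - s₂ ι) + (s₁ (NumberField.ComplexEmbedding.conjugate ι) -
        s₂ (NumberField.ComplexEmbedding.conjugate ι)) = 2 * m) →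
      ∃ (χ : Literature.NumberTheory.Automorphic.CuspidalAutomorphicRepData 1 K h1)
        (p : (K →+* ℂ) → ℂ), χ.1.HasArchParameter (fun ι => {p ι}) ∧
          ∀ ι, ∃ m : ℤ, p ι + s₁ ι - 1 / 2 = m

/-- Sanity: `HalfIntegralTwistCMWithoutDatum` implies the crux (pure logic). [folklore] -/
theorem halfIntegralTwistCM_of_withoutDatum (h : HalfIntegralTwistCMWithoutDatum) : Crux :=
  fun K _ _ hK h1 s₁ s₂ hi hii hiii _ => h K hK h1 s₁ s₂ hi hii hiii

/-- **Hypothesis (iv) is load-bearing over every CM field with two complex places** (unconditional):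
`s₁ = s₂ = (1/4)·𝟙_{mk ι = w₁}` satisfies (i)–(iii) and admits no half-integral re-twist, by the
parallelism of real parts for `χ`. [folklore] -/
theorem halfIntegralTwistCM_false_without_datum_of_two_complex_places
    {K : Type} [Field K] [NumberField K] [hK : NumberField.IsCMField K]
    (w₁ w₂ : {w : InfinitePlace K // w.IsComplex}) (hne : w₁ ≠ w₂) : ¬ HalfIntegralTwistCMWithoutDatum := by
  intro hC
  classical
  set h1 : isCompact_glFiniteIntegralLevel 1 K := isCompact_glFiniteIntegralLevel_holds 1 K with hh1
  set d : (K →+* ℂ) → ℂ := fun ι => if InfinitePlace.mk ι = w₁.1 then 1 / 4 else 0 with hd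
  have hdconj : ∀ ι, d (ComplexEmbedding.conjugate ι) = d ι := fun ι => by
    simp only [hd, mk_conjugate_eq]
  obtain ⟨χ, P, hP, hint⟩ := hC K hK h1 d d (fun ι => ⟨0, by simp⟩)
    (fun ι => ⟨0, by rw [hdconj]; simp⟩) (fun ι => ⟨0, by simp⟩)
  obtain ⟨σ, -, hcplx⟩ := exists_re_archParam_parallel_glOne χ.1 hP
  have hPar : ∀ w : {w : InfinitePlace K // w.IsComplex},
      (P w.1.embedding + P (ComplexEmbedding.conjugate w.1.embedding)).re = 2 * σ :=
    fun w => hcplx w _ _ rfl rfl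
  set σ₁ : K →+* ℂ := w₁.1.embedding with hσ₁
  set σ₂ : K →+* ℂ := w₂.1.embedding with hσ₂
  have hw₂ : w₂.1 ≠ w₁.1 := fun h => hne (Subtype.ext h).symm
  have d₁ : d σ₁ = 1 / 4 := by simp [hd, hσ₁, mk_embedding]
  have d₁' : d (ComplexEmbedding.conjugate σ₁) = 1 / 4 := by rw [hdconj, d₁]
  have d₂ : d σ₂ = 0 := by simp [hd, hσ₂, mk_embedding, hw₂]
  have d₂' : d (ComplexEmbedding.conjugate σ₂) = 0 := by rw [hdconj, d₂]
  obtain ⟨n₁, hn₁⟩ := hint σ₁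
  obtain ⟨n₁', hn₁'⟩ := hint (ComplexEmbedding.conjugate σ₁)
  obtain ⟨n₂, hn₂⟩ := hint σ₂
  obtain ⟨n₂', hn₂'⟩ := hint (ComplexEmbedding.conjugate σ₂)
  rw [d₁] at hn₁
  rw [d₁'] at hn₁'
  rw [d₂] at hn₂
  rw [d₂'] at hn₂'
  have p₁ := hPar w₁
  have p₂ := hPar w₂
  rw [← hσ₁] at p₁
  rw [← hσ₂] at p₂
  have r₁ := congrArg Complex.re hn₁
  have r₁' := congrArg Complex.re hn₁'
  have r₂ := congrArg Complex.re hn₂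
  have r₂' := congrArg Complex.re hn₂'
  simp only [Complex.add_re, Complex.sub_re, Complex.zero_re, Complex.intCast_re] at r₁ r₁' r₂ r₂' p₁ p₂
  have q2 : ((1 : ℂ) / 2).re = 1 / 2 := by norm_num
  have q4 : ((1 : ℂ) / 4).re = 1 / 4 := by norm_num
  simp only [q2, q4] at r₁ r₁' r₂ r₂'
  have key : (2 * ((n₁ + n₁') - (n₂ + n₂')) : ℝ) = 1 := by linarith
  have key' : (2 * ((n₁ + n₁') - (n₂ + n₂')) : ℤ) = 1 := by exact_mod_cast key
  omega

/-- **Hypothesis (iv) is load-bearing: `HalfIntegralTwistCMWithoutDatum` is FALSE**, unconditionally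
(witness `ℚ(ζ₅)`): the automorphy of the given exponents `s₁ + s₂` is what makes `Re (s₁ σ + s₁ σ̄)`
place-independent. [folklore] -/
theorem halfIntegralTwistCM_false_without_datum : ¬ HalfIntegralTwistCMWithoutDatum := by
  haveI : NumberField.IsCMField K₅ := isCMField_K₅
  have h : 1 < Fintype.card (InfinitePlace K₅) := by rw [card_infinitePlace_K₅]; decide
  obtain ⟨v₁, v₂, hne⟩ := Fintype.exists_pair_of_one_lt_card h
  exact halfIntegralTwistCM_false_without_datum_of_two_complex_places (K := K₅)
    ⟨v₁, NumberField.IsTotallyComplex.isComplex v₁⟩ ⟨v₂, NumberField.IsTotallyComplex.isComplex v₂⟩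
    (fun e => hne (congrArg Subtype.val e))

/-! ## §8 Non-vacuity: the hypotheses of the crux are jointly satisfiable (sorry-free, unconditional)

The crux is not true for lack of instances: over the CM field `ℚ(ζ₅)`, `s₁ = s₂ = 0` with `ω = π_𝟙`
(parameter `{0}` everywhere, `archParam_trivial_glOne`) satisfy (i)–(iv). (For this instance the
conclusion asks for a datum with exponents in `1/2 + ℤ`, e.g. `‖·‖_𝔸^{1/2}` — true on paper.) -/

/-- **The hypotheses (i)–(iv) of the crux are satisfiable over a CM field** (so any proof by
`False.elim` on the hypotheses is excluded): `K = ℚ(ζ₅)`, `s₁ = s₂ = 0`, `ω = π_𝟙`. [folklore] -/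
theorem hypotheses_satisfiable :
    ∃ (K : Type) (_ : Field K) (_ : NumberField K) (_ : NumberField.IsCMField K)
      (h1 : isCompact_glFiniteIntegralLevel 1 K) (s₁ s₂ : (K →+* ℂ) → ℂ),
      (∀ ι, ∃ k : ℤ, s₁ ι - s₂ ι = k) ∧
      (∀ ι, ∃ m : ℤ, s₁ ι - s₁ (NumberField.ComplexEmbedding.conjugate ι) = m) ∧
      (∀ ι, ∃ m : ℤ, (s₁ ι - s₂ ι) + (s₁ (NumberField.ComplexEmbedding.conjugate ι) -
        s₂ (NumberField.ComplexEmbedding.conjugate ι)) = 2 * m) ∧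
      ∃ ω : CuspidalAutomorphicRepData 1 K h1, ω.1.HasArchParameter (fun ι => {s₁ ι + s₂ ι}) := by
  classical
  set h1 : isCompact_glFiniteIntegralLevel 1 K₅ := isCompact_glFiniteIntegralLevel_holds 1 K₅ with hh1
  obtain ⟨τ, hτW, hτW'⟩ := exists_automorphicRepData_detTwist_glOne h1 (1 : HeckeCharacter K₅)
  have hcusp : τ.W ≤ cuspFormsGL 1 K₅ h1 := by
    rw [hτW, Submodule.span_le]
    rintro _ rfl
    exact IsCuspFormGL.mem_cuspFormsGL
      ⟨isAutomorphicForm_detTwist_glOne h1 (1 : HeckeCharacter K₅), fun k hk hk1 => absurd hk1 (by omega)⟩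
  have hχτ := detTwist_datum_heckeCharacter (hcpt := h1) (θ := (1 : HeckeCharacter K₅)) hτW
  obtain ⟨E, hE⟩ := τ.exists_hasArchParameter_glOne
  have hE0 : E = fun ι => ({(0 : ℂ) + 0} : Multiset ℂ) := by
    funext ι
    rw [add_zero]
    exact archParam_trivial_glOne τ hχτ hE ι
  refine ⟨K₅, inferInstance, inferInstance, isCMField_K₅, h1, fun _ => 0, fun _ => 0,
    fun _ => ⟨0, by simp⟩, fun _ => ⟨0, by simp⟩, fun _ => ⟨0, by simp⟩, ⟨τ, hcusp⟩, ?_⟩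
  rw [← hE0]
  exact hE

/-! ## §9 Natural strengthenings refuted: the integer shifts are necessary and NON-UNIFORM
## (sorry-free, UNCONDITIONAL; witness `ℚ(ζ₅)`; gen 2, cycle 1)

The one-page proof takes `p ι = 1/2 - s₁ ι + N_ι`. Two natural strengthenings of the CONCLUSION fail:
(a) `HalfIntegralTwistCMUniformShift` — a single `N ∈ ℤ` for all `ι`; (b) `HalfIntegralTwistCMExact` —
`N = 0`. Witness for both: `s₁ = (1/2)·𝟙_{mk ι = w₁}`, `s₂ = -s₁`, `ω = π_𝟙` over any CM field with two
complex places: `Re (p σ_{w₁} + p σ̄_{w₁}) = 2N ≠ 1 + 2N = Re (p σ_{w₂} + p σ̄_{w₂})` against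
`exists_re_archParam_parallel_glOne`. So any proof must let `N_ι` depend on `ι` — through
`j_w = ((s₁-s₂) σ_w + (s₁-s₂) σ̄_w)/2`, with `N_{σ_w} + N_{σ̄_w} = j_w + const`. Landed as
`Theorems/HalfIntegralTwistCM/Negative/ExactShift.lean`. -/

/-- The crux with its conclusion STRENGTHENED to a UNIFORM integer shift: one `N ∈ ℤ` with
`p ι = 1/2 - s₁ ι + N` at every embedding (hypotheses verbatim). [folklore] -/
def HalfIntegralTwistCMUniformShift : Prop :=
  ∀ (K : Type) [Field K] [NumberField K], NumberField.IsCMField K →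
    ∀ (h1 : Literature.NumberTheory.Automorphic.isCompact_glFiniteIntegralLevel 1 K)
      (s₁ s₂ : (K →+* ℂ) → ℂ), (∀ ι, ∃ k : ℤ, s₁ ι - s₂ ι = k) →
      (∀ ι, ∃ m : ℤ, s₁ ι - s₁ (NumberField.ComplexEmbedding.conjugate ι) = m) →
      (∀ ι, ∃ m : ℤ, (s₁ ι - s₂ ι) + (s₁ (NumberField.ComplexEmbedding.conjugate ι) -
        s₂ (NumberField.ComplexEmbedding.conjugate ι)) = 2 * m) →
      (∃ ω : Literature.NumberTheory.Automorphic.CuspidalAutomorphicRepData 1 K h1,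
        ω.1.HasArchParameter (fun ι => {s₁ ι + s₂ ι})) →
      ∃ (χ : Literature.NumberTheory.Automorphic.CuspidalAutomorphicRepData 1 K h1) (N : ℤ),
        χ.1.HasArchParameter (fun ι => {1 / 2 - s₁ ι + N})

/-- The crux with its conclusion STRENGTHENED to the EXACT half-twist `p = 1/2 - s₁` (no integer
shift at all; hypotheses verbatim). [folklore] -/
def HalfIntegralTwistCMExact : Prop :=
  ∀ (K : Type) [Field K] [NumberField K], NumberField.IsCMField K →
    ∀ (h1 : Literature.NumberTheory.Automorphic.isCompact_glFiniteIntegralLevel 1 K)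
      (s₁ s₂ : (K →+* ℂ) → ℂ), (∀ ι, ∃ k : ℤ, s₁ ι - s₂ ι = k) →
      (∀ ι, ∃ m : ℤ, s₁ ι - s₁ (NumberField.ComplexEmbedding.conjugate ι) = m) →
      (∀ ι, ∃ m : ℤ, (s₁ ι - s₂ ι) + (s₁ (NumberField.ComplexEmbedding.conjugate ι) -
        s₂ (NumberField.ComplexEmbedding.conjugate ι)) = 2 * m) →
      (∃ ω : Literature.NumberTheory.Automorphic.CuspidalAutomorphicRepData 1 K h1,
        ω.1.HasArchParameter (fun ι => {s₁ ι + s₂ ι})) →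
      ∃ χ : Literature.NumberTheory.Automorphic.CuspidalAutomorphicRepData 1 K h1,
        χ.1.HasArchParameter (fun ι => {1 / 2 - s₁ ι})

/-- Sanity: the exact form implies the uniform-shift form (`N = 0`). [folklore] -/
theorem uniformShift_of_exact (h : HalfIntegralTwistCMExact) : HalfIntegralTwistCMUniformShift := by
  intro K _ _ hK h1 s₁ s₂ hi hii hiii hiv
  obtain ⟨χ, hχ⟩ := h K hK h1 s₁ s₂ hi hii hiii hiv
  refine ⟨χ, 0, ?_⟩
  have : (fun ι : K →+* ℂ => ({1 / 2 - s₁ ι + ((0 : ℤ) : ℂ)} : Multiset ℂ)) =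
      fun ι => ({1 / 2 - s₁ ι} : Multiset ℂ) := by
    funext ι; push_cast; rw [add_zero]
  rw [this]; exact hχ

/-- Sanity: the uniform-shift form implies the crux (`p := 1/2 - s₁ + N`, `m := N`). [folklore] -/
theorem crux_of_uniformShift (h : HalfIntegralTwistCMUniformShift) :
    Summit.Langlands.Langlands.Theses.IrreducibilityBySelfDuality.HalfIntegralTwistCM := by
  intro K _ _ hK h1 s₁ s₂ hi hii hiii hiv
  obtain ⟨χ, N, hχ⟩ := h K hK h1 s₁ s₂ hi hii hiii hiv
  exact ⟨χ, fun ι => 1 / 2 - s₁ ι + N, hχ, fun ι => ⟨N, by ring⟩⟩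

/-- **The uniform-shift strengthening is FALSE over every CM field with two complex places**
(unconditional). Witness `s₁ = (1/2)·𝟙_{mk ι = w₁}`, `s₂ = -s₁`, `ω = π_𝟙`: (i)–(iv) hold, and a datum
with exponents `1/2 - s₁ + N` would have `Re (p σ_{w₁} + p σ̄_{w₁}) = 2N` but
`Re (p σ_{w₂} + p σ̄_{w₂}) = 1 + 2N`, contradicting the parallelism of real parts
(`exists_re_archParam_parallel_glOne`). MORAL for the prover: the integer shifts `N_ι` of the one-page
proof must DEPEND on `ι` (through `((s₁-s₂) ι + (s₁-s₂) ῑ)/2`). [folklore] -/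
theorem not_uniformShift_of_two_complex_places
    {K : Type} [Field K] [NumberField K] [hK : NumberField.IsCMField K]
    (w₁ w₂ : {w : InfinitePlace K // w.IsComplex}) (hne : w₁ ≠ w₂) : ¬ HalfIntegralTwistCMUniformShift := by
  intro hC
  classical
  set h1 : isCompact_glFiniteIntegralLevel 1 K := isCompact_glFiniteIntegralLevel_holds 1 K with hh1
  -- the exponents `s₁ = (1/2)·𝟙_{w₁}`, `s₂ = -s₁`
  set s : (K →+* ℂ) → ℂ := fun ι => if InfinitePlace.mk ι = w₁.1 then 1 / 2 else 0 with hs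
  have hsconj : ∀ ι, s (ComplexEmbedding.conjugate ι) = s ι := fun ι => by
    simp only [hs, mk_conjugate_eq]
  -- the trivial datum `π_𝟙`, parameter `{0} = {s + (-s)}`
  obtain ⟨τ, hτW, hτW'⟩ := exists_automorphicRepData_detTwist_glOne h1 (1 : HeckeCharacter K)
  have hcusp : τ.W ≤ cuspFormsGL 1 K h1 := by
    rw [hτW, Submodule.span_le]
    rintro _ rfl
    exact IsCuspFormGL.mem_cuspFormsGL
      ⟨isAutomorphicForm_detTwist_glOne h1 (1 : HeckeCharacter K), fun k hk hk1 => absurd hk1 (by omega)⟩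
  have hχτ := detTwist_datum_heckeCharacter (hcpt := h1) (θ := (1 : HeckeCharacter K)) hτW
  obtain ⟨E, hE⟩ := τ.exists_hasArchParameter_glOne
  have hE0 : E = fun ι => ({s ι + -s ι} : Multiset ℂ) := by
    funext ι
    rw [add_neg_cancel]
    exact archParam_trivial_glOne τ hχτ hE ι
  -- hypotheses (i)–(iii)
  have hi : ∀ ι : K →+* ℂ, ∃ k : ℤ, s ι - -s ι = k := by
    intro ι
    by_cases h : InfinitePlace.mk ι = w₁.1
    · exact ⟨1, by simp [hs, h]; norm_num⟩
    · exact ⟨0, by simp [hs, h]⟩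
  have hii : ∀ ι : K →+* ℂ, ∃ m : ℤ, s ι - s (ComplexEmbedding.conjugate ι) = m :=
    fun ι => ⟨0, by rw [hsconj]; simp⟩
  have hiii : ∀ ι : K →+* ℂ, ∃ m : ℤ, (s ι - -s ι) + (s (ComplexEmbedding.conjugate ι) -
      -s (ComplexEmbedding.conjugate ι)) = 2 * m := by
    intro ι
    rw [hsconj]
    by_cases h : InfinitePlace.mk ι = w₁.1
    · exact ⟨1, by simp [hs, h]; norm_num⟩
    · exact ⟨0, by simp [hs, h]⟩
  obtain ⟨χ, N, hP⟩ := hC K hK h1 s (fun ι => -s ι) hi hii hiii ⟨⟨τ, hcusp⟩, by rw [← hE0]; exact hE⟩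
  -- parallel real parts for `χ`
  obtain ⟨σ, -, hcplx⟩ := exists_re_archParam_parallel_glOne χ.1 hP
  have hPar : ∀ w : {w : InfinitePlace K // w.IsComplex},
      ((1 / 2 - s w.1.embedding + N) + (1 / 2 - s (ComplexEmbedding.conjugate w.1.embedding) + N)).re
        = 2 * σ := fun w => hcplx w _ _ rfl rfl
  have hw₂ : w₂.1 ≠ w₁.1 := fun h => hne (Subtype.ext h).symm
  have e₁ : s w₁.1.embedding = 1 / 2 := by simp [hs, mk_embedding]
  have e₂ : s w₂.1.embedding = 0 := by simp [hs, mk_embedding, hw₂]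
  have p₁ := hPar w₁
  have p₂ := hPar w₂
  rw [hsconj, e₁] at p₁
  rw [hsconj, e₂] at p₂
  simp only [Complex.add_re, Complex.sub_re, Complex.zero_re, Complex.intCast_re] at p₁ p₂
  have q2 : ((1 : ℂ) / 2).re = 1 / 2 := by norm_num
  simp only [q2] at p₁ p₂
  linarith

/-- **`HalfIntegralTwistCMUniformShift` is FALSE** (unconditional; witness `ℚ(ζ₅)`). [folklore] -/
theorem not_halfIntegralTwistCMUniformShift : ¬ HalfIntegralTwistCMUniformShift := by
  haveI : NumberField.IsCMField K₅ := isCMField_K₅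
  have h : 1 < Fintype.card (InfinitePlace K₅) := by rw [card_infinitePlace_K₅]; decide
  obtain ⟨v₁, v₂, hne⟩ := Fintype.exists_pair_of_one_lt_card h
  exact not_uniformShift_of_two_complex_places (K := K₅)
    ⟨v₁, NumberField.IsTotallyComplex.isComplex v₁⟩ ⟨v₂, NumberField.IsTotallyComplex.isComplex v₂⟩
    (fun e => hne (congrArg Subtype.val e))

/-- **`HalfIntegralTwistCMExact` is FALSE** (unconditional; witness `ℚ(ζ₅)`): the exact half-twist
`p = 1/2 - s₁` is in general NOT automorphic — the integer shifts are necessary. [folklore] -/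
theorem not_halfIntegralTwistCMExact : ¬ HalfIntegralTwistCMExact :=
  fun h => not_halfIntegralTwistCMUniformShift (uniformShift_of_exact h)


end Summit.Langlands.Langlands.Cruxes.HalfIntegralTwistCM.Disproof

/-! ## §10 Weil NECESSITY: the unit relation of a `GL₁` datum (sorry-free, any number field; gen 2)

The necessity half of Weil's unit criterion in the tree's Borel–Jacquet `GL₁` model, for quasi-characters
with arbitrary complex exponents (landed as `Theorems/HalfIntegralTwistCM/Negative/UnitRelation.lean`):
`θ((u^M)_∞, 1) = 1` for one `M` and all units (`heckeCharacter_exists_pow_map_infiniteIdeles_units_eq_one`),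
the exponential formula for `θ_∞` (`heckeCharacter_infiniteIdeles_eq_exp_sum`), and the UNIT RELATION
`unit_relation_glOne`: `exp (M (∑_{w real} c_w log|u|_w + ∑_{w cplx} (a_w p_w + ā_w q_w))) = 1` for every unit `u`
and every choice of logarithms `e^{a_w} = σ_w(u)`. This is STUB 1 (`necessity_weilForm`) of the crux line
(card torsion-blind-unit-criterion) in exponent form, FREE of any named fact. -/


-- Mathlib idiom (Mathlib/Algebra/Lie/OfAssociative.lean): commutator bracket on matrices, needed to
-- mention `𝔤 →ₗ⁅ℝ⁆ End V` (as in `AutomorphicRepsGLOneArchParameter`)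
attribute [local instance 100] LieRing.ofAssociativeRing

open scoped MatrixGroups Matrix Classical NumberField ComplexConjugate
open NumberField NumberField.InfinitePlace NumberField.mixedEmbedding IsDedekindDomain

namespace Summit.Langlands.Langlands.Cruxes.HalfIntegralTwistCM.Disproof

open Literature.NumberTheory.Automorphic
open Literature.NumberTheory.GaloisRepresentations

variable {K : Type} [Field K] [NumberField K] {hcpt : isCompact_glFiniteIntegralLevel 1 K}

/-- **A Hecke character kills the infinite parts of a uniform power of the global units.** For every
Hecke (quasi-)character `χ` of `K` there is `M ≥ 1` with `χ((u^M)_∞, 1) = 1` for all `u ∈ 𝓞_Kˣ`: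
take a module of definition `𝔪` of `χ` (`exists_isModulus`), `M` with `u^M ≡ 1 mod 𝔪`
(`exists_unit_pow_sub_one_mem`), and split the principal idele of `u^M` (`map_principalIdele_eq`:
its finite part lies in `I_f^𝔪`). This is the idelic heart of the necessity half of Weil's unit
criterion. Weil 1956, §1; Patrikis 2019, Lemma 2.1.1 (⇒). [cite: Patrikis2019, Lemma 2.1.1] -/
theorem heckeCharacter_exists_pow_map_infiniteIdeles_units_eq_one (χ : HeckeCharacter K) :
    ∃ M : ℕ, 0 < M ∧ ∀ u : (𝓞 K)ˣ,
      χ (infiniteIdeles K (globalToInfiniteUnits K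
        (Units.map (algebraMap (𝓞 K) K : 𝓞 K →* K) (u ^ M)))) = 1 := by
  classical
  obtain ⟨T, e, hmod⟩ := χ.exists_isModulus
  obtain ⟨M, hM, hcong⟩ :=
    HeckeCharacter.exists_unit_pow_sub_one_mem (HeckeCharacter.modulusIdeal T e)
      (HeckeCharacter.modulusIdeal_ne_bot T e)
  refine ⟨M, hM, fun u => ?_⟩
  set k : Kˣ := Units.map (algebraMap (𝓞 K) K : 𝓞 K →* K) (u ^ M) with hk
  have hkval : (k : K) = algebraMap (𝓞 K) K (((u ^ M : (𝓞 K)ˣ) : 𝓞 K)) := rfl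
  -- `k` is a unit at every finite place
  have hunit : ∀ v : HeightOneSpectrum (𝓞 K), v.valuation K (k : K) = 1 := by
    intro v
    rw [hkval]
    refine (HeightOneSpectrum.valuation_eq_one_iff_notMem (K := K) v).mpr fun hmem => ?_
    exact v.isPrime.ne_top (Ideal.eq_top_of_isUnit_mem _ hmem (Units.isUnit _))
  have hB := HeckeCharacter.map_principalIdele_eq hmod k (S := T) subset_rfl (fun v _ => hunit v)
  -- the local factors at `T` are killed: `k ≡ 1 mod 𝔪`
  have hT : ∏ v ∈ T, χ (localUnits v (globalToLocalUnits v k)) = 1 := by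
    rw [← map_prod]
    refine HeckeCharacter.map_prod_localUnits_eq_one_of_isModulus hmod
      (fun v => globalToLocalUnits v k) (fun v _ => ?_) (fun v hv => ?_)
    · rw [val_globalToLocalUnits,
        Literature.NumberTheory.GaloisRepresentations.valued_algebraMap_adicCompletion]
      exact hunit v
    · rw [val_globalToLocalUnits]
      have hsub : algebraMap K (v.adicCompletion K) (k : K) - 1 =
          algebraMap K (v.adicCompletion K)
            (algebraMap (𝓞 K) K (((u ^ M : (𝓞 K)ˣ) : 𝓞 K) - 1)) := by
        rw [map_sub, map_one, map_sub, map_one, hkval]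
      rw [hsub, Literature.NumberTheory.GaloisRepresentations.valued_algebraMap_adicCompletion,
        HeightOneSpectrum.valuation_of_algebraMap]
      have hmem : ((u ^ M : (𝓞 K)ˣ) : 𝓞 K) - 1 ∈ v.asIdeal ^ (e v + 1) := by
        have h := hcong u
        rw [← Units.val_pow_eq_pow_val] at h
        exact Ideal.le_of_dvd (HeckeCharacter.pow_dvd_modulusIdeal e hv) h
      calc v.intValuation (((u ^ M : (𝓞 K)ˣ) : 𝓞 K) - 1)
          ≤ WithZero.exp (-((e v + 1 : ℕ) : ℤ)) :=
            (HeightOneSpectrum.intValuation_le_pow_iff_mem v _ (e v + 1)).mpr hmem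
        _ ≤ WithZero.exp (-(e v : ℤ)) := WithZero.exp_le_exp.mpr (by push_cast; linarith)
  rwa [hT, mul_one] at hB

/-- **The Hecke character of a `GL₁` datum on exponential infinite ideles** (all places at once): if
`θ` is the Hecke character of `π = W / W'` (`r(g) φ - θ(det g) φ ∈ W'`), `P` its archimedean parameter
with `P σ_w = {c_w}` at real `w` and `P σ_w = {p_w}`, `P σ̄_w = {q_w}` at complex `w`, and the infinite
idele `x` has coordinates `ι_w(x_w) = e^{r_w}` (`r_w ∈ ℝ`, real `w`) and `ι_w(x_w) = e^{a_w}` (complex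
`w`), then `θ((x, 1)) = exp (∑_{w real} r_w c_w + ∑_{w complex} (a_w p_w + ā_w q_w))` — i.e.
`θ_∞ = ∏_{w real} |·|^{c_w} ∏_{w complex} z^{p_w} z̄^{q_w}` on the image of `exp`. (The idele `(x,1)` is
`det (exp Y, 1)` for the matrix `Y = (r, a)`, along which `θ` is `e^{d(Y)}`; `d` is read off `P` by the
Harish-Chandra clauses.) Gelbart 1975, §2.A; Clozel 1990, §3.3; Knapp 2002, Thm. 5.44.
[cite: Clozel1990, §3.3] -/
theorem heckeCharacter_infiniteIdeles_eq_exp_sum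
    (π : AutomorphicRepData (AutomorphyDatum.gl 1 K hcpt)) {θ : HeckeCharacter K}
    (hθ : ∀ (g : (AdelicGroupData.gl 1 K).Adelic), ∀ φ ∈ π.W,
      rightTranslation (AdelicGroupData.gl 1 K) g φ -
        ((θ (Matrix.GeneralLinearGroup.det g) : ℂˣ) : ℂ) • φ ∈ π.W')
    {P : (K →+* ℂ) → Multiset ℂ} (hP : π.HasArchParameter P)
    {c : {w : InfinitePlace K // w.IsReal} → ℂ} (hc : ∀ w, P w.1.embedding = {c w})
    {p q : {w : InfinitePlace K // w.IsComplex} → ℂ} (hp : ∀ w, P w.1.embedding = {p w})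
    (hq : ∀ w, P (ComplexEmbedding.conjugate w.1.embedding) = {q w})
    (x : (InfiniteAdeleRing K)ˣ) (r : {w : InfinitePlace K // w.IsReal} → ℝ)
    (a : {w : InfinitePlace K // w.IsComplex} → ℂ)
    (hr : ∀ w, Completion.extensionEmbedding w.1 ((x : InfiniteAdeleRing K) w.1) =
      ((Real.exp (r w) : ℝ) : ℂ))
    (ha : ∀ w, Completion.extensionEmbedding w.1 ((x : InfiniteAdeleRing K) w.1) = Complex.exp (a w)) :
    ((θ (infiniteIdeles K x) : ℂˣ) : ℂ) =
      Complex.exp (∑ w, (r w : ℂ) * c w + ∑ w, (a w * p w + conj (a w) * q w)) := by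
  classical
  -- the Lie algebra acts on the line `W / W'` through the real linear form `d'`
  obtain ⟨ρ, hρ⟩ := π.exists_hasLieAction_gl
  obtain ⟨d', hd'⟩ := π.exists_linearMap_lieAction_eq_smul_one_glOne ρ
  -- the link `θ(det (exp Y, 1)) = e^{d'(Y)}`
  have hlink : ∀ Y : Matrix (Fin 1) (Fin 1) (mixedSpace K),
      ((θ (Matrix.GeneralLinearGroup.det (GLn.ofInfinite 1 K (expGL Y))) : ℂˣ) : ℂ) =
        Complex.exp (d' ⟨Y, trivial⟩) := by
    intro Y
    have h := π.heckeCharacter_glOne_det_ofArch_expMem hθ ⟨Y, trivial⟩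
      (fun φ hφ => π.lieDeriv_sub_smul_mem_of_hasLieAction_glOne hρ hd' ⟨Y, trivial⟩ hφ) 1
    rw [one_smul, Complex.ofReal_one, one_mul] at h
    exact h
  obtain ⟨hre, hco⟩ := π.archParameter_clauses_glOne hρ d' hd' hP
  -- `d'` as a linear form on all of `𝔤𝔩₁(K_∞)`
  let D : Matrix (Fin 1) (Fin 1) (mixedSpace K) →ₗ[ℝ] ℂ := d' ∘ₗ
    ((LieSubalgebra.topEquiv.symm : Matrix (Fin 1) (Fin 1) (mixedSpace K) ≃ₗ⁅ℝ⁆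
        (⊤ : LieSubalgebra ℝ (Matrix (Fin 1) (Fin 1) (mixedSpace K)))).toLinearMap)
  have hD : ∀ Y, D Y = d' ⟨Y, trivial⟩ := fun Y => rfl
  -- real places: `D(r · 1_w) = r c_w`
  have hDre : ∀ (w : {w : InfinitePlace K // w.IsReal}) (s : ℝ),
      D (realPlaceLie 1 w (s • (1 : Matrix (Fin 1) (Fin 1) ℝ))) = (s : ℂ) * c w := by
    intro w s
    have h1 : realPlaceLie 1 w (s • (1 : Matrix (Fin 1) (Fin 1) ℝ)) = s • realPlaceLie 1 w 1 := by
      rw [map_smul]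
    rw [h1, map_smul, hD, Complex.real_smul]
    congr 1
    exact Multiset.singleton_inj.1 ((hre w).symm.trans (hc w))
  -- complex places: `D(b_w) = b p_w + b̄ q_w`
  have hDco : ∀ (w : {w : InfinitePlace K // w.IsComplex}) (b : ℂ),
      D (complexPlaceLie 1 w (b • (1 : Matrix (Fin 1) (Fin 1) ℂ))) = b * p w + conj b * q w := by
    intro w b
    let L : ℂ →ₗ[ℝ] ℂ := D ∘ₗ ((complexPlaceLie 1 w).toLinearMap ∘ₗ
      ((LinearMap.toSpanSingleton ℂ (Matrix (Fin 1) (Fin 1) ℂ) 1).restrictScalars ℝ))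
    have hL : ∀ b : ℂ, L b = d' ⟨complexPlaceLie 1 w (b • (1 : Matrix (Fin 1) (Fin 1) ℂ)), trivial⟩ :=
      fun b => rfl
    have hsum : L b = b * HCEmb.proj (L : ℂ → ℂ) (AlgHom.id ℝ ℂ) 1 +
        conj b * HCEmb.proj (L : ℂ → ℂ) (Complex.conjAe : ℂ →ₐ[ℝ] ℂ) 1 := by
      have h := HCEmb.sum_proj (𝕜 := ℂ) L.toAddMonoidHom b
      rw [LinearMap.toAddMonoidHom_coe] at h
      rw [← h]
      obtain ⟨huniv, hne⟩ := univ_algHom_complex_eq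
      rw [huniv, Finset.sum_pair hne]
      have h1 := HCEmb.proj_smul L (AlgHom.id ℝ ℂ) b (1 : ℂ)
      have h2 := HCEmb.proj_smul L (Complex.conjAe : ℂ →ₐ[ℝ] ℂ) b (1 : ℂ)
      rw [smul_eq_mul, mul_one, smul_eq_mul] at h1 h2
      rw [h1, h2]
      rfl
    have hpw : HCEmb.proj (L : ℂ → ℂ) (AlgHom.id ℝ ℂ) 1 = p w := by
      have h := hco w (AlgHom.id ℝ ℂ)
      rw [algHomId_toRingHom_comp] at h
      exact Multiset.singleton_inj.1 (h.symm.trans (hp w))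
    have hqw : HCEmb.proj (L : ℂ → ℂ) (Complex.conjAe : ℂ →ₐ[ℝ] ℂ) 1 = q w := by
      have h := hco w (Complex.conjAe : ℂ →ₐ[ℝ] ℂ)
      rw [conjAe_toRingHom_comp] at h
      exact Multiset.singleton_inj.1 (h.symm.trans (hq w))
    have hDL : D (complexPlaceLie 1 w (b • (1 : Matrix (Fin 1) (Fin 1) ℂ))) = L b := rfl
    rw [hDL, hsum, hpw, hqw]
  -- the matrix `Y = (r, a)` and the decomposition of `D Y`
  set Y : Matrix (Fin 1) (Fin 1) (mixedSpace K) :=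
    Matrix.of fun _ _ => ((fun w => r w, fun w => a w) : mixedSpace K) with hY
  have hY00 : Y 0 0 = ((fun w => r w, fun w => a w) : mixedSpace K) := rfl
  have hYre : ∀ w : {w : InfinitePlace K // w.IsReal},
      Y.map (fun y : mixedSpace K => y.1 w) = r w • (1 : Matrix (Fin 1) (Fin 1) ℝ) := by
    intro w
    ext i j
    fin_cases i; fin_cases j
    simp [hY]
  have hYco : ∀ w : {w : InfinitePlace K // w.IsComplex},
      Y.map (fun y : mixedSpace K => y.2 w) = a w • (1 : Matrix (Fin 1) (Fin 1) ℂ) := by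
    intro w
    ext i j
    fin_cases i; fin_cases j
    simp [hY]
  have hDY : D Y = ∑ w, (r w : ℂ) * c w + ∑ w, (a w * p w + conj (a w) * q w) := by
    conv_lhs => rw [eq_sum_realPlaceLie_add_sum_complexPlaceLie 1 Y]
    rw [map_add, map_sum, map_sum]
    congr 1
    · exact Finset.sum_congr rfl fun w _ => by rw [hYre, hDre]
    · exact Finset.sum_congr rfl fun w _ => by rw [hYco, hDco]
  -- `(x, 1) = det (exp Y, 1)`
  have hx : infiniteIdeles K x = Matrix.GeneralLinearGroup.det (GLn.ofInfinite 1 K (expGL Y)) := by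
    refine idele_eq_of_snd_eq_of_extensionEmbedding_eq K ?_ (fun w => ?_)
    · rw [det_ofInfinite_snd]
      rfl
    · rw [extensionEmbedding_det_ofInfinite_expGL, infiniteIdeles_fst, hY00]
      by_cases hw : w.IsReal
      · rw [dif_pos hw]
        exact hr ⟨w, hw⟩
      · rw [dif_neg hw]
        exact ha ⟨w, not_isReal_iff_isComplex.1 hw⟩
  rw [hx, hlink, ← hD, hDY]

omit [NumberField K] in
/-- At a real place the embedding of a global element is real: `σ_w(y)^2 = |y|_w^2`. [folklore] -/
theorem embedding_sq_eq_of_isReal (w : {w : InfinitePlace K // w.IsReal}) (y : K) :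
    w.1.embedding y ^ 2 = ((w.1 y ^ 2 : ℝ) : ℂ) := by
  have hreal : ComplexEmbedding.IsReal w.1.embedding := isReal_iff.mp w.2
  have hconj : conj (w.1.embedding y) = w.1.embedding y := by
    have := RingHom.congr_fun hreal y
    simpa [ComplexEmbedding.conjugate] using this
  rw [sq, ← norm_embedding_eq w.1 y]
  nth_rewrite 2 [← hconj]
  rw [Complex.mul_conj, Complex.normSq_eq_norm_sq]

/-- **Weil's unit relation for a `GL₁` datum (necessity half of the unit criterion; any number
field).** Let `π = W / W'` be an automorphic representation of `GL₁(𝔸_K)` with Hecke character `θ`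
and archimedean parameter `P` (`P σ_w = {c_w}` at real `w`; `{p_w}`, `{q_w}` at `σ_w`, `σ̄_w` for
complex `w`). Then there is `M ≥ 1` such that for EVERY global unit `u` and EVERY choice of
logarithms `e^{a_w} = σ_w(u)` at the complex places,
`exp (M · (∑_{w real} c_w log |u|_w + ∑_{w complex} (a_w p_w + ā_w q_w))) = 1` — the character
`∏_w |·|^{c_w} ∏_w z^{p_w} z̄^{q_w}` of `K_∞ˣ` is trivial on the `M`-th powers of the units (`M` even,
so real places see only `|u|_w`). Proof: `θ((u^M)_∞, 1) = 1` (previous lemma, applied to `u²`) and the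
exponential formula for `θ_∞`. Weil 1956; Patrikis 2019, Lemma 2.1.1 (direction ⇒), here for
quasi-characters with complex exponents. [cite: Patrikis2019, Lemma 2.1.1] -/
theorem unit_relation_glOne
    (π : AutomorphicRepData (AutomorphyDatum.gl 1 K hcpt)) {θ : HeckeCharacter K}
    (hθ : ∀ (g : (AdelicGroupData.gl 1 K).Adelic), ∀ φ ∈ π.W,
      rightTranslation (AdelicGroupData.gl 1 K) g φ -
        ((θ (Matrix.GeneralLinearGroup.det g) : ℂˣ) : ℂ) • φ ∈ π.W')
    {P : (K →+* ℂ) → Multiset ℂ} (hP : π.HasArchParameter P)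
    {c : {w : InfinitePlace K // w.IsReal} → ℂ} (hc : ∀ w, P w.1.embedding = {c w})
    {p q : {w : InfinitePlace K // w.IsComplex} → ℂ} (hp : ∀ w, P w.1.embedding = {p w})
    (hq : ∀ w, P (ComplexEmbedding.conjugate w.1.embedding) = {q w}) :
    ∃ M : ℕ, 0 < M ∧ ∀ (u : (𝓞 K)ˣ) (a : {w : InfinitePlace K // w.IsComplex} → ℂ),
      (∀ w, Complex.exp (a w) = w.1.embedding ((u : 𝓞 K) : K)) →
      Complex.exp ((M : ℂ) * (∑ w : {w : InfinitePlace K // w.IsReal},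
          (Real.log (w.1 ((u : 𝓞 K) : K)) : ℂ) * c w +
        ∑ w : {w : InfinitePlace K // w.IsComplex}, (a w * p w + conj (a w) * q w))) = 1 := by
  obtain ⟨M₀, hM₀, hkill⟩ := heckeCharacter_exists_pow_map_infiniteIdeles_units_eq_one θ
  refine ⟨2 * M₀, by omega, fun u a ha => ?_⟩
  set M : ℕ := 2 * M₀ with hM
  set k : Kˣ := Units.map (algebraMap (𝓞 K) K : 𝓞 K →* K) ((u ^ 2) ^ M₀) with hk
  have hθk : θ (infiniteIdeles K (globalToInfiniteUnits K k)) = 1 := hkill (u ^ 2)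
  have hkval : (k : K) = ((u : 𝓞 K) : K) ^ M := by
    rw [hk, Units.coe_map, ← pow_mul, Units.val_pow_eq_pow_val]
    rfl
  have hu0 : ((u : 𝓞 K) : K) ≠ 0 := by exact_mod_cast Units.ne_zero u
  -- coordinates of `(u^M)_∞`
  have hcoord : ∀ w : InfinitePlace K, Completion.extensionEmbedding w
      ((globalToInfiniteUnits K k : InfiniteAdeleRing K) w) = w.embedding ((u : 𝓞 K) : K) ^ M := by
    intro w
    have h1 : Completion.extensionEmbedding w ((globalToInfiniteUnits K k : InfiniteAdeleRing K) w) =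
        w.embedding (k : K) := by
      rw [val_globalToInfiniteUnits, InfiniteAdeleRing.algebraMap_apply]
      exact Completion.extensionEmbedding_coe w (WithAbs.toAbs w.1 (k : K))
    rw [h1, hkval, map_pow]
  have hval := heckeCharacter_infiniteIdeles_eq_exp_sum π hθ hP hc hp hq (globalToInfiniteUnits K k)
    (fun w => M * Real.log (w.1 ((u : 𝓞 K) : K))) (fun w => M * a w) (fun w => ?_) (fun w => ?_)
  · -- the exponents agree
    have harg : (M : ℂ) * (∑ w : {w : InfinitePlace K // w.IsReal},
          (Real.log (w.1 ((u : 𝓞 K) : K)) : ℂ) * c w +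
        ∑ w : {w : InfinitePlace K // w.IsComplex}, (a w * p w + conj (a w) * q w)) =
        ∑ w : {w : InfinitePlace K // w.IsReal},
          (((M : ℝ) * Real.log (w.1 ((u : 𝓞 K) : K)) : ℝ) : ℂ) * c w +
        ∑ w : {w : InfinitePlace K // w.IsComplex},
          ((M : ℂ) * a w * p w + conj ((M : ℂ) * a w) * q w) := by
      rw [mul_add, Finset.mul_sum, Finset.mul_sum]
      congr 1
      · refine Finset.sum_congr rfl fun w _ => ?_
        push_cast
        ring
      · refine Finset.sum_congr rfl fun w _ => ?_
        rw [map_mul, Complex.conj_natCast]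
        ring
    rw [harg, ← hval, hθk, Units.val_one]
  · -- real place: `σ_w(u)^M = |u|_w^M = e^{M log |u|_w}` (`M` even)
    have hpos : 0 < w.1 ((u : 𝓞 K) : K) := pos_iff.mpr hu0
    rw [hcoord, Real.exp_nat_mul, Real.exp_log hpos, hM, pow_mul, embedding_sq_eq_of_isReal w,
      ← Complex.ofReal_pow, ← pow_mul]
  · -- complex place: `σ_w(u)^M = e^{M a_w}`
    rw [hcoord, ← ha w, ← Complex.exp_nat_mul]

end Summit.Langlands.Langlands.Cruxes.HalfIntegralTwistCM.Disproof

namespace Summit.Langlands.Langlands.Cruxes.HalfIntegralTwistCM.Disproof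

open scoped Classical NumberField ComplexConjugate
open NumberField NumberField.InfinitePlace
open Literature.NumberTheory.Automorphic
open Literature.NumberTheory.GaloisRepresentations

/-! ## §10b Weil's unit relation in Patrikis's `archUnitaryValue` form (totally complex fields; gen 2)

`unit_relation_weilForm_glOne` is VERBATIM the stub `necessity_weilForm` of card torsion-blind-unit-criterion
(`SketchIdeator3.lean`, stated for CM `K`), proved for every totally complex `K` with NO named fact: §10 +
the ideator's bridge identity + parallel real weights + the product formula. Landed as
`Negative/UnitRelationWeilForm.lean`. -/

/-- `(e^x)^s = e^{x s}` for real `x` (principal power of a positive real). [folklore] -/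
theorem ofReal_exp_cpow' (x : ℝ) (s : ℂ) : ((Real.exp x : ℝ) : ℂ) ^ s = Complex.exp (x * s) := by
  have hpos : (0 : ℝ) < Real.exp x := Real.exp_pos x
  have hne : ((Real.exp x : ℝ) : ℂ) ≠ 0 := by exact_mod_cast hpos.ne'
  rw [Complex.cpow_def_of_ne_zero hne, Complex.ofReal_exp,
    Complex.log_exp (by simp [Real.pi_pos]) (by simpa using Real.pi_pos.le)]

/-- **Bridge to Weil's form** (card torsion-blind-unit-criterion, `SketchIdeator3.lean`): for `p - q = m ∈ ℤ`
the value `e^{a p + ā q}` of `z^p z̄^q` at `z = e^a` is `|z|^{Re(p+q)} · (z/|z|)^m |z|^{i Im(p+q)}`.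
[folklore] -/
theorem exp_linear_eq_norm_cpow_mul_archUnitaryValue' (p q : ℂ) (m : ℤ) (hm : p - q = m) (a : ℂ) :
    Complex.exp (a * p + conj a * q) =
      ((‖Complex.exp a‖ : ℂ) ^ (((p + q).re : ℝ) : ℂ)) *
        archUnitaryValue m ((p + q).im) (Complex.exp a) := by
  obtain ⟨x, y, rfl⟩ : ∃ x y : ℝ, a = x + y * Complex.I := ⟨a.re, a.im, (Complex.re_add_im a).symm⟩
  have hre : ((x : ℂ) + y * Complex.I).re = x := by simp
  have hnorm : ‖Complex.exp (x + y * Complex.I)‖ = Real.exp x := by rw [Complex.norm_exp, hre]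
  have hratio : Complex.exp (x + y * Complex.I) / (‖Complex.exp (x + y * Complex.I)‖ : ℂ) =
      Complex.exp (y * Complex.I) := by
    rw [hnorm, Complex.ofReal_exp, ← Complex.exp_sub]
    congr 1; ring
  have hq : q = p - m := by rw [← hm]; ring
  unfold archUnitaryValue
  rw [hratio, hnorm, ofReal_exp_cpow', ofReal_exp_cpow', ← Complex.exp_int_mul, ← Complex.exp_add,
    ← Complex.exp_add]
  congr 1
  simp only [map_add, map_mul, Complex.conj_ofReal, Complex.conj_I]
  rw [hq]
  have h2 := Complex.re_add_im (p + (p - m))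
  linear_combination (-(x : ℂ)) * h2

/-- **Weil's unit relation in `archUnitaryValue` form, for `GL₁` data over a TOTALLY COMPLEX field** (the
stub `necessity_weilForm` of the crux line, card torsion-blind-unit-criterion, stated there for CM `K`):
if a `GL₁` datum has archimedean parameter `ι ↦ {e ι}` and `e σ_w - e σ̄_w = m_w ∈ ℤ`, then for one `M ≥ 1`
and all units `α`, `(∏_w (σ_w α/|σ_w α|)^{m_w} |σ_w α|^{i Im(e σ_w + e σ̄_w)})^M = 1`. Proof:
`unit_relation_glOne` with `a_w = log σ_w(α)`, the bridge above, parallel real weights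
(`exists_re_archParam_parallel_glOne`) and the product formula `∏_w |σ_w α|² = |N α| = 1`. No named fact.
Patrikis 2019, Lemma 2.1.1 (⇒). [cite: Patrikis2019, Lemma 2.1.1] -/
theorem unit_relation_weilForm_glOne {K : Type} [Field K] [NumberField K] [IsTotallyComplex K]
    {h1 : isCompact_glFiniteIntegralLevel 1 K} (ω : CuspidalAutomorphicRepData 1 K h1)
    (e : (K →+* ℂ) → ℂ) (hω : ω.1.HasArchParameter (fun ι => {e ι}))
    (me : InfinitePlace K → ℤ)
    (hme : ∀ w : InfinitePlace K, e w.embedding - e (ComplexEmbedding.conjugate w.embedding) = me w) :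
    ∃ M : ℕ, 0 < M ∧ ∀ α : (𝓞 K)ˣ,
      (∏ w : InfinitePlace K, archUnitaryValue (me w)
        ((e w.embedding + e (ComplexEmbedding.conjugate w.embedding)).im)
          (w.embedding ((α : 𝓞 K) : K))) ^ M = 1 := by
  haveI : IsEmpty {w : InfinitePlace K // w.IsReal} :=
    ⟨fun w => (not_isReal_iff_isComplex.mpr (IsTotallyComplex.isComplex w.1)) w.2⟩
  obtain ⟨θ, hθ⟩ := ω.1.exists_heckeCharacter_glOne
  obtain ⟨M, hM, hrel⟩ := unit_relation_glOne ω.1 hθ hω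
    (c := fun w : {w : InfinitePlace K // w.IsReal} => (isEmptyElim w : ℂ)) (fun w => isEmptyElim w)
    (p := fun w => e w.1.embedding) (q := fun w => e (ComplexEmbedding.conjugate w.1.embedding))
    (fun w => rfl) (fun w => rfl)
  obtain ⟨σ, -, hpar⟩ := exists_re_archParam_parallel_glOne ω.1 hω
  refine ⟨M, hM, fun α => ?_⟩
  have hα0 : ((α : 𝓞 K) : K) ≠ 0 := by exact_mod_cast Units.ne_zero α
  have hz : ∀ w : InfinitePlace K, w.embedding ((α : 𝓞 K) : K) ≠ 0 := fun w =>
    (map_ne_zero _).mpr hα0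
  -- logarithms
  set a : {w : InfinitePlace K // w.IsComplex} → ℂ := fun w => Complex.log (w.1.embedding ((α : 𝓞 K) : K))
    with ha
  have hexp : ∀ w, Complex.exp (a w) = w.1.embedding ((α : 𝓞 K) : K) := fun w => Complex.exp_log (hz w.1)
  have h := hrel α a hexp
  rw [Finset.univ_eq_empty, Finset.sum_empty, zero_add, Finset.mul_sum, Complex.exp_sum] at h
  -- each factor: `exp (M T_w) = (|σ_w α|^{2σ} · AUV_w)^M`
  have hfac : ∀ w : {w : InfinitePlace K // w.IsComplex},
      Complex.exp ((M : ℂ) * (a w * e w.1.embedding + conj (a w) * e (ComplexEmbedding.conjugate w.1.embedding))) =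
        ((((w.1 ((α : 𝓞 K) : K)) ^ (2 * σ) : ℝ) : ℂ) *
          archUnitaryValue (me w.1) ((e w.1.embedding + e (ComplexEmbedding.conjugate w.1.embedding)).im)
            (w.1.embedding ((α : 𝓞 K) : K))) ^ M := by
    intro w
    rw [Complex.exp_nat_mul, exp_linear_eq_norm_cpow_mul_archUnitaryValue' _ _ (me w.1) (hme w.1) (a w), hexp w,
      hpar w _ _ rfl rfl, norm_embedding_eq, ← Complex.ofReal_cpow (apply_nonneg _ _)]
  simp_rw [hfac] at h
  -- the modulus factor is `1`: `∏_w |α|_w = 1` (product formula, all places complex, `|N α| = 1`)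
  have hc : ∀ w : InfinitePlace K, w.IsComplex := fun w => IsTotallyComplex.isComplex w
  have hall1 : ∏ w : InfinitePlace K, w ((α : 𝓞 K) : K) = 1 := by
    have hpf := prod_eq_abs_norm ((α : 𝓞 K) : K)
    rw [NumberField.Units.norm, Rat.cast_one] at hpf
    have hsq : ∏ w : InfinitePlace K, w ((α : 𝓞 K) : K) ^ 2 = 1 := by
      rw [← hpf]
      refine Finset.prod_congr rfl fun w _ => ?_
      rw [mult, if_neg (not_isReal_iff_isComplex.mpr (hc w))]
    rw [Finset.prod_pow] at hsq
    have hnn : 0 ≤ ∏ w : InfinitePlace K, w ((α : 𝓞 K) : K) := Finset.prod_nonneg fun w _ => apply_nonneg _ _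
    nlinarith [hsq, hnn]
  have hmod : ∏ w : {w : InfinitePlace K // w.IsComplex},
      ((((w.1 ((α : 𝓞 K) : K)) ^ (2 * σ) : ℝ) : ℂ)) = 1 := by
    rw [← Complex.ofReal_prod, Real.finsetProd_rpow _ _ (fun w _ => apply_nonneg _ _),
      Fintype.prod_equiv (Equiv.subtypeUnivEquiv hc) (fun w => w.1 ((α : 𝓞 K) : K))
        (fun w => w ((α : 𝓞 K) : K)) (fun w => rfl), hall1, Real.one_rpow, Complex.ofReal_one]
  rw [Finset.prod_pow, Finset.prod_mul_distrib, mul_pow, hmod, one_pow, one_mul,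
    Fintype.prod_equiv (Equiv.subtypeUnivEquiv hc)
      (fun w : {w : InfinitePlace K // w.IsComplex} => archUnitaryValue (me w.1)
        ((e w.1.embedding + e (ComplexEmbedding.conjugate w.1.embedding)).im) (w.1.embedding ((α : 𝓞 K) : K)))
      (fun w => archUnitaryValue (me w) ((e w.embedding + e (ComplexEmbedding.conjugate w.embedding)).im)
        (w.embedding ((α : 𝓞 K) : K))) (fun w => rfl)] at h
  exact h

end Summit.Langlands.Langlands.Cruxes.HalfIntegralTwistCM.Disproof

/-! ## §11 `IsCMField` cannot be weakened to `IsTotallyComplex` (sorry-free, UNCONDITIONAL; gen 2)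
## — the non-CM totally imaginary `S₃`-sextic `K₆ = ℚ(ζ₃, ∛2)` (Patrikis 2019, Lemma 2.1.5, kernel-checked)

Gen 1 (§4) removed `IsCMField` entirely and refuted over `ℚ(√5)` through the MODULUS (two real places). The sharp
question is whether total complexity suffices: it does NOT. `HalfIntegralTwistCMTotallyComplex` (the crux with
`IsCMField` replaced by `IsTotallyComplex`) is FALSE: witness `K₆`, `s₁ = (1/2)𝟙_{mk ι₀}`, `s₂ = -s₁`, `ω = π_𝟙`;
the obstruction is ANGULAR — the unit relation of §10 at `ε₁ = 1 + ζ∛2 + ζ²∛4` forces `A^N = Ā^N` (`A = ι₀ ε₁`),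
refuted by the transposition `(γ₁ γ₀) ∈ Gal(K₆/ℚ) ≅ S₃` (`Aval_pow_ne_conj_pow`). Over a CM field `ε/ε̄` is a
root of unity for every unit (Mathlib `IsCMField.unitsMulComplexConjInv`) — THAT is the CM input of the
positive proof. Landed as `Negative/SexticDefs.lean`, `SexticRoots.lean`, `SexticPlaces.lean`,
`TotallyComplexNonCM.lean`. -/


open scoped NumberField ComplexConjugate
open Polynomial NumberField

namespace Summit.Langlands.Langlands.Cruxes.HalfIntegralTwistCM.Disproof.Sextic

/-! ### The polynomial, the field, the distinguished embedding -/

/-- `X³ - 2 ∈ ℚ[X]`. [folklore] -/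
abbrev P3 : ℚ[X] := X ^ 3 - C 2

/-- `deg (X³ - 2) = 3`. [folklore] -/
theorem natDegree_P3 : P3.natDegree = 3 := natDegree_X_pow_sub_C

/-- `X³ - 2 ≠ 0`. [folklore] -/
theorem P3_ne_zero : P3 ≠ 0 := fun h => by
  have := congrArg natDegree h
  rw [natDegree_P3, natDegree_zero] at this
  exact absurd this (by norm_num)

/-- The witness field `K₆ = ℚ(ζ₃, ∛2)`, the splitting field of `X³ - 2` over `ℚ`: a totally imaginary
`S₃`-sextic, NOT CM. [folklore] -/
abbrev K₆ : Type := P3.SplittingField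

/-- `X³ - 2` splits in `ℂ` (algebraically closed); the `Fact` feeding Mathlib's `Gal` action on complex roots. [folklore] -/
instance fact_splits_P3 : Fact ((P3.map (algebraMap ℚ ℂ)).Splits) := ⟨IsAlgClosed.splits _⟩

/-- `K₆` has characteristic zero. [folklore] -/
instance charZero_K₆ : CharZero K₆ := charZero_of_injective_algebraMap (algebraMap ℚ K₆).injective

/-- `K₆` is a number field (finite over `ℚ`). [folklore] -/
instance numberField_K₆ : NumberField K₆ := NumberField.mk

/-- The distinguished embedding `ι₀ : K₆ → ℂ` (Mathlib's `algebraMap` for the splitting field). [folklore] -/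
def ι₀ : K₆ →+* ℂ := algebraMap K₆ ℂ

/-- Unfolding `ι₀`. [folklore] -/
theorem ι₀_apply (x : K₆) : ι₀ x = algebraMap K₆ ℂ x := rfl

/-! ### The complex roots `r_j = ζ^j ∛2` -/

/-- The real cube root of `2`. [folklore] -/
def r₀ : ℝ := (2 : ℝ) ^ ((1 : ℝ) / 3)

/-- `∛2 > 0`. [folklore] -/
theorem r₀_pos : 0 < r₀ := Real.rpow_pos_of_pos two_pos _

/-- `(∛2)³ = 2`. [folklore] -/
theorem r₀_pow : r₀ ^ 3 = 2 := by
  rw [r₀, ← Real.rpow_natCast, ← Real.rpow_mul (by norm_num)]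
  norm_num

/-- A primitive cube root of unity in `ℂ`. [folklore] -/
def ζ : ℂ := Complex.exp (2 * Real.pi * Complex.I / 3)

/-- `ζ` is a primitive cube root of unity. [folklore] -/
theorem ζ_prim : IsPrimitiveRoot ζ 3 := Complex.isPrimitiveRoot_exp 3 (by norm_num)

/-- `ζ³ = 1`. [folklore] -/
theorem ζ_pow_three : ζ ^ 3 = 1 := ζ_prim.pow_eq_one

/-- `ζ ≠ 1`. [folklore] -/
theorem ζ_ne_one : ζ ≠ 1 := ζ_prim.ne_one (by norm_num)

/-- `ζ ≠ 0`. [folklore] -/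
theorem ζ_ne_zero : ζ ≠ 0 := Complex.exp_ne_zero _

/-- `|ζ| = 1`. [folklore] -/
theorem norm_ζ : ‖ζ‖ = 1 := by
  rw [ζ, show (2 * Real.pi * Complex.I / 3 : ℂ) = ((2 * Real.pi / 3 : ℝ) : ℂ) * Complex.I by push_cast; ring]
  exact Complex.norm_exp_ofReal_mul_I _

/-- `ζ² + ζ + 1 = 0`. [folklore] -/
theorem ζ_quad : ζ ^ 2 + ζ + 1 = 0 := by
  have h : (ζ - 1) * (ζ ^ 2 + ζ + 1) = 0 := by
    have := ζ_pow_three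
    linear_combination this
  rcases mul_eq_zero.mp h with h | h
  · exact absurd (sub_eq_zero.mp h) ζ_ne_one
  · exact h

/-- The complex roots `r_j = ζ^j · ∛2` of `X³ - 2`. [folklore] -/
def rC (j : ℕ) : ℂ := ζ ^ j * (r₀ : ℂ)

/-- `r_j³ = 2`. [folklore] -/
theorem rC_pow (j : ℕ) : rC j ^ 3 = 2 := by
  rw [rC, mul_pow, ← pow_mul, mul_comm j 3, pow_mul, ζ_pow_three, one_pow, one_mul]
  exact_mod_cast r₀_pow

/-- Evaluation of `X³ - 2`. [folklore] -/
theorem aeval_P3 {R : Type*} [CommRing R] [Algebra ℚ R] (x : R) : aeval x P3 = x ^ 3 - 2 := by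
  rw [map_sub, aeval_X_pow, aeval_C, map_ofNat]

/-- `r_j` is a complex root of `X³ - 2`. [folklore] -/
theorem rC_mem (j : ℕ) : rC j ∈ P3.rootSet ℂ :=
  mem_rootSet.mpr ⟨P3_ne_zero, by rw [aeval_P3, rC_pow, sub_self]⟩

/-! ### The roots `γ_j ∈ K₆`, complex conjugation, the units `ε_j = 1 + γ_j + γ_j²` -/

theorem ι₀_injective : Function.Injective ι₀ := (algebraMap K₆ ℂ).injective

/-- The roots of `X³ - 2` in `K₆`, indexed so that `ι₀ γ_j = r_j`. [folklore] -/
def γ (j : ℕ) : K₆ := ((Gal.rootsEquivRoots P3 ℂ).symm ⟨rC j, rC_mem j⟩ : P3.rootSet K₆)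

/-- `ι₀ γ_j = r_j` (the indexing of the roots in `K₆`). [folklore] -/
theorem ι₀_γ (j : ℕ) : ι₀ (γ j) = rC j := by
  change ((Gal.rootsEquivRoots P3 ℂ ((Gal.rootsEquivRoots P3 ℂ).symm ⟨rC j, rC_mem j⟩) : P3.rootSet ℂ) : ℂ)
    = rC j
  rw [Equiv.apply_symm_apply]

/-- `γ_j` is a root of `X³ - 2` in `K₆`. [folklore] -/
theorem γ_mem (j : ℕ) : γ j ∈ P3.rootSet K₆ := Subtype.property _

/-- `γ_j³ = 2`. [folklore] -/
theorem γ_pow (j : ℕ) : γ j ^ 3 = 2 := by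
  have := (mem_rootSet.mp (γ_mem j)).2
  rwa [aeval_P3, sub_eq_zero] at this

/-- `K₆/ℚ` is normal (a splitting field; named instance to bypass the `ℚ`-algebra diamond). -/
instance normal_K₆ : Normal ℚ K₆ := Polynomial.SplittingField.instNormal P3

/-- Complex conjugation as an automorphism of `K₆` (w.r.t. `ι₀`). [folklore] -/
def τ : P3.Gal := (((starRingEnd ℂ).comp ι₀).toRatAlgHom.restrictNormal' K₆ : K₆ ≃ₐ[ℚ] K₆)

/-- `ι₀ ∘ τ = conj ∘ ι₀`. [folklore] -/
theorem ι₀_τ (x : K₆) : ι₀ (τ x) = conj (ι₀ x) := by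
  have h := AlgHom.restrictNormal_commutes ((starRingEnd ℂ).comp ι₀).toRatAlgHom K₆ x
  rw [Algebra.algebraMap_self, RingHom.id_apply] at h
  exact h

theorem isIntegral_γ (j : ℕ) : IsIntegral ℤ (γ j) := by
  refine ⟨X ^ 3 - C 2, monic_X_pow_sub_C 2 (by norm_num), ?_⟩
  simp [γ_pow]

/-- The roots as algebraic integers. [folklore] -/
def γi (j : ℕ) : 𝓞 K₆ := ⟨γ j, isIntegral_γ j⟩

/-- Coercion of `γi`. [folklore] -/
@[simp] theorem coe_γi (j : ℕ) : ((γi j : 𝓞 K₆) : K₆) = γ j := rfl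

/-- **The units `ε_j = 1 + γ_j + γ_j²`** (`(γ_j - 1) ε_j = γ_j³ - 1 = 1`). [folklore] -/
def εu (j : ℕ) : (𝓞 K₆)ˣ where
  val := 1 + γi j + γi j ^ 2
  inv := γi j - 1
  val_inv := by
    apply RingOfIntegers.ext
    push_cast
    change (1 + γ j + γ j ^ 2) * (γ j - 1) = 1
    linear_combination γ_pow j
  inv_val := by
    apply RingOfIntegers.ext
    push_cast
    change (γ j - 1) * (1 + γ j + γ j ^ 2) = 1
    linear_combination γ_pow j

/-- `ε_j = 1 + γ_j + γ_j²` in `K₆`. [folklore] -/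
theorem coe_εu (j : ℕ) : (((εu j : (𝓞 K₆)ˣ) : 𝓞 K₆) : K₆) = 1 + γ j + γ j ^ 2 := by
  simp [εu]

/-- The complex values `E = ι₀ ε₀ = 1 + ∛2 + ∛4 ∈ ℝ_{>1}` and `A = ι₀ ε₁ = 1 + ζ∛2 + ζ²∛4 ∉ ℝ`. -/
def Eval : ℝ := 1 + r₀ + r₀ ^ 2

/-- `A = ι₀ ε₁ = 1 + ζ∛2 + ζ²∛4`. [folklore] -/
def Aval : ℂ := 1 + rC 1 + rC 1 ^ 2

/-! ### `K₆` is totally complex (`ζ₃ ∈ K₆`); the embeddings `ι₀ ∘ g` -/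

open NumberField.InfinitePlace

/-- `ζ ∈ K₆` forces every embedding to be non-real: `K₆` is totally complex. [folklore] -/
theorem not_isReal (w : InfinitePlace K₆) : ¬ w.IsReal := by
  intro hw
  have hreal : ComplexEmbedding.IsReal w.embedding := isReal_iff.mp hw
  -- `x = γ₁ / γ₀` is a primitive cube root of unity in `K₆`
  set x : K₆ := γ 1 / γ 0 with hx
  have hγ0 : γ 0 ≠ 0 := fun h => by
    have := γ_pow 0; rw [h] at this; norm_num at this
  have hιx : ι₀ x = ζ := by
    rw [hx, map_div₀, ι₀_γ, ι₀_γ, rC, rC, pow_one, pow_zero, one_mul,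
      mul_div_cancel_right₀ _ (by exact_mod_cast r₀_pos.ne')]
  have hxq : x ^ 2 + x + 1 = 0 := ι₀_injective (by
    rw [map_add, map_add, map_pow, map_one, map_zero, hιx]; exact ζ_quad)
  -- its image under a real embedding would be a real root of `t² + t + 1`
  set z : ℂ := w.embedding x with hz
  have hzq : z ^ 2 + z + 1 = 0 := by
    have := congrArg w.embedding hxq
    rwa [map_add, map_add, map_pow, map_one, map_zero] at this
  have hzreal : conj z = z := by
    have := RingHom.congr_fun (ComplexEmbedding.isReal_iff.mp hreal) x
    rwa [ComplexEmbedding.conjugate_coe_eq] at this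
  have hz' : z = (z.re : ℂ) := (Complex.conj_eq_iff_re.mp hzreal).symm
  rw [hz'] at hzq
  have hre : z.re ^ 2 + z.re + 1 = 0 := by exact_mod_cast hzq
  nlinarith [sq_nonneg (z.re + 1 / 2)]

/-- `K₆` is totally complex. [folklore] -/
instance isTotallyComplex_K₆ : IsTotallyComplex K₆ :=
  ⟨fun w => not_isReal_iff_isComplex.mp (not_isReal w)⟩

/-- `K₆` has no real places. [folklore] -/
instance isEmpty_realPlaces_K₆ : IsEmpty {w : InfinitePlace K₆ // w.IsReal} :=
  ⟨fun w => not_isReal w.1 w.2⟩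

/-- The embedding `ι₀ ∘ g`. [folklore] -/
def embOf (g : P3.Gal) : K₆ →+* ℂ := ι₀.comp ((g : K₆ ≃ₐ[ℚ] K₆) : K₆ →+* K₆)

/-- Unfolding `embOf`. [folklore] -/
theorem embOf_apply (g : P3.Gal) (x : K₆) : embOf g x = ι₀ (g x) := rfl

end Summit.Langlands.Langlands.Cruxes.HalfIntegralTwistCM.Disproof.Sextic


open scoped NumberField ComplexConjugate
open Polynomial NumberField

namespace Summit.Langlands.Langlands.Cruxes.HalfIntegralTwistCM.Disproof.Sextic

/-- `∛2 > 1`. [folklore] -/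
theorem one_lt_r₀ : 1 < r₀ := by
  by_contra h
  push Not at h
  have h3 : r₀ ^ 3 ≤ 1 ^ 3 := by gcongr; exact r₀_pos.le
  rw [r₀_pow] at h3
  norm_num at h3

/-- `ζ² ≠ 1`. [folklore] -/
theorem ζ_sq_ne_one : ζ ^ 2 ≠ 1 := ζ_prim.pow_ne_one_of_pos_of_lt (by norm_num) (by norm_num)

/-- `ζ̄ = ζ²`. [folklore] -/
theorem conj_ζ : conj ζ = ζ ^ 2 := by
  have h1 : conj ζ * ζ = 1 := by
    rw [mul_comm, Complex.mul_conj, Complex.normSq_eq_norm_sq, norm_ζ]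
    norm_num
  have h2 : ζ ^ 2 * ζ = 1 := by rw [← pow_succ]; exact ζ_pow_three
  exact mul_right_cancel₀ ζ_ne_zero (h1.trans h2.symm)

/-- `r₀ = ∛2` is real. [folklore] -/
theorem rC_zero : rC 0 = (r₀ : ℂ) := by simp [rC]

/-- `r_j ≠ 0`. [folklore] -/
theorem rC_ne_zero (j : ℕ) : rC j ≠ 0 := fun h => by
  have := rC_pow j
  rw [h] at this
  norm_num at this

/-- `r̄₀ = r₀`. [folklore] -/
theorem conj_rC_zero : conj (rC 0) = rC 0 := by rw [rC_zero, Complex.conj_ofReal]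

/-- `r̄₁ = r₂`. [folklore] -/
theorem conj_rC_one : conj (rC 1) = rC 2 := by
  rw [rC, rC, map_mul, Complex.conj_ofReal, pow_one, conj_ζ]

/-- `r̄₂ = r₁`. [folklore] -/
theorem conj_rC_two : conj (rC 2) = rC 1 := by
  rw [← conj_rC_one, Complex.conj_conj]

/-- `r₀ ≠ r₁`. [folklore] -/
theorem rC_zero_ne_one : rC 0 ≠ rC 1 := fun h => by
  rw [rC, rC, pow_zero, pow_one] at h
  exact ζ_ne_one (mul_right_cancel₀ (by exact_mod_cast r₀_pos.ne') h).symm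

/-- `r₀ ≠ r₂`. [folklore] -/
theorem rC_zero_ne_two : rC 0 ≠ rC 2 := fun h => by
  rw [rC, rC, pow_zero] at h
  exact ζ_sq_ne_one (mul_right_cancel₀ (by exact_mod_cast r₀_pos.ne') h).symm

/-- `r₁ ≠ r₂`. [folklore] -/
theorem rC_one_ne_two : rC 1 ≠ rC 2 := fun h => by
  rw [rC, rC, pow_one] at h
  have h' : ζ = ζ ^ 2 := mul_right_cancel₀ (by exact_mod_cast r₀_pos.ne') h
  have : ζ * 1 = ζ * ζ := by rw [mul_one, ← sq]; exact h'
  exact ζ_ne_one (mul_left_cancel₀ ζ_ne_zero this).symm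

/-- `r₁ = ζ ∛2` is not real. [folklore] -/
theorem rC_one_im_ne_zero : (rC 1).im ≠ 0 := fun h => by
  have hreal : conj (rC 1) = rC 1 := Complex.conj_eq_iff_im.mpr h
  rw [conj_rC_one] at hreal
  exact rC_one_ne_two hreal.symm

/-- **The complex roots of `X³ - 2` are exactly `∛2, ζ∛2, ζ²∛2`.** [folklore] -/
theorem mem_rootSet_P3_iff (z : ℂ) : z ∈ P3.rootSet ℂ ↔ z = rC 0 ∨ z = rC 1 ∨ z = rC 2 := by
  constructor
  · intro hz
    have hz3 : z ^ 3 = 2 := by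
      have := (mem_rootSet.mp hz).2
      rwa [aeval_P3, sub_eq_zero] at this
    have hr0 : (r₀ : ℂ) ≠ 0 := by exact_mod_cast r₀_pos.ne'
    have hw : (z / r₀) ^ 3 = 1 := by
      rw [div_pow, hz3]
      have : (r₀ : ℂ) ^ 3 = 2 := by exact_mod_cast r₀_pow
      rw [this, div_self two_ne_zero]
    obtain ⟨i, hi, hζi⟩ := ζ_prim.eq_pow_of_pow_eq_one hw
    have hz' : z = rC i := by
      rw [rC, hζi, div_mul_cancel₀ z hr0]
    interval_cases i
    · exact Or.inl hz'
    · exact Or.inr (Or.inl hz')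
    · exact Or.inr (Or.inr hz')
  · rintro (rfl | rfl | rfl) <;> exact rC_mem _

/-- `γ₀ ≠ γ₁`. [folklore] -/
theorem γ_zero_ne_one : γ 0 ≠ γ 1 := fun h => rC_zero_ne_one (by rw [← ι₀_γ, ← ι₀_γ, h])

/-- `γ₀ ≠ γ₂`. [folklore] -/
theorem γ_zero_ne_two : γ 0 ≠ γ 2 := fun h => rC_zero_ne_two (by rw [← ι₀_γ, ← ι₀_γ, h])

/-- `γ₁ ≠ γ₂`. [folklore] -/
theorem γ_one_ne_two : γ 1 ≠ γ 2 := fun h => rC_one_ne_two (by rw [← ι₀_γ, ← ι₀_γ, h])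

/-- An embedding sends the roots in `K₆` to complex roots. [folklore] -/
theorem embedding_mem_rootSet (ι : K₆ →+* ℂ) {x : K₆} (hx : x ∈ P3.rootSet K₆) : ι x ∈ P3.rootSet ℂ := by
  rw [mem_rootSet] at hx ⊢
  refine ⟨P3_ne_zero, ?_⟩
  have h := congrArg ι hx.2
  rw [aeval_P3, map_sub, map_pow, map_ofNat, map_zero] at h
  rwa [aeval_P3]

/-- **The roots of `X³ - 2` in `K₆` are exactly `γ₀, γ₁, γ₂`.** [folklore] -/
theorem mem_rootSet_K₆_iff (x : K₆) : x ∈ P3.rootSet K₆ ↔ x = γ 0 ∨ x = γ 1 ∨ x = γ 2 := by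
  constructor
  · intro hx
    rcases (mem_rootSet_P3_iff _).mp (embedding_mem_rootSet ι₀ hx) with h | h | h
    · exact Or.inl (ι₀_injective (by rw [ι₀_γ]; exact h))
    · exact Or.inr (Or.inl (ι₀_injective (by rw [ι₀_γ]; exact h)))
    · exact Or.inr (Or.inr (ι₀_injective (by rw [ι₀_γ]; exact h)))
  · rintro (rfl | rfl | rfl) <;> exact γ_mem _

/-- An automorphism maps roots to roots. [folklore] -/
theorem algEquiv_mem_rootSet (g : P3.Gal) {x : K₆} (hx : x ∈ P3.rootSet K₆) : g x ∈ P3.rootSet K₆ := by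
  rw [mem_rootSet] at hx ⊢
  refine ⟨P3_ne_zero, ?_⟩
  have h := congrArg g hx.2
  rw [aeval_P3, map_sub, map_pow, map_ofNat, map_zero] at h
  rwa [aeval_P3]

/-- An automorphism sends `γ_j` to some `γ_k`. [folklore] -/
theorem algEquiv_γ (g : P3.Gal) (j : ℕ) : g (γ j) = γ 0 ∨ g (γ j) = γ 1 ∨ g (γ j) = γ 2 :=
  (mem_rootSet_K₆_iff _).mp (algEquiv_mem_rootSet g (γ_mem j))

/-- **Every embedding `K₆ → ℂ` is `ι₀ ∘ g` for an automorphism `g`** (`K₆/ℚ` is normal). [folklore] -/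
theorem exists_algEquiv_of_embedding (ι : K₆ →+* ℂ) : ∃ g : P3.Gal, ∀ x, ι₀ (g x) = ι x := by
  let φ : K₆ →ₐ[ℚ] ℂ := ι.toRatAlgHom
  refine ⟨(φ.restrictNormal' K₆ : K₆ ≃ₐ[ℚ] K₆), fun x => ?_⟩
  have h := AlgHom.restrictNormal_commutes φ K₆ x
  rw [Algebra.algebraMap_self, RingHom.id_apply] at h
  exact h

/-- `τ γ₀ = γ₀`. [folklore] -/
theorem τ_γ_zero : τ (γ 0) = γ 0 := ι₀_injective (by rw [ι₀_τ, ι₀_γ, conj_rC_zero])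

/-- `τ γ₁ = γ₂`. [folklore] -/
theorem τ_γ_one : τ (γ 1) = γ 2 := ι₀_injective (by rw [ι₀_τ, ι₀_γ, ι₀_γ, conj_rC_one])

/-- `τ γ₂ = γ₁`. [folklore] -/
theorem τ_γ_two : τ (γ 2) = γ 1 := ι₀_injective (by rw [ι₀_τ, ι₀_γ, ι₀_γ, conj_rC_two])

/-- **The stabiliser of `γ₀` in `Gal(K₆/ℚ)` is `{1, τ}`** (an automorphism is determined by its action
on the three roots). [folklore] -/
theorem eq_one_or_eq_τ_of_apply_γ_zero (g : P3.Gal) (hg : g (γ 0) = γ 0) : g = 1 ∨ g = τ := by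
  have h1 : g (γ 1) = γ 1 ∨ g (γ 1) = γ 2 := by
    rcases algEquiv_γ g 1 with h | h | h
    · exact absurd (EquivLike.injective g (h.trans hg.symm)) γ_zero_ne_one.symm
    · exact Or.inl h
    · exact Or.inr h
  rcases h1 with h1 | h1
  · left
    have h2 : g (γ 2) = γ 2 := by
      rcases algEquiv_γ g 2 with h | h | h
      · exact absurd (EquivLike.injective g (h.trans hg.symm)) γ_zero_ne_two.symm
      · exact absurd (EquivLike.injective g (h.trans h1.symm)) γ_one_ne_two.symm
      · exact h
    refine Gal.ext P3 fun x hx => ?_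
    rcases (mem_rootSet_K₆_iff x).mp hx with rfl | rfl | rfl
    · rw [hg]; rfl
    · rw [h1]; rfl
    · rw [h2]; rfl
  · right
    have h2 : g (γ 2) = γ 1 := by
      rcases algEquiv_γ g 2 with h | h | h
      · exact absurd (EquivLike.injective g (h.trans hg.symm)) γ_zero_ne_two.symm
      · exact h
      · exact absurd (EquivLike.injective g (h.trans h1.symm)) γ_one_ne_two.symm
    refine Gal.ext P3 fun x hx => ?_
    rcases (mem_rootSet_K₆_iff x).mp hx with rfl | rfl | rfl
    · rw [hg, τ_γ_zero]
    · rw [h1, τ_γ_one]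
    · rw [h2, τ_γ_two]

/-- `X³ - 2` is irreducible over `ℚ` (`2` is not a rational cube: `3 ∤ v₂(2) = 1`). [folklore] -/
theorem irreducible_P3 : Irreducible P3 := by
  refine X_pow_sub_C_irreducible_of_prime Nat.prime_three fun b hb => ?_
  have hb0 : b ≠ 0 := by rintro rfl; norm_num at hb
  have h1 : padicValRat 2 (b ^ 3) = padicValRat 2 (2 : ℚ) := by rw [hb]
  rw [padicValRat.pow, show (2 : ℚ) = ((2 : ℕ) : ℚ) by norm_num, padicValRat.self (by norm_num)] at h1
  push_cast at h1
  omega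

/-- **A transposition**: an automorphism with `γ₁ ↦ γ₀`, `γ₂ ↦ γ₂` (transitivity of the Galois group
of the irreducible `X³ - 2` on its roots, corrected by `τ` if necessary). [folklore] -/
theorem exists_swap : ∃ g : P3.Gal, g (γ 1) = γ 0 ∧ g (γ 2) = γ 2 := by
  haveI := Gal.galAction_isPretransitive P3 ℂ irreducible_P3
  obtain ⟨g, hg⟩ := MulAction.exists_smul_eq P3.Gal (⟨rC 1, rC_mem 1⟩ : P3.rootSet ℂ) ⟨rC 0, rC_mem 0⟩
  have hg1 : g (γ 1) = γ 0 := by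
    have h := congrArg (fun z : P3.rootSet ℂ => (((Gal.rootsEquivRoots P3 ℂ).symm z : P3.rootSet K₆) : K₆)) hg
    simp only [Gal.smul_def, Equiv.symm_apply_apply] at h
    exact h
  have hg2 : g (γ 2) = γ 1 ∨ g (γ 2) = γ 2 := by
    rcases algEquiv_γ g 2 with h | h | h
    · exact absurd (EquivLike.injective g (h.trans hg1.symm)) γ_one_ne_two.symm
    · exact Or.inl h
    · exact Or.inr h
  rcases hg2 with h | h
  · refine ⟨τ * g, ?_, ?_⟩
    · show τ (g (γ 1)) = γ 0
      rw [hg1, τ_γ_zero]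
    · show τ (g (γ 2)) = γ 2
      rw [h, τ_γ_one]
  · exact ⟨g, hg1, h⟩

theorem gal_apply_inv_apply (g : P3.Gal) (x : K₆) : g (g⁻¹ x) = x := by
  show (g * g⁻¹) x = x
  rw [mul_inv_cancel]
  rfl

/-- The real cube root as a complex number is fixed by conjugation. -/
theorem conj_r₀ : conj ((r₀ : ℝ) : ℂ) = (r₀ : ℂ) := Complex.conj_ofReal _

/-- An automorphism with `γ_j ↦ γ_k` sends `ε_j ↦ ε_k`. [folklore] -/
theorem algEquiv_εu_of (g : P3.Gal) {j k : ℕ} (h : g (γ j) = γ k) :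
    g ((((εu j : (𝓞 K₆)ˣ) : 𝓞 K₆) : K₆)) = (((εu k : (𝓞 K₆)ˣ) : 𝓞 K₆) : K₆) := by
  rw [coe_εu, coe_εu, map_add, map_add, map_one, map_pow, h]

/-- `E = 1 + ∛2 + ∛4 > 1`. [folklore] -/
theorem one_lt_Eval : 1 < Eval := by
  have := r₀_pos
  unfold Eval
  nlinarith

/-- `E > 0`. [folklore] -/
theorem Eval_pos : 0 < Eval := lt_trans one_pos one_lt_Eval

/-- `ι₀ ε₀ = E`. [folklore] -/
theorem ι₀_εu_zero : ι₀ ((((εu 0 : (𝓞 K₆)ˣ) : 𝓞 K₆) : K₆)) = (Eval : ℂ) := by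
  rw [coe_εu, map_add, map_add, map_one, map_pow, ι₀_γ, rC_zero, Eval]
  push_cast
  ring

/-- `ι₀ ε₁ = A`. [folklore] -/
theorem ι₀_εu_one : ι₀ ((((εu 1 : (𝓞 K₆)ˣ) : 𝓞 K₆) : K₆)) = Aval := by
  rw [coe_εu, map_add, map_add, map_one, map_pow, ι₀_γ, Aval]

/-- `ι₀ ε₂ = Ā`. [folklore] -/
theorem ι₀_εu_two : ι₀ ((((εu 2 : (𝓞 K₆)ˣ) : 𝓞 K₆) : K₆)) = conj Aval := by
  rw [coe_εu, map_add, map_add, map_one, map_pow, ι₀_γ, Aval, map_add, map_add, map_one, map_pow,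
    conj_rC_one]

/-- `ε₀ ε₁ ε₂ = 1`, read in `ℂ`: `E · |A|² = 1`. [folklore] -/
theorem Eval_mul_normSq_Aval : Eval * Complex.normSq Aval = 1 := by
  have h3 : (r₀ : ℂ) ^ 3 = 2 := by exact_mod_cast r₀_pow
  have hz := ζ_quad
  -- `A Ā = 1 - r - r³ + r⁴` (reduce with `ζ² + ζ + 1 = 0`)
  have h1 : Aval * conj Aval = 1 - r₀ - (r₀ : ℂ) ^ 3 + (r₀ : ℂ) ^ 4 := by
    rw [Aval, map_add, map_add, map_one, map_pow, conj_rC_one, rC, rC, pow_one]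
    linear_combination ((r₀ : ℂ) + ζ ^ 2 * r₀ ^ 2 + (ζ ^ 3 - ζ + 1) * r₀ ^ 3 +
      (ζ - 1) * (ζ ^ 3 + 1) * r₀ ^ 4) * hz
  -- `E (1 - r - r³ + r⁴) = (1 - r³)² = 1`
  have key : ((Eval : ℝ) : ℂ) * (Aval * conj Aval) = 1 := by
    rw [h1, Eval]
    push_cast
    linear_combination ((r₀ : ℂ) ^ 3) * h3
  rw [Complex.mul_conj] at key
  exact_mod_cast key

/-- `|A|² = E⁻¹`. [folklore] -/
theorem normSq_Aval : Complex.normSq Aval = Eval⁻¹ :=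
  eq_inv_of_mul_eq_one_right Eval_mul_normSq_Aval

/-- `A ≠ 0`. [folklore] -/
theorem Aval_ne_zero : Aval ≠ 0 := fun h => by
  have := Eval_mul_normSq_Aval
  rw [h, map_zero, mul_zero] at this
  exact zero_ne_one this

/-- `A = ι₀ ε₁` is not real (else `ε₁ = ε₂`... precisely: `Im A = (√3/2)(∛2 - ∛4) ≠ 0`; here via
`conj A = A ⇒ ι₀ ε₂ = ι₀ ε₁ ⇒` contradiction with the transposition). We prove the form we need:
`conj A ≠ A`. [folklore] -/
theorem conj_Aval_ne : conj Aval ≠ Aval := by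
  intro h
  -- `ι₀ ε₂ = ι₀ ε₁`, so `ε₂ = ε₁` in `K₆`; apply the swap `g`: `ε₂ = ε₀`, so `conj A = E`, `A = E` real:
  -- then `|A|² = E²` and `E |A|² = E³ = 1`, contradicting `E > 1`.
  have h12 : (((εu 2 : (𝓞 K₆)ˣ) : 𝓞 K₆) : K₆) = (((εu 1 : (𝓞 K₆)ˣ) : 𝓞 K₆) : K₆) :=
    ι₀_injective (by rw [ι₀_εu_two, ι₀_εu_one, h])
  obtain ⟨g, hg1, hg2⟩ := exists_swap
  have h20 : (((εu 2 : (𝓞 K₆)ˣ) : 𝓞 K₆) : K₆) = (((εu 0 : (𝓞 K₆)ˣ) : 𝓞 K₆) : K₆) := by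
    have := congrArg g h12
    rwa [algEquiv_εu_of g hg2, algEquiv_εu_of g hg1] at this
  have hAE : conj Aval = (Eval : ℂ) := by rw [← ι₀_εu_two, ← ι₀_εu_zero, h20]
  have hA : Aval = (Eval : ℂ) := by rw [← h, hAE]
  have hn : Complex.normSq Aval = Eval ^ 2 := by
    rw [hA, Complex.normSq_ofReal]; ring
  have h1 := Eval_mul_normSq_Aval
  rw [hn] at h1
  have hE := one_lt_Eval
  nlinarith

/-- `A` is not real. [folklore] -/
theorem Aval_im_ne_zero : Aval.im ≠ 0 := fun h => conj_Aval_ne (Complex.conj_eq_iff_im.mpr h)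

end Summit.Langlands.Langlands.Cruxes.HalfIntegralTwistCM.Disproof.Sextic


open scoped NumberField ComplexConjugate Classical
open Polynomial NumberField NumberField.InfinitePlace

namespace Summit.Langlands.Langlands.Cruxes.HalfIntegralTwistCM.Disproof.Sextic

/-- **At every place exactly one of `γ₀, γ₁, γ₂` is real**, existence: some `γ_j ↦ ∛2`. [folklore] -/
theorem exists_realRoot (w : InfinitePlace K₆) :
    ∃ j : ℕ, (j = 0 ∨ j = 1 ∨ j = 2) ∧ w.embedding (γ j) = (r₀ : ℂ) := by
  obtain ⟨g, hg⟩ := exists_algEquiv_of_embedding w.embedding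
  -- `g⁻¹ γ₀` is a root `γ_j`, and `σ_w(γ_j) = ι₀(g γ_j) = ι₀ γ₀ = ∛2`
  have hmem : g⁻¹ (γ 0) ∈ P3.rootSet K₆ := algEquiv_mem_rootSet g⁻¹ (γ_mem 0)
  rcases (mem_rootSet_K₆_iff _).mp hmem with h | h | h
  · exact ⟨0, Or.inl rfl, by rw [← hg, ← h, gal_apply_inv_apply, ι₀_γ, rC_zero]⟩
  · exact ⟨1, Or.inr (Or.inl rfl), by rw [← hg, ← h, gal_apply_inv_apply, ι₀_γ, rC_zero]⟩
  · exact ⟨2, Or.inr (Or.inr rfl), by rw [← hg, ← h, gal_apply_inv_apply, ι₀_γ, rC_zero]⟩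

/-- Uniqueness of the real root index at a place. [folklore] -/
theorem realRoot_unique {w : InfinitePlace K₆} {j k : ℕ} (hj : j = 0 ∨ j = 1 ∨ j = 2)
    (hk : k = 0 ∨ k = 1 ∨ k = 2) (hwj : w.embedding (γ j) = (r₀ : ℂ))
    (hwk : w.embedding (γ k) = (r₀ : ℂ)) : j = k := by
  have h : γ j = γ k := w.embedding.injective (hwj.trans hwk.symm)
  rcases hj with rfl | rfl | rfl <;> rcases hk with rfl | rfl | rfl <;>
    first
      | rfl
      | exact absurd h γ_zero_ne_one
      | exact absurd h γ_zero_ne_two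
      | exact absurd h γ_one_ne_two
      | exact absurd h.symm γ_zero_ne_one
      | exact absurd h.symm γ_zero_ne_two
      | exact absurd h.symm γ_one_ne_two

/-- **Two places with the same real root coincide** (the stabiliser of `γ₀` is `{1, τ}` and
`ι₀ ∘ τ = conj ∘ ι₀`). [folklore] -/
theorem eq_of_realRoot_eq {w w' : InfinitePlace K₆} {j : ℕ}
    (hw : w.embedding (γ j) = (r₀ : ℂ)) (hw' : w'.embedding (γ j) = (r₀ : ℂ)) : w = w' := by
  obtain ⟨g, hg⟩ := exists_algEquiv_of_embedding w.embedding
  obtain ⟨g', hg'⟩ := exists_algEquiv_of_embedding w'.embedding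
  have hgj : g (γ j) = γ 0 := ι₀_injective (by rw [hg, hw, ι₀_γ, rC_zero])
  have hg'j : g' (γ j) = γ 0 := ι₀_injective (by rw [hg', hw', ι₀_γ, rC_zero])
  -- `h = g' g⁻¹` fixes `γ₀`
  have hinv : g⁻¹ (γ 0) = γ j := EquivLike.injective g (by rw [gal_apply_inv_apply, hgj])
  have hfix : (g' * g⁻¹) (γ 0) = γ 0 := by
    show g' (g⁻¹ (γ 0)) = γ 0
    rw [hinv, hg'j]
  rcases eq_one_or_eq_τ_of_apply_γ_zero _ hfix with h1 | h1
  · -- `g' = g`: same embedding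
    have hgg : g' = g := by
      have := congrArg (· * g) h1
      simpa using this
    have hemb : w'.embedding = w.embedding := RingHom.ext fun x => by rw [← hg', ← hg, hgg]
    rw [← mk_embedding w, ← mk_embedding w', hemb]
  · -- `g' = τ g`: conjugate embedding
    have hgg : g' = τ * g := by
      have := congrArg (· * g) h1
      simpa using this
    have hemb : w'.embedding = ComplexEmbedding.conjugate w.embedding := RingHom.ext fun x => by
      rw [← hg', hgg, ComplexEmbedding.conjugate_coe_eq, ← hg]
      show ι₀ (τ (g x)) = conj (ι₀ (g x))
      exact ι₀_τ _
    rw [← mk_embedding w, ← mk_embedding w', hemb, mk_conjugate_eq]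

/-- The place of `ι₀ ∘ g` makes `γ_j` real when `g γ_j = γ₀`. [folklore] -/
theorem embedding_mk_embOf_γ {g : P3.Gal} {j : ℕ} (h : g (γ j) = γ 0) :
    (mk (embOf g)).embedding (γ j) = (r₀ : ℂ) := by
  rcases embedding_mk_eq (embOf g) with h' | h'
  · rw [h', embOf_apply, h, ι₀_γ, rC_zero]
  · rw [h', ComplexEmbedding.conjugate_coe_eq, embOf_apply, h, ι₀_γ, rC_zero, conj_r₀]

/-- `γ₀` is real at the place of `ι₀`. [folklore] -/
theorem embedding_mk_ι₀_γ_zero : (mk ι₀).embedding (γ 0) = (r₀ : ℂ) := by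
  have h : (1 : P3.Gal) (γ 0) = γ 0 := rfl
  have e : embOf 1 = ι₀ := RingHom.ext fun x => rfl
  have := embedding_mk_embOf_γ h
  rwa [e] at this

/-- **`K₆` has exactly three infinite places `mk ι₀, ω₁, ω₂`, at which `γ₀`, `γ₁`, `γ₂` respectively are
real** (transitivity supplies `ω₁ = mk (ι₀ ∘ g)`, `ω₂ = mk (ι₀ ∘ g ∘ τ)` for the transposition `g`;
distinctness by `realRoot_unique`, exhaustion by `exists_realRoot` + `eq_of_realRoot_eq`). [folklore] -/
theorem exists_places : ∃ ω₁ ω₂ : InfinitePlace K₆,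
    mk ι₀ ≠ ω₁ ∧ mk ι₀ ≠ ω₂ ∧ ω₁ ≠ ω₂ ∧ (∀ w : InfinitePlace K₆, w = mk ι₀ ∨ w = ω₁ ∨ w = ω₂) ∧
      ω₁.embedding (γ 1) = (r₀ : ℂ) ∧ ω₂.embedding (γ 2) = (r₀ : ℂ) := by
  obtain ⟨g, hg1, -⟩ := exists_swap
  have hgτ : (g * τ) (γ 2) = γ 0 := by
    show g (τ (γ 2)) = γ 0
    rw [τ_γ_two, hg1]
  have h0 := embedding_mk_ι₀_γ_zero
  have h1 : (mk (embOf g)).embedding (γ 1) = (r₀ : ℂ) := embedding_mk_embOf_γ hg1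
  have h2 : (mk (embOf (g * τ))).embedding (γ 2) = (r₀ : ℂ) := embedding_mk_embOf_γ hgτ
  refine ⟨mk (embOf g), mk (embOf (g * τ)), fun h => ?_, fun h => ?_, fun h => ?_, fun w => ?_, h1, h2⟩
  · exact absurd (realRoot_unique (Or.inl rfl) (Or.inr (Or.inl rfl)) h0 (h ▸ h1)) (by norm_num)
  · exact absurd (realRoot_unique (Or.inl rfl) (Or.inr (Or.inr rfl)) h0 (h ▸ h2)) (by norm_num)
  · exact absurd (realRoot_unique (Or.inr (Or.inl rfl)) (Or.inr (Or.inr rfl)) h1 (h ▸ h2)) (by norm_num)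
  · obtain ⟨j, hj, hw⟩ := exists_realRoot w
    rcases hj with rfl | rfl | rfl
    · exact Or.inl (eq_of_realRoot_eq hw h0)
    · exact Or.inr (Or.inl (eq_of_realRoot_eq hw h1))
    · exact Or.inr (Or.inr (eq_of_realRoot_eq hw h2))

/-- **Sums over the complex places of `K₆` have three terms** (given the three places). [folklore] -/
theorem sum_complexPlaces_eq {ω₀ ω₁ ω₂ : InfinitePlace K₆} (h01 : ω₀ ≠ ω₁) (h02 : ω₀ ≠ ω₂) (h12 : ω₁ ≠ ω₂)
    (hall : ∀ w : InfinitePlace K₆, w = ω₀ ∨ w = ω₁ ∨ w = ω₂) (f : {w : InfinitePlace K₆ // w.IsComplex} → ℂ) :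
    ∑ w, f w = f ⟨ω₀, IsTotallyComplex.isComplex _⟩ + f ⟨ω₁, IsTotallyComplex.isComplex _⟩ +
      f ⟨ω₂, IsTotallyComplex.isComplex _⟩ := by
  have huniv : (Finset.univ : Finset {w : InfinitePlace K₆ // w.IsComplex}) =
      {⟨ω₀, IsTotallyComplex.isComplex _⟩, ⟨ω₁, IsTotallyComplex.isComplex _⟩, ⟨ω₂, IsTotallyComplex.isComplex _⟩} := by
    ext w
    simp only [Finset.mem_univ, true_iff, Finset.mem_insert, Finset.mem_singleton]
    rcases hall w.1 with h | h | h
    · exact Or.inl (Subtype.ext h)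
    · exact Or.inr (Or.inl (Subtype.ext h))
    · exact Or.inr (Or.inr (Subtype.ext h))
  rw [huniv, Finset.sum_insert, Finset.sum_pair, add_assoc]
  · exact fun h => h12 (congrArg Subtype.val h)
  · simp only [Finset.mem_insert, Finset.mem_singleton, not_or]
    exact ⟨fun h => h01 (congrArg Subtype.val h), fun h => h02 (congrArg Subtype.val h)⟩

/-! ### Values of the unit `ε₁` at the places; the non-CM certificate -/

/-- At a place where `γ₁` is real, `ε₁ ↦ E`. [folklore] -/
theorem e₁_eq_Eval_of {w : InfinitePlace K₆} (hw : w.embedding (γ 1) = (r₀ : ℂ)) :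
    w.embedding (((εu 1 : (𝓞 K₆)ˣ) : 𝓞 K₆) : K₆) = (Eval : ℂ) := by
  obtain ⟨g, hg⟩ := exists_algEquiv_of_embedding w.embedding
  have hg1 : g (γ 1) = γ 0 := ι₀_injective (by rw [hg, hw, ι₀_γ, rC_zero])
  rw [← hg, algEquiv_εu_of g hg1, ι₀_εu_zero]

/-- At a place where `γ₁` is NOT real (`ω₀`, `ω₂`), `ε₁ ↦ A` or `Ā`. [folklore] -/
theorem e₁_eq_or {w : InfinitePlace K₆} {j : ℕ} (hj : j = 0 ∨ j = 2)
    (hw : w.embedding (γ j) = (r₀ : ℂ)) : w.embedding (((εu 1 : (𝓞 K₆)ˣ) : 𝓞 K₆) : K₆) = Aval ∨ w.embedding (((εu 1 : (𝓞 K₆)ˣ) : 𝓞 K₆) : K₆) = conj Aval := by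
  obtain ⟨g, hg⟩ := exists_algEquiv_of_embedding w.embedding
  have hgj : g (γ j) = γ 0 := ι₀_injective (by rw [hg, hw, ι₀_γ, rC_zero])
  have hj1 : j ≠ 1 := by rcases hj with rfl | rfl <;> norm_num
  have hg1 : g (γ 1) = γ 1 ∨ g (γ 1) = γ 2 := by
    rcases algEquiv_γ g 1 with h | h | h
    · refine absurd (EquivLike.injective g (h.trans hgj.symm)) fun h11 => hj1 ?_
      rcases hj with rfl | rfl
      · exact absurd h11.symm γ_zero_ne_one
      · exact absurd h11 γ_one_ne_two
    · exact Or.inl h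
    · exact Or.inr h
  rcases hg1 with h | h
  · left
    rw [← hg, algEquiv_εu_of g h, ι₀_εu_one]
  · right
    rw [← hg, algEquiv_εu_of g h, ι₀_εu_two]

/-- **The `ι₀`-value `A` of `ε₁` has no power equal to the same power of `Ā`** (`A^N = Ā^N ⇒ ε₁^N = ε₂^N
⇒` (swap) `ε₀^N = ε₂^N ⇒ E^N = |A|^N ⇒ E = |A| ⇒ E³ = E |A|² = 1`, contradicting `E > 1`): the
angular part of `A` is not a root of unity — the non-CM phenomenon. [folklore] -/
theorem Aval_pow_ne_conj_pow {N : ℕ} (hN : 0 < N) : Aval ^ N ≠ conj Aval ^ N := by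
  intro h
  have h12 : (((εu 1 : (𝓞 K₆)ˣ) : 𝓞 K₆) : K₆) ^ N = (((εu 2 : (𝓞 K₆)ˣ) : 𝓞 K₆) : K₆) ^ N :=
    ι₀_injective (by rw [map_pow, map_pow, ι₀_εu_one, ι₀_εu_two, h])
  have h02 : (((εu 0 : (𝓞 K₆)ˣ) : 𝓞 K₆) : K₆) ^ N = (((εu 2 : (𝓞 K₆)ˣ) : 𝓞 K₆) : K₆) ^ N := by
    obtain ⟨g, hg1, hg2⟩ := exists_swap
    have := congrArg g h12
    rwa [map_pow, map_pow, algEquiv_εu_of g hg1, algEquiv_εu_of g hg2] at this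
  have hEA : ((Eval : ℝ) : ℂ) ^ N = conj Aval ^ N := by
    have := congrArg ι₀ h02
    rwa [map_pow, map_pow, ι₀_εu_zero, ι₀_εu_two] at this
  have hnorm : Eval ^ N = ‖Aval‖ ^ N := by
    have := congrArg (fun z : ℂ => ‖z‖) hEA
    simp only [norm_pow, Complex.norm_real, Real.norm_eq_abs, abs_of_pos Eval_pos, Complex.norm_conj] at this
    exact this
  have hEeq : Eval = ‖Aval‖ := (pow_left_inj₀ Eval_pos.le (norm_nonneg _) hN.ne').mp hnorm
  have h1 := Eval_mul_normSq_Aval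
  rw [Complex.normSq_eq_norm_sq, ← hEeq] at h1
  have hE := one_lt_Eval
  nlinarith

end Summit.Langlands.Langlands.Cruxes.HalfIntegralTwistCM.Disproof.Sextic


-- Mathlib idiom (Mathlib/Algebra/Lie/OfAssociative.lean): commutator bracket on matrices
attribute [local instance 100] LieRing.ofAssociativeRing

namespace Summit.Langlands.Langlands.Cruxes.HalfIntegralTwistCM.Disproof

open scoped Classical NumberField ComplexConjugate
open NumberField NumberField.InfinitePlace
open Literature.NumberTheory.Automorphic
open Literature.NumberTheory.GaloisRepresentations
open Sextic

/-- **The four-case bookkeeping of the sextic witness.** With `L = log A`, `a₁ = -(L + L̄) = log E`,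
exponents `P₀ = n₀`, `P₀' = n₀'` (integral place `ω₀`), `P_k = n_k + 1/2`, `P_k' = n_k' + 1/2`
(`k = 1, 2`), parallel weights `n₀ + n₀' = n₁ + n₁' + 1 = n₂ + n₂' + 1`, and logarithms `a₀, a₂ ∈ {L, L̄}`
at the two places where `ε₁` is not real: twice the exponent sum is `(L - L̄)·(odd integer)`. [folklore] -/
theorem sextic_odd_relation (L a₀ a₁ a₂ P₀ P₀' P₁ P₁' P₂ P₂' : ℂ) (n₀ n₀' n₁ n₁' n₂ n₂' : ℤ)
    (ha₁ : a₁ = -(L + conj L))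
    (h0 : P₀ = n₀) (h0' : P₀' = n₀') (h1 : P₁ = n₁ + 1 / 2) (h1' : P₁' = n₁' + 1 / 2)
    (h2 : P₂ = n₂ + 1 / 2) (h2' : P₂' = n₂' + 1 / 2)
    (hN1 : (n₀ : ℂ) + n₀' = n₁ + n₁' + 1) (hN2 : (n₀ : ℂ) + n₀' = n₂ + n₂' + 1)
    (ha₀ : a₀ = L ∨ a₀ = conj L) (ha₂ : a₂ = L ∨ a₂ = conj L) :
    ∃ m : ℤ, 2 * ((a₀ * P₀ + conj a₀ * P₀') + (a₁ * P₁ + conj a₁ * P₁') + (a₂ * P₂ + conj a₂ * P₂')) =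
      (L - conj L) * (2 * m + 1) := by
  have hn1' : (n₁' : ℂ) = n₀ + n₀' - n₁ - 1 := by linear_combination -hN1
  have hn2' : (n₂' : ℂ) = n₀ + n₀' - n₂ - 1 := by linear_combination -hN2
  rw [h0, h0', h1, h1', h2, h2', ha₁, map_neg, map_add, Complex.conj_conj, hn1', hn2']
  rcases ha₀ with rfl | rfl <;> rcases ha₂ with rfl | rfl
  · exact ⟨n₂ - n₀', by push_cast; ring⟩
  · refine ⟨n₀ - n₂ - 1, ?_⟩
    rw [Complex.conj_conj]; push_cast; ring
  · refine ⟨n₂ - n₀, ?_⟩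
    rw [Complex.conj_conj]; push_cast; ring
  · refine ⟨n₀' - n₂ - 1, ?_⟩
    rw [Complex.conj_conj]; push_cast; ring

/-- From `exp (M X) = 1` and `2 X = (L - L̄)(2m + 1)`: `A^N = Ā^N` for some `N ≥ 1`, where `A = e^L`.
[folklore] -/
theorem pow_eq_conj_pow_of_exp_eq_one {L X : ℂ} {M : ℕ} (hM : 0 < M) {m : ℤ}
    (hrel : Complex.exp ((M : ℂ) * X) = 1) (hm : 2 * X = (L - conj L) * (2 * m + 1)) :
    ∃ N : ℕ, 0 < N ∧ Complex.exp L ^ N = conj (Complex.exp L) ^ N := by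
  set k : ℤ := (M : ℤ) * (2 * m + 1) with hk
  have hk0 : k ≠ 0 := mul_ne_zero (by exact_mod_cast hM.ne') (by omega)
  -- `exp (k L) = exp (k L̄)`
  have h2 : Complex.exp ((2 : ℕ) * ((M : ℂ) * X)) = 1 := by rw [Complex.exp_nat_mul, hrel, one_pow]
  have hkX : ((2 : ℕ) : ℂ) * ((M : ℂ) * X) = (k : ℂ) * L - (k : ℂ) * conj L := by
    rw [hk]; push_cast; linear_combination (M : ℂ) * hm
  rw [hkX, Complex.exp_sub, div_eq_one_iff_eq (Complex.exp_ne_zero _), Complex.exp_int_mul,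
    Complex.exp_int_mul, Complex.exp_conj] at h2
  -- `k = ±N`
  rcases Int.natAbs_eq k with hkN | hkN
  · refine ⟨k.natAbs, Int.natAbs_pos.mpr hk0, ?_⟩
    rw [hkN, zpow_natCast, zpow_natCast] at h2
    exact h2
  · refine ⟨k.natAbs, Int.natAbs_pos.mpr hk0, ?_⟩
    rw [hkN, zpow_neg, zpow_neg, inv_inj, zpow_natCast, zpow_natCast] at h2
    exact h2

/-- The crux with `NumberField.IsCMField K` WEAKENED to `NumberField.IsTotallyComplex K`; everything else
verbatim. [folklore] -/
def HalfIntegralTwistCMTotallyComplex : Prop :=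
  ∀ (K : Type) [Field K] [NumberField K], NumberField.IsTotallyComplex K →
        ∀ (h1 : Literature.NumberTheory.Automorphic.isCompact_glFiniteIntegralLevel 1 K)
          (s₁ s₂ : (K →+* ℂ) → ℂ), (∀ ι, ∃ k : ℤ, s₁ ι - s₂ ι = k) →
          (∀ ι, ∃ m : ℤ, s₁ ι - s₁ (NumberField.ComplexEmbedding.conjugate ι) = m) →
          (∀ ι, ∃ m : ℤ, (s₁ ι - s₂ ι) + (s₁ (NumberField.ComplexEmbedding.conjugate ι) -
            s₂ (NumberField.ComplexEmbedding.conjugate ι)) = 2 * m) →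
          (∃ ω : Literature.NumberTheory.Automorphic.CuspidalAutomorphicRepData 1 K h1,
            ω.1.HasArchParameter (fun ι => {s₁ ι + s₂ ι})) →
          ∃ (χ : Literature.NumberTheory.Automorphic.CuspidalAutomorphicRepData 1 K h1)
            (p : (K →+* ℂ) → ℂ), χ.1.HasArchParameter (fun ι => {p ι}) ∧
              ∀ ι, ∃ m : ℤ, p ι + s₁ ι - 1 / 2 = m

/-- Sanity: `HalfIntegralTwistCMTotallyComplex` implies the crux (a CM field is totally complex; pure
logic + Mathlib's instance). [folklore] -/
theorem crux_of_totallyComplex (h : HalfIntegralTwistCMTotallyComplex) : Crux :=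
  fun K _ _ hK h1 s₁ s₂ hi hii hiii hiv => by
    haveI := hK
    exact h K inferInstance h1 s₁ s₂ hi hii hiii hiv

/-- **`IsCMField` cannot be weakened to `IsTotallyComplex` in the crux** (unconditional; Patrikis 2019,
Lemma 2.1.5: over a totally imaginary NON-CM field the parity obstruction returns). Witness: the
`S₃`-sextic `K₆ = ℚ(ζ₃, ∛2)`, `s₁ = (1/2)·𝟙_{ω₀}` (`ω₀` the place of `ι₀`, where `∛2 ↦ ∛2 ∈ ℝ`),
`s₂ = -s₁`, `ω = π_𝟙`. A half-integral re-twist `χ` would have exponents `n_ι + 1/2 - s₁ ι`, and Weil's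
unit relation (`unit_relation_glOne`) at the unit `ε₁ = 1 + ζ∛2 + ζ²∛4` reads, after the parallel-weight
bookkeeping (`sextic_odd_relation`), `exp ((log A - log Ā)·(odd)·M/2) = 1` for `A = ι₀(ε₁)`; hence
`A^N = Ā^N` for some `N ≥ 1`, i.e. `ε₁^N = ε₂^N`, which the transposition `(γ₁ γ₀)` of `Gal(K₆/ℚ) ≅ S₃`
turns into `E^N = |A|^N`, `E³ = 1` — impossible (`Aval_pow_ne_conj_pow`). Over a CM field this last step
fails exactly because `ε/ε̄` is a root of unity for every unit (Mathlib `IsCMField.unitsMulComplexConjInv`).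
[cite: Patrikis2019, Lemma 2.1.5] -/
theorem halfIntegralTwistCM_false_of_isTotallyComplex : ¬ HalfIntegralTwistCMTotallyComplex := by
  intro hC
  -- the three places `ω₀ = mk ι₀, ω₁, ω₂` of `K₆`
  obtain ⟨ω₁, ω₂, h01, h02, h12, hall, hω₁, hω₂⟩ := exists_places
  set ω₀ : InfinitePlace K₆ := mk ι₀ with hω₀def
  have hω₀ : ω₀.embedding (γ 0) = (r₀ : ℂ) := embedding_mk_ι₀_γ_zero
  set cω₀ : {w : InfinitePlace K₆ // w.IsComplex} := ⟨ω₀, IsTotallyComplex.isComplex _⟩ with hcω₀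
  set cω₁ : {w : InfinitePlace K₆ // w.IsComplex} := ⟨ω₁, IsTotallyComplex.isComplex _⟩ with hcω₁
  set cω₂ : {w : InfinitePlace K₆ // w.IsComplex} := ⟨ω₂, IsTotallyComplex.isComplex _⟩ with hcω₂
  set h1 : isCompact_glFiniteIntegralLevel 1 K₆ := isCompact_glFiniteIntegralLevel_holds 1 K₆ with hh1
  -- the exponents `s = (1/2)·𝟙_{ω₀}`
  set s : (K₆ →+* ℂ) → ℂ := fun ι => if mk ι = ω₀ then 1 / 2 else 0 with hs
  have hsconj : ∀ ι, s (ComplexEmbedding.conjugate ι) = s ι := fun ι => by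
    simp only [hs, mk_conjugate_eq]
  -- the trivial datum `π_𝟙`, parameter `{0} = {s + (-s)}`
  obtain ⟨πd, hπW, hπW'⟩ := exists_automorphicRepData_detTwist_glOne h1 (1 : HeckeCharacter K₆)
  have hcusp : πd.W ≤ cuspFormsGL 1 K₆ h1 := by
    rw [hπW, Submodule.span_le]
    rintro _ rfl
    exact IsCuspFormGL.mem_cuspFormsGL
      ⟨isAutomorphicForm_detTwist_glOne h1 (1 : HeckeCharacter K₆), fun k hk hk1 => absurd hk1 (by omega)⟩
  have hχπ := detTwist_datum_heckeCharacter (hcpt := h1) (θ := (1 : HeckeCharacter K₆)) hπW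
  obtain ⟨E0, hE0⟩ := πd.exists_hasArchParameter_glOne
  have hE00 : E0 = fun ι => ({s ι + -s ι} : Multiset ℂ) := by
    funext ι
    rw [add_neg_cancel]
    exact archParam_trivial_glOne πd hχπ hE0 ι
  -- hypotheses (i)–(iii)
  have hi : ∀ ι : K₆ →+* ℂ, ∃ k : ℤ, s ι - -s ι = k := by
    intro ι
    by_cases h : mk ι = ω₀
    · exact ⟨1, by simp [hs, h]; norm_num⟩
    · exact ⟨0, by simp [hs, h]⟩
  have hii : ∀ ι : K₆ →+* ℂ, ∃ m : ℤ, s ι - s (ComplexEmbedding.conjugate ι) = m :=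
    fun ι => ⟨0, by rw [hsconj]; simp⟩
  have hiii : ∀ ι : K₆ →+* ℂ, ∃ m : ℤ, (s ι - -s ι) + (s (ComplexEmbedding.conjugate ι) -
      -s (ComplexEmbedding.conjugate ι)) = 2 * m := by
    intro ι
    rw [hsconj]
    by_cases h : mk ι = ω₀
    · exact ⟨1, by simp [hs, h]; norm_num⟩
    · exact ⟨0, by simp [hs, h]⟩
  obtain ⟨χ, Pf, hP, hint⟩ := hC K₆ inferInstance h1 s (fun ι => -s ι) hi hii hiii
    ⟨⟨πd, hcusp⟩, by rw [← hE00]; exact hE0⟩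
  choose n hn using hint
  -- the Hecke character of `χ` and Weil's unit relation
  obtain ⟨θ, hθ⟩ := χ.1.exists_heckeCharacter_glOne
  obtain ⟨M, hM, hrel⟩ := unit_relation_glOne χ.1 hθ hP
    (c := fun w : {w : InfinitePlace K₆ // w.IsReal} => (isEmptyElim w : ℂ)) (fun w => isEmptyElim w)
    (p := fun w => Pf w.1.embedding) (q := fun w => Pf (ComplexEmbedding.conjugate w.1.embedding))
    (fun w => rfl) (fun w => rfl)
  -- parallel real parts
  obtain ⟨ρ, -, hpar⟩ := exists_re_archParam_parallel_glOne χ.1 hP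
  -- the logarithms of `ε₁` at the three places
  set L : ℂ := Complex.log Aval with hL
  have hexpL : Complex.exp L = Aval := Complex.exp_log Aval_ne_zero
  have hexpL' : Complex.exp (conj L) = conj Aval := by rw [Complex.exp_conj, hexpL]
  have hlogE : Complex.exp (-(L + conj L)) = (Eval : ℂ) := by
    have hre : L + conj L = ((2 * Real.log ‖Aval‖ : ℝ) : ℂ) := by
      rw [Complex.add_conj, hL, Complex.log_re]
    rw [hre, ← Complex.ofReal_neg, ← Complex.ofReal_exp]
    congr 1
    rw [← Real.log_rpow (norm_pos_iff.mpr Aval_ne_zero), Real.rpow_two, ← Complex.normSq_eq_norm_sq,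
      normSq_Aval, Real.log_inv, neg_neg, Real.exp_log Eval_pos]
  set a : {w : InfinitePlace K₆ // w.IsComplex} → ℂ := fun w =>
    if w.1.embedding ((((εu 1 : (𝓞 K₆)ˣ) : 𝓞 K₆) : K₆)) = Aval then L
      else if w.1.embedding ((((εu 1 : (𝓞 K₆)ˣ) : 𝓞 K₆) : K₆)) = conj Aval then conj L
      else -(L + conj L) with ha
  have hAE : Aval ≠ (Eval : ℂ) := fun h => conj_Aval_ne (by rw [h, Complex.conj_ofReal])
  have hAE' : conj Aval ≠ (Eval : ℂ) := fun h => conj_Aval_ne (by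
    have h2 := congrArg conj h
    rw [Complex.conj_conj, Complex.conj_ofReal] at h2
    rw [h]; exact h2.symm)
  have ha_of_A : ∀ w : {w : InfinitePlace K₆ // w.IsComplex},
      w.1.embedding ((((εu 1 : (𝓞 K₆)ˣ) : 𝓞 K₆) : K₆)) = Aval → a w = L :=
    fun w h => by simp only [ha, h, if_true]
  have ha_of_A' : ∀ w : {w : InfinitePlace K₆ // w.IsComplex},
      w.1.embedding ((((εu 1 : (𝓞 K₆)ˣ) : 𝓞 K₆) : K₆)) = conj Aval → a w = conj L := fun w h => by
    simp only [ha, h, conj_Aval_ne, if_false, if_true]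
  have hω₀e := e₁_eq_or (Or.inl rfl) hω₀
  have hω₁e := e₁_eq_Eval_of hω₁
  have hω₂e := e₁_eq_or (Or.inr rfl) hω₂
  have ha1 : a cω₁ = -(L + conj L) := by
    have h : cω₁.1.embedding ((((εu 1 : (𝓞 K₆)ˣ) : 𝓞 K₆) : K₆)) = (Eval : ℂ) := hω₁e
    simp only [ha, h, hAE.symm, hAE'.symm, if_false]
  have hexp_a : ∀ w : {w : InfinitePlace K₆ // w.IsComplex}, Complex.exp (a w) =
      w.1.embedding ((((εu 1 : (𝓞 K₆)ˣ) : 𝓞 K₆) : K₆)) := by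
    intro w
    rcases hall w.1 with hw | hw | hw
    · have hw' : w = cω₀ := Subtype.ext hw
      rw [hw']
      rcases hω₀e with h | h
      · rw [ha_of_A _ h, hexpL]; exact h.symm
      · rw [ha_of_A' _ h, hexpL']; exact h.symm
    · have hw' : w = cω₁ := Subtype.ext hw
      rw [hw', ha1, hlogE]; exact hω₁e.symm
    · have hw' : w = cω₂ := Subtype.ext hw
      rw [hw']
      rcases hω₂e with h | h
      · rw [ha_of_A _ h, hexpL]; exact h.symm
      · rw [ha_of_A' _ h, hexpL']; exact h.symm
  have hrel1 := hrel (εu 1) a hexp_a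
  rw [Finset.univ_eq_empty, Finset.sum_empty, zero_add, sum_complexPlaces_eq h01 h02 h12 hall] at hrel1
  -- the integers and the values of `s` at the six embeddings
  have hs0 : s ω₀.embedding = 1 / 2 := by simp [hs, mk_embedding]
  have hs0' : s (ComplexEmbedding.conjugate ω₀.embedding) = 1 / 2 := by rw [hsconj, hs0]
  have hs1 : s ω₁.embedding = 0 := by simp [hs, mk_embedding, h01.symm]
  have hs1' : s (ComplexEmbedding.conjugate ω₁.embedding) = 0 := by rw [hsconj, hs1]
  have hs2 : s ω₂.embedding = 0 := by simp [hs, mk_embedding, h02.symm]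
  have hs2' : s (ComplexEmbedding.conjugate ω₂.embedding) = 0 := by rw [hsconj, hs2]
  have hP0 : Pf ω₀.embedding = n ω₀.embedding := by
    have := hn ω₀.embedding; rw [hs0] at this; linear_combination this
  have hP0' : Pf (ComplexEmbedding.conjugate ω₀.embedding) = n (ComplexEmbedding.conjugate ω₀.embedding) := by
    have := hn (ComplexEmbedding.conjugate ω₀.embedding); rw [hs0'] at this; linear_combination this
  have hP1 : Pf ω₁.embedding = n ω₁.embedding + 1 / 2 := by
    have := hn ω₁.embedding; rw [hs1] at this; linear_combination this
  have hP1' : Pf (ComplexEmbedding.conjugate ω₁.embedding) =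
      n (ComplexEmbedding.conjugate ω₁.embedding) + 1 / 2 := by
    have := hn (ComplexEmbedding.conjugate ω₁.embedding); rw [hs1'] at this; linear_combination this
  have hP2 : Pf ω₂.embedding = n ω₂.embedding + 1 / 2 := by
    have := hn ω₂.embedding; rw [hs2] at this; linear_combination this
  have hP2' : Pf (ComplexEmbedding.conjugate ω₂.embedding) =
      n (ComplexEmbedding.conjugate ω₂.embedding) + 1 / 2 := by
    have := hn (ComplexEmbedding.conjugate ω₂.embedding); rw [hs2'] at this; linear_combination this
  -- parallel weights: `n₀ + n₀' = n₁ + n₁' + 1 = n₂ + n₂' + 1`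
  have hw0 := hpar cω₀ _ _ rfl rfl
  have hw1 := hpar cω₁ _ _ rfl rfl
  have hw2 := hpar cω₂ _ _ rfl rfl
  change (Pf ω₀.embedding + Pf (ComplexEmbedding.conjugate ω₀.embedding)).re = 2 * ρ at hw0
  change (Pf ω₁.embedding + Pf (ComplexEmbedding.conjugate ω₁.embedding)).re = 2 * ρ at hw1
  change (Pf ω₂.embedding + Pf (ComplexEmbedding.conjugate ω₂.embedding)).re = 2 * ρ at hw2
  rw [hP0, hP0'] at hw0
  rw [hP1, hP1'] at hw1
  rw [hP2, hP2'] at hw2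
  simp only [Complex.add_re, Complex.intCast_re, Complex.div_re, Complex.one_re] at hw0 hw1 hw2
  have hN1 : (n ω₀.embedding : ℂ) + n (ComplexEmbedding.conjugate ω₀.embedding) =
      n ω₁.embedding + n (ComplexEmbedding.conjugate ω₁.embedding) + 1 := by
    have h : (n ω₀.embedding : ℝ) + n (ComplexEmbedding.conjugate ω₀.embedding) =
        n ω₁.embedding + n (ComplexEmbedding.conjugate ω₁.embedding) + 1 := by
      norm_num at hw0 hw1; linarith
    exact_mod_cast congrArg (fun x : ℝ => (x : ℂ)) h
  have hN2 : (n ω₀.embedding : ℂ) + n (ComplexEmbedding.conjugate ω₀.embedding) =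
      n ω₂.embedding + n (ComplexEmbedding.conjugate ω₂.embedding) + 1 := by
    have h : (n ω₀.embedding : ℝ) + n (ComplexEmbedding.conjugate ω₀.embedding) =
        n ω₂.embedding + n (ComplexEmbedding.conjugate ω₂.embedding) + 1 := by
      norm_num at hw0 hw2; linarith
    exact_mod_cast congrArg (fun x : ℝ => (x : ℂ)) h
  -- logarithms at `ω₀`, `ω₂` are `L` or `L̄`
  have ha0 : a cω₀ = L ∨ a cω₀ = conj L := by
    rcases hω₀e with h | h
    · exact Or.inl (ha_of_A _ h)
    · exact Or.inr (ha_of_A' _ h)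
  have ha2 : a cω₂ = L ∨ a cω₂ = conj L := by
    rcases hω₂e with h | h
    · exact Or.inl (ha_of_A _ h)
    · exact Or.inr (ha_of_A' _ h)
  -- the odd relation and the contradiction
  obtain ⟨m, hm⟩ := sextic_odd_relation L (a cω₀) (a cω₁) (a cω₂) _ _ _ _ _ _ _ _ _ _ _ _ ha1
    hP0 hP0' hP1 hP1' hP2 hP2' hN1 hN2 ha0 ha2
  obtain ⟨N, hN, hpow⟩ := pow_eq_conj_pow_of_exp_eq_one hM hrel1 hm
  rw [hexpL] at hpow
  exact Aval_pow_ne_conj_pow hN hpow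


/-! ## §11b CM blindness is genuinely CM (gen 2): the lever `(m,t) ↦ (m', t/2)` of card
## torsion-blind-unit-criterion FAILS over the non-CM `K₆` (landed with §11 in `Negative/TotallyComplexNonCM.lean`) -/

/-- **CM blindness is genuinely CM**: the lever of card torsion-blind-unit-criterion — over a CM field Weil's
unit product is blind to the angular exponents, so `(m, t) ↦ (m', t/2)` preserves Weil's hypothesis
(`weilHypothesis_blind_halve`, proved there from Mathlib's `IsCMField.unitsMulComplexConjInv`) — FAILS over
a totally complex NON-CM field: over `K₆ = ℚ(ζ₃, ∛2)` the trivial type `(0, 0)` satisfies Weil's hypothesis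
but the angular type `(𝟙_{mk ι₀}, 0)` does not, because `(σ(ε₁)/|σ(ε₁)|)^M = 1` would give `A^M = Ā^M`
(`Aval_pow_ne_conj_pow`). [folklore] -/
theorem not_weilHypothesis_blind_of_isTotallyComplex :
    ¬ (∀ (K : Type) [Field K] [NumberField K] [IsTotallyComplex K] (m m' : InfinitePlace K → ℤ)
        (t : InfinitePlace K → ℝ),
        (∃ M : ℕ, 0 < M ∧ ∀ α : (𝓞 K)ˣ, (∏ w : InfinitePlace K,
          archUnitaryValue (m w) (t w) (w.embedding ((α : 𝓞 K) : K))) ^ M = 1) →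
        (∃ M : ℕ, 0 < M ∧ ∀ α : (𝓞 K)ˣ, (∏ w : InfinitePlace K,
          archUnitaryValue (m' w) (t w / 2) (w.embedding ((α : 𝓞 K) : K))) ^ M = 1)) := by
  intro h
  have h0 : ∀ z : ℂ, archUnitaryValue 0 0 z = 1 := fun z => by simp [archUnitaryValue]
  obtain ⟨M, hM, hrel⟩ := h K₆ (fun _ => 0) (fun w => if w = mk ι₀ then 1 else 0) (fun _ => 0)
    ⟨1, one_pos, fun α => by simp [h0]⟩
  have hα := hrel (εu 1)
  rw [Finset.prod_eq_single (mk ι₀) (fun w _ hw => by rw [if_neg hw, zero_div, h0])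
    (fun hh => absurd (Finset.mem_univ _) hh), if_pos rfl, zero_div] at hα
  -- `(z/|z|)^M = 1` for `z = σ(ε₁) ∈ {A, Ā}`
  set z : ℂ := (mk ι₀).embedding ((((εu 1 : (𝓞 K₆)ˣ) : 𝓞 K₆) : K₆)) with hz
  have hzA : z = Aval ∨ z = conj Aval := e₁_eq_or (Or.inl rfl) embedding_mk_ι₀_γ_zero
  have hz0 : z ≠ 0 := by
    rcases hzA with h' | h' <;> rw [h']
    · exact Aval_ne_zero
    · exact (_root_.map_ne_zero _).mpr Aval_ne_zero
  have hzn : (‖z‖ : ℂ) ≠ 0 := by exact_mod_cast norm_ne_zero_iff.mpr hz0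
  have hval : archUnitaryValue 1 0 z = z / (‖z‖ : ℂ) := by
    simp [archUnitaryValue]
  rw [hval, div_pow, div_eq_one_iff_eq (pow_ne_zero _ hzn)] at hα
  -- `z^M` is real, hence `z^M = z̄^M`, i.e. `A^M = Ā^M`
  have hreal : conj (z ^ M) = z ^ M := by rw [hα, ← Complex.ofReal_pow, Complex.conj_ofReal]
  rw [map_pow] at hreal
  rcases hzA with h' | h'
  · rw [h'] at hreal
    exact Aval_pow_ne_conj_pow hM hreal.symm
  · rw [h', Complex.conj_conj] at hreal
    exact Aval_pow_ne_conj_pow hM hreal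

end Summit.Langlands.Langlands.Cruxes.HalfIntegralTwistCM.Disproof
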